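/-
Copyright: cell `langlands-arthur-audit` (papers/Langlands/langlands-arthur-audit), unit `pub-arthur-down-g68`
(downstream tracer, gen 68).  Eighteenth file of the exact-support certificates of the downstream register (module M309 of the cell's MODULE-MAP — CLAIMed in
`lean/MODULE-MAP3.md` 2026-08-27).  `DownstreamSupport17.lean` (module M305, sections 149–159: the supports of tranches 147–157) stands at v11 = 147,004 B = 73.5 % of the
gate's 200,000-byte bound and is left for at most one small section; this file continues APPEND-ONLY in the same conventions and the same namespace
`…Arthur2013.Downstream.Support`, importing `…DownstreamSupport17` (through it every earlier support file: the canonical readings `canon` (section 1), `canon₈` / `canon₈no`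
(section 8), `canon₁₃` (section 13), `canon₄₅S` / `canon₁₅₃` (section 155), `canon₄₇F` / `canon₄₈F` (section 156) with their `canon_implications…`, the tops `νtop` / `μtop` /
`κtop`, `κnoMok`, `bookInputs_top`, `mokInputs_top`, `kmswInputs_top`, `not_B_cm`, `not_M_cm`, `scope_of_onlyFull`, the carver's `LeafSupport` certificates) and the register head
`…Downstream44`.  A SUPPORT STATEMENT, as before, is a kernel-checked fact about the canonical (minimal) reading of a tranche: each typed statement := exactly the conjunction
of the register inputs its edges name; « at the top » = every atom of the three DAGs true; « countermodel of leaf l » = the carver's assignment in which every edge of the DAG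
holds, every other leaf holds and l fails.  Nothing of sections 1–159 is redeclared or changed.
v1 = section 160 (tranche 158, `Downstream44.lean` v4: NEW row B132 W. T. Gan – B. H. Gross – D. Prasad, Compositio Math. 156 (2020) = arXiv:1911.02783 — node `GGPntLLC`
(§2 standing input ⇐ the book ∧ the Chapter-9 leaf ∧ Mok ∧ KMSW's proved scope ∧ E43), Theorem 7.7 ⇐ node ∧ B70 ∧ B71, Proposition 8.2 ⇐ node ∧ A8-p (orthogonal),
Theorem 11.17 ⇐ node ∧ B75 (symplectic / orthogonal families) ∧ B7 (Sp – O), control Theorem 9.7 premise-free).v2 (same unit) = section 161 appended (tranche 159, `Downstream44.lean` v5: NEW rows B133 Bin Xu, Math. Z. 297 (2021) ⇐ the book ∧ B75 quasi-split ∧ B2 ∧ B109; B134 M. Tadić,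
manuscripta math. 169 (2021) ⇐ the book ∧ B70 ∧ B71 ∧ B75 quasi-split ∧ B2 (∧ B108 for its Theorem 1.1)); nothing of v1 redeclared or changed, no new import.
v3 (same unit) = section 162 appended (tranche 160, `Downstream44.lean` v6: NEW rows B135 F. Chen – W.-W. Li, Peking Math. J. 2025 ⇐ the book ∧ A5 ∧ A8-p ∧ B10 ∧ B11 ∧ B112 ∧ B8 ∧ B57;
B136 Kim – Krishnamurthy – Shahidi 2025 preprint ⇐ Mok alone, with two premise-free controls); nothing of v1 – v2 redeclared or changed, no new import.
v4 (same unit) = sections 163 and 164 appended (tranches 161 / 162, NEW `Downstream45.lean` v1 / v2: rows B137 K. Choiy – D. Goldberg 2016 ⇐ Mok ∧ KMSW proved scope, no book;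
B138 J. Hundley – S. D. Miller, Amer. J. Math. 2022 ⇐ the book for its classical cases, exceptional part a control); ADDS `import …Downstream45` (the register head, module M310);
nothing of v1 – v3 redeclared or changed.
v5 (unit `pub-arthur-down-g69`, downstream tracer gen 69) = section 165 appended (tranche 163, `Downstream45.lean` v3: row C143 Liu – Tian – Xiao – Zhang – Zhu, Acta Math. Sin.
(Engl. Ser.) 40 (2024) ⇐ Mok ∧ KMSW proved scope, no book, its rigidity theorem a control; NEW row B139 Y. Mieda, Math. Res. Lett. 28 (2021) ⇐ the book ∧ row B30, its Galois-side
theorem a control); nothing of v1 – v4 redeclared or changed, no new import.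
v6 (same unit) = section 166 appended (tranche 164, `Downstream45.lean` v4: NEW rows C318 Anandavardhanan – Matringe, Adv. Math. 360 (2020) ⇐ Mok ∧ row C25, finite-field theorem a
control; C319 Hernandez – Schraen, arXiv:2210.10564v2 (2023, preprint) ⇐ Mok ∧ its own Theorem 8.8, the latter a control); nothing of v1 – v5 redeclared or changed, no new import.
v7 (same unit) = section 167 appended (tranche 165, `Downstream45.lean` v5: NEW row B140 M. Hanzer, arXiv:2510.10389v2 (2025, preprint) ⇐ the book ∧ B110 ∧ C168 ∧ B2 ∧ B5 ∧ B89 ∧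
Mœglin – Tadić ∧ B7 (Sp – O) ∧ B111 — the 24 book leaves modulo B75's granted remainder, no Mok / KMSW); nothing of v1 – v6 redeclared or changed, no new import.
v8 (same unit) = section 168 appended (tranche 166, `Downstream45.lean` v6: NEW rows C320 Cléry – van der Geer / Chenevier's appendices, Doc. Math. 23 (2018) ⇐ the book ∧ C5★, and C321
S. Tang, JTNB 33 (2021) ⇐ the book ∧ C10 — the 24 book leaves, no Mok / KMSW; one new abbrev `c₁noC10`); nothing of v1 – v7 redeclared or changed, no new import.
v9 (unit `pub-arthur-down-g70`, downstream tracer gen 70) = section 169 appended (tranche 167, NEW `Downstream46.lean` v1: NEW row B141 C. Blondel – G. K.-F. Tam, J. reine angew. Math.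
774 (2021): Thm 3.9 = Thm 1.1 in its quasi-split case ⇐ E43 ∧ E41 — exactly ten book leaves, no book theorem, no Mok / KMSW —, in its non-quasi-split case ⇐ A8-p as printed — the 24 book
leaves ∧ Mok ∧ KMSW's proved scope —, Rem. 3.11 ⇐ E43 ∧ the theorem, two controls); ADDS `import …Downstream46` (the register head, module M311); nothing of v1 – v8 redeclared or changed.
v10 (same unit) = section 170 appended (tranche 168, `Downstream46.lean` v2: NEW rows C322 Dittmann – Salvati Manni – Scheithauer, Algebra Number Theory 15 (2021) ⇐ rows C4 / C6, and C323
R. Hain, Forum Math. Sigma 13 (2025) ⇐ row C4 — the 24 book leaves, no Mok / KMSW; one new abbrev `c₁noC4`); nothing of v1 – v9 redeclared or changed, no new import.  THIS FILE IS NOW CLOSED (≈ 80 % of the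
byte bound): the next support section opens `DownstreamSupport19.lean` (module M312).
-/
import HarnessLib
import Literature.NumberTheory.Automorphic.Arthur2013.DownstreamSupport17
import Literature.NumberTheory.Automorphic.Arthur2013.Downstream44
import Literature.NumberTheory.Automorphic.Arthur2013.Downstream45
import Literature.NumberTheory.Automorphic.Arthur2013.Downstream46

set_option autoImplicit false

namespace Literature.NumberTheory.Automorphic.Arthur2013

namespace Downstream

namespace Support

/-! ## 160. Hundred-and-fifty-eighth tranche (v1 of this file, after `Downstream44.lean` v4; unit `pub-arthur-down-g68`): supports of NEW row B132 (W. T. Gan – B. H. Gross – D. Prasad,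
*Branching laws for classical groups: the non-tempered case*, Compositio Math. 156 (2020) 2298–2367).  The canonical reading `canon₁₅₈ ν μ κ g c₈ c₅₄` (over an ARBITRARY tranche-8
assignment `c₈` — Chapter-9 leaf granted: `canon₈`; denied: `canon₈no` — and an arbitrary tranche-54 assignment `c₅₄`, of which only row B7's Sp – O instance `AtobeGanThetaSpO` is
read; B70 / B71 in section 156's family readings `canon₄₈F` / `canon₄₇F`, B75's instances in section 155's `canon₄₅S ν κ g` / `canon₁₅₃ ν κ c g`, A8-p in section 13's `canon₁₃`):
node := the book ∧ `c₈.InnerTwists` ∧ Mok ∧ KMSW-scope ∧ E43's five published leaves; Theorem 7.7 := node ∧ B70's value ∧ B71's value; Proposition 8.2 := node ∧ A8-p's orthogonal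
value; Theorem 11.17 := node ∧ B75 quasi-split ∧ B75 non-quasi-split orthogonal ∧ `c₅₄.AtobeGanThetaSpO`; Theorem 9.7 := `True`.  Every tranche-158 edge holds in it for every ν, μ,
κ, g, c₈, c₅₄ (`canon_implications₁₅₈`).  READINGS: (i) AT THE TOP (Chapter-9 leaf granted, g denied, c₅₄ := section 54's `canon₅₄ νtop`) the node and all four theorems HOLD —
delivered by the tranche's own `ggpntLLC_of_inputs` / `ggpnt_of_node` from the canonical bundles of tranches 1, 13, 45 (instantiated), 47 / 48 (family), 153, 154 and the top inputs
of the three DAGs — while B75's node FAILS in the same reading: no Mœglin standing hypothesis and no general-spin residue in B132's support (`c158_top`); (ii) in each of the 24 BOOK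
countermodels the node and the three consumer theorems FAIL, the control holds (`c158_book_cm`); (iii) with the CHAPTER-9 LEAF DENIED they fail for every ν, μ, κ, g, c₅₄
(`c158_ch9_denied`) — [A28] is load-bearing through the node; (iv) in each of Mok's 29 countermodels (book at the top, KMSW read `κnoMok`) they FAIL (`c158_mok_cm`) — Mok's leaves
are load-bearing through the node's supplier sentence, unlike rows B16 / B10 / B47 of sections 157–159; (v) in KMSW's countermodel of a KMSW leaf l (book and Mok at the top) the
node holds iff l is a sequel-only leaf (`c158_kmsw_cm_iff`): KMSW's proved-scope leaves are load-bearing, its sequels [KMS_A] / [KMS_B] are not; (vi) the control field holds in every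
reading (`c158_control`).  Supports, exact: support(`GGPntLLC`) = support(Thm 7.7) = support(Prop. 8.2) = support(Thm 11.17) = the 24 book leaves ∧ the leaf `InnerTwists` ∧ Mok's
29 leaves ∧ KMSW's proved-scope leaves; support(Thm 9.7) = ∅. -/

section Canon158

variable (ν : Nodes) (μ : Mok2015.Nodes) (κ : KMSW2014.Nodes) (g : Prop)

/-- The canonical reading of NEW row B132 over arbitrary tranche-8 and tranche-54 assignments: node := the book ∧ the Chapter-9 leaf ∧ Mok ∧ KMSW-scope ∧ E43's five published
leaves; Theorem 7.7 := node ∧ B70 ∧ B71 (section 156's family values); Proposition 8.2 := node ∧ A8-p's orthogonal value (section 13); Theorem 11.17 := node ∧ B75 quasi-split ∧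
B75 non-quasi-split orthogonal (sections 155) ∧ `c₅₄.AtobeGanThetaSpO`; Theorem 9.7 := `True`. [cite: GanGrossPrasad2020, §2, Thm 7.7, Prop. 8.2, Thm 11.17, Thm 9.7 (canonical model; bookkeeping)] [claim: KalethaMinguezShinWhite2014, under-review] -/
abbrev canon₁₅₈ (c₈ : Consumers8) (c₅₄ : Consumers54) : Consumers158 where
  GGPntLLC := (∀ N, ν.Everything N) ∧ c₈.InnerTwists ∧ (∀ N, μ.Everything N) ∧ (∀ N, κ.Scope N) ∧ (ν.LLC_GLN ∧ ν.FL ∧ ν.Transfer ∧ ν.InvariantTF ∧ ν.TwistedTF)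
  GGPntSupercuspidal := ((∀ N, ν.Everything N) ∧ c₈.InnerTwists ∧ (∀ N, μ.Everything N) ∧ (∀ N, κ.Scope N) ∧ (ν.LLC_GLN ∧ ν.FL ∧ ν.Transfer ∧ ν.InvariantTF ∧ ν.TwistedTF)) ∧
    (canon₄₈F ν κ g).MoeglinElementary ∧ (canon₄₇F ν κ).MoeglinDiscretePackets
  GGPntMoeglinCase := ((∀ N, ν.Everything N) ∧ c₈.InnerTwists ∧ (∀ N, μ.Everything N) ∧ (∀ N, κ.Scope N) ∧ (ν.LLC_GLN ∧ ν.FL ∧ ν.Transfer ∧ ν.InvariantTF ∧ ν.TwistedTF)) ∧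
    (canon₁₃ ν κ).MRpadicOrth
  GGPntThetaDistinguished := ((∀ N, ν.Everything N) ∧ c₈.InnerTwists ∧ (∀ N, μ.Everything N) ∧ (∀ N, κ.Scope N) ∧ (ν.LLC_GLN ∧ ν.FL ∧ ν.Transfer ∧ ν.InvariantTF ∧ ν.TwistedTF)) ∧
    (∀ N, ν.Everything N) ∧ ((∀ N, ν.Everything N) ∧ (canon₁₃ ν κ).MRpadicOrth) ∧ c₅₄.AtobeGanThetaSpO
  GGPntLvalues := True

/-- Every hundred-and-fifty-eighth-tranche edge holds in the canonical reading, for arbitrary ν, μ, κ, g, c₈, c₅₄ (read against sections 13 / 155 / 156's `canon₁₃`, `canon₄₅S`,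
`canon₁₅₃`, `canon₄₇F`, `canon₄₈F`; E43's value is `canon₄₅S`'s `MoeglinUnitaryDS`). [cite: GanGrossPrasad2020, §2, Thm 7.7, Prop. 8.2, Thm 11.17, Thm 9.7 (bookkeeping proved here)] -/
theorem canon_implications₁₅₈ (c : Consumers) (c₈ : Consumers8) (c₅₄ : Consumers54) :
    Implications158 ν μ κ c₈ (canon₁₃ ν κ) (canon₄₅S ν κ g) (canon₄₇F ν κ) (canon₄₈F ν κ g) c₅₄ (canon₁₅₃ ν κ c g) (canon₁₅₈ ν μ κ g c₈ c₅₄) where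
  llc := fun b n m k u => ⟨b, n, m, k, u⟩
  supercuspidal := fun n e d => ⟨n, e, d⟩
  moeglinCase := fun n o => ⟨n, o⟩
  theta := fun n qs o a => ⟨n, qs, o, a⟩
  lvalues := True.intro

end Canon158

/-- AT THE TOP (Chapter-9 leaf GRANTED via `canon₈`, general-spin instance DENIED, c₅₄ := section 54's `canon₅₄ νtop`): the node and all four theorems of row B132 HOLD — the node by
the tranche's `ggpntLLC_of_inputs` from the top inputs of the three DAGs, the three consumer theorems by its `ggpnt_of_node` fed with B70 / B71 (tranche 154's
`moeglinPackets_of_inputs_2026`), A8-p's orthogonal value (`mrpadicOrth_of_leaves`), B75's symplectic / orthogonal statements (`moeglinOrthSymp_of_inputs`) and B7's instance (the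
book at the top), all over the canonical bundles —, while B75's NODE and B75 AS PRINTED FAIL in the same reading: neither Mœglin's standing hypothesis nor its general-spin instance
is in B132's support. [cite: GanGrossPrasad2020, §2 (arXiv:1911.02783v2 p0009:L2-3), Thm 7.7, Prop. 8.2, Thm 11.17 (separating model; bookkeeping proved here)] [claim: KalethaMinguezShinWhite2014, under-review] -/
theorem c158_top :
    Implications158 νtop μtop κtop (canon₈ νtop μtop κtop) (canon₁₃ νtop κtop) (canon₄₅S νtop κtop False) (canon₄₇F νtop κtop) (canon₄₈F νtop κtop False) (canon₅₄ νtop)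
        (canon₁₅₃ νtop κtop (canon νtop μtop κtop) False) (canon₁₅₈ νtop μtop κtop False (canon₈ νtop μtop κtop) (canon₅₄ νtop)) ∧
      ((canon₁₅₈ νtop μtop κtop False (canon₈ νtop μtop κtop) (canon₅₄ νtop)).GGPntLLC ∧
        (canon₁₅₈ νtop μtop κtop False (canon₈ νtop μtop κtop) (canon₅₄ νtop)).GGPntSupercuspidal ∧
        (canon₁₅₈ νtop μtop κtop False (canon₈ νtop μtop κtop) (canon₅₄ νtop)).GGPntMoeglinCase ∧
        (canon₁₅₈ νtop μtop κtop False (canon₈ νtop μtop κtop) (canon₅₄ νtop)).GGPntThetaDistinguished ∧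
        (canon₁₅₈ νtop μtop κtop False (canon₈ νtop μtop κtop) (canon₅₄ νtop)).GGPntLvalues) ∧
      (¬ (canon₄₅S νtop κtop False).MoeglinDSHyp ∧ ¬ (canon₄₅S νtop κtop False).MoeglinMult1) :=
  have Y := canon_implications₁₅₈ νtop μtop κtop False (canon νtop μtop κtop) (canon₈ νtop μtop κtop) (canon₅₄ νtop)
  have V := canon_implications₄₅S νtop μtop κtop False
  have X := canon_implications₁₅₃ νtop κtop (canon νtop μtop κtop) False
  have I := canon_implications νtop μtop κtop
  have G := canon_implications₁₃ νtop μtop κtop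
  have n := ggpntLLC_of_inputs Y V bookInputs_top mokInputs_top (kmswInputs_top μtop).1 True.intro
  have p := moeglinPackets_of_inputs_2026 (canon_implications₁₅₄ νtop κtop (canon νtop μtop κtop) False) (canon_implications₄₇F νtop κtop False) (canon_implications₄₈F νtop κtop False)
    V X I G bookInputs_top
  have o := (moeglinOrthSymp_of_inputs X V I G bookInputs_top).2
  have t := ggpnt_of_node Y n p.2.2.2.2 p.2.1 (mrpadicOrth_of_leaves I G bookInputs_top) o.1 o.2.1 bookInputs_top.everything
  ⟨Y, ⟨n, t.1, t.2.1, t.2.2, True.intro⟩, ⟨fun x => x.2.2, fun x => x.2.2⟩⟩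

/-- Book-countermodel instance of the canonical reading (Mok, KMSW at the top; Chapter-9 leaf granted; g granted; c₅₄ := `canon₅₄` of the countermodel). [cite: GanGrossPrasad2020, §2 (separating models; bookkeeping)] -/
abbrev cm₁₅₈ (l : LeafSupport.Leaf) : Consumers158 :=
  canon₁₅₈ (LeafSupport.mkN (LeafSupport.cm l)) μtop κtop True (canon₈ (LeafSupport.mkN (LeafSupport.cm l)) μtop κtop) (canon₅₄ (LeafSupport.mkN (LeafSupport.cm l)))

/-- BOOK SIDE: in the book countermodel of ANY of the 24 leaves `l` (Mok, KMSW at the top; Chapter-9 leaf and g granted) the tranche's bundle holds and the node, Theorem 7.7,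
Proposition 8.2, Theorem 11.17 all FAIL; Theorem 9.7 holds.  All 24 book leaves are load-bearing for row B132's classification-dependent statements. [cite: GanGrossPrasad2020, §2 (p0008:L38-41), Thm 7.7, Prop. 8.2, Thm 11.17 (bookkeeping proved here)] -/
theorem c158_book_cm (l : LeafSupport.Leaf) :
    ¬ (LeafSupport.mkN (LeafSupport.cm l)).leaf l ∧
      Implications158 (LeafSupport.mkN (LeafSupport.cm l)) μtop κtop (canon₈ (LeafSupport.mkN (LeafSupport.cm l)) μtop κtop) (canon₁₃ (LeafSupport.mkN (LeafSupport.cm l)) κtop)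
        (canon₄₅S (LeafSupport.mkN (LeafSupport.cm l)) κtop True) (canon₄₇F (LeafSupport.mkN (LeafSupport.cm l)) κtop) (canon₄₈F (LeafSupport.mkN (LeafSupport.cm l)) κtop True)
        (canon₅₄ (LeafSupport.mkN (LeafSupport.cm l))) (canon₁₅₃ (LeafSupport.mkN (LeafSupport.cm l)) κtop (canon (LeafSupport.mkN (LeafSupport.cm l)) μtop κtop) True) (cm₁₅₈ l) ∧
      (¬ (cm₁₅₈ l).GGPntLLC ∧ ¬ (cm₁₅₈ l).GGPntSupercuspidal ∧ ¬ (cm₁₅₈ l).GGPntMoeglinCase ∧ ¬ (cm₁₅₈ l).GGPntThetaDistinguished) ∧ (cm₁₅₈ l).GGPntLvalues :=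
  have nb := not_B_cm l
  ⟨(LeafSupport.countermodel l).2.2.1,
    canon_implications₁₅₈ (LeafSupport.mkN (LeafSupport.cm l)) μtop κtop True (canon (LeafSupport.mkN (LeafSupport.cm l)) μtop κtop) (canon₈ (LeafSupport.mkN (LeafSupport.cm l)) μtop κtop)
      (canon₅₄ (LeafSupport.mkN (LeafSupport.cm l))),
    ⟨fun h => nb h.1, fun h => nb h.1.1, fun h => nb h.1.1, fun h => nb h.1.1⟩, True.intro⟩

/-- CHAPTER-9 LEAF DENIED (`canon₈no`), for EVERY ν, μ, κ, g, c, c₅₄: the bundle holds and the node, Theorem 7.7, Proposition 8.2, Theorem 11.17 FAIL — [A28] (inner twists, unwritten)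
is load-bearing for row B132 through the node's [Art2] premise for the pure inner forms of the orthogonal groups. [cite: GanGrossPrasad2020, §2 (p0008:L40-41, p0009:L2-3); Arthur2013, Foreword p. xvii ([A28]) (separating model; bookkeeping proved here)] -/
theorem c158_ch9_denied (ν : Nodes) (μ : Mok2015.Nodes) (κ : KMSW2014.Nodes) (g : Prop) (c : Consumers) (c₅₄ : Consumers54) :
    Implications158 ν μ κ (canon₈no ν μ) (canon₁₃ ν κ) (canon₄₅S ν κ g) (canon₄₇F ν κ) (canon₄₈F ν κ g) c₅₄ (canon₁₅₃ ν κ c g) (canon₁₅₈ ν μ κ g (canon₈no ν μ) c₅₄) ∧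
      (¬ (canon₁₅₈ ν μ κ g (canon₈no ν μ) c₅₄).GGPntLLC ∧ ¬ (canon₁₅₈ ν μ κ g (canon₈no ν μ) c₅₄).GGPntSupercuspidal ∧
        ¬ (canon₁₅₈ ν μ κ g (canon₈no ν μ) c₅₄).GGPntMoeglinCase ∧ ¬ (canon₁₅₈ ν μ κ g (canon₈no ν μ) c₅₄).GGPntThetaDistinguished) :=
  ⟨canon_implications₁₅₈ ν μ κ g c (canon₈no ν μ) c₅₄, ⟨fun h => h.2.1, fun h => h.1.2.1, fun h => h.1.2.1, fun h => h.1.2.1⟩⟩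

/-- MOK SIDE: book at the top, Mok's countermodel of ANY of the 29 Mok leaves `l` (KMSW read `κnoMok`; Chapter-9 leaf and g granted): the bundle holds and the node, Theorem 7.7,
Proposition 8.2, Theorem 11.17 FAIL — Mok's leaves are load-bearing through the node's supplier sentence « Mok [ Mok ] for unitary groups », although the three typed theorems
concern special orthogonal groups (the authors' own frame: « We will assume this through the work »). [cite: GanGrossPrasad2020, §2 (p0008:L38-41, p0009:L2-3) (separating model; bookkeeping proved here)] -/
theorem c158_mok_cm (l : Mok2015.LeafSupport.Leaf) (c₅₄ : Consumers54) :
    ¬ (Mok2015.LeafSupport.mkN (Mok2015.LeafSupport.cm l)).leaf l ∧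
      Implications158 νtop (Mok2015.LeafSupport.mkN (Mok2015.LeafSupport.cm l)) κnoMok (canon₈ νtop (Mok2015.LeafSupport.mkN (Mok2015.LeafSupport.cm l)) κnoMok) (canon₁₃ νtop κnoMok)
        (canon₄₅S νtop κnoMok True) (canon₄₇F νtop κnoMok) (canon₄₈F νtop κnoMok True) c₅₄ (canon₁₅₃ νtop κnoMok (canon νtop (Mok2015.LeafSupport.mkN (Mok2015.LeafSupport.cm l)) κnoMok) True)
        (canon₁₅₈ νtop (Mok2015.LeafSupport.mkN (Mok2015.LeafSupport.cm l)) κnoMok True (canon₈ νtop (Mok2015.LeafSupport.mkN (Mok2015.LeafSupport.cm l)) κnoMok) c₅₄) ∧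
      (¬ (canon₁₅₈ νtop (Mok2015.LeafSupport.mkN (Mok2015.LeafSupport.cm l)) κnoMok True (canon₈ νtop (Mok2015.LeafSupport.mkN (Mok2015.LeafSupport.cm l)) κnoMok) c₅₄).GGPntLLC ∧
        ¬ (canon₁₅₈ νtop (Mok2015.LeafSupport.mkN (Mok2015.LeafSupport.cm l)) κnoMok True (canon₈ νtop (Mok2015.LeafSupport.mkN (Mok2015.LeafSupport.cm l)) κnoMok) c₅₄).GGPntSupercuspidal ∧
        ¬ (canon₁₅₈ νtop (Mok2015.LeafSupport.mkN (Mok2015.LeafSupport.cm l)) κnoMok True (canon₈ νtop (Mok2015.LeafSupport.mkN (Mok2015.LeafSupport.cm l)) κnoMok) c₅₄).GGPntMoeglinCase ∧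
        ¬ (canon₁₅₈ νtop (Mok2015.LeafSupport.mkN (Mok2015.LeafSupport.cm l)) κnoMok True (canon₈ νtop (Mok2015.LeafSupport.mkN (Mok2015.LeafSupport.cm l)) κnoMok) c₅₄).GGPntThetaDistinguished) :=
  have nm := not_M_cm l
  ⟨(Mok2015.LeafSupport.countermodel l).2.2.1,
    canon_implications₁₅₈ νtop (Mok2015.LeafSupport.mkN (Mok2015.LeafSupport.cm l)) κnoMok True (canon νtop (Mok2015.LeafSupport.mkN (Mok2015.LeafSupport.cm l)) κnoMok)
      (canon₈ νtop (Mok2015.LeafSupport.mkN (Mok2015.LeafSupport.cm l)) κnoMok) c₅₄,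
    ⟨fun h => nm h.2.2.1, fun h => nm h.1.2.2.1, fun h => nm h.1.2.2.1, fun h => nm h.1.2.2.1⟩⟩

/-- KMSW SIDE: book and Mok at the top, KMSW's countermodel of a KMSW leaf `l` (Chapter-9 leaf and g granted, c₅₄ := `canon₅₄ νtop`): the bundle holds, and the node — hence each of
Theorem 7.7, Proposition 8.2, Theorem 11.17 — HOLDS IFF `l` is a sequel-only leaf ([KMS_A] / [KMS_B] / Aubert's involution are not consumed by KMSW's proved scope): KMSW's
proved-scope leaves are load-bearing, its sequels are not (the node takes `κ.Scope`, not `κ.Full`). [cite: GanGrossPrasad2020, §2 (p0009:L2-3) (separating models; bookkeeping proved here)] [claim: KalethaMinguezShinWhite2014, under-review] -/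
theorem c158_kmsw_cm_iff (l : KMSW2014.LeafSupport.Leaf) :
    Implications158 νtop μtop (KMSW2014.LeafSupport.mkN (KMSW2014.LeafSupport.cm l)) (canon₈ νtop μtop (KMSW2014.LeafSupport.mkN (KMSW2014.LeafSupport.cm l)))
        (canon₁₃ νtop (KMSW2014.LeafSupport.mkN (KMSW2014.LeafSupport.cm l))) (canon₄₅S νtop (KMSW2014.LeafSupport.mkN (KMSW2014.LeafSupport.cm l)) True)
        (canon₄₇F νtop (KMSW2014.LeafSupport.mkN (KMSW2014.LeafSupport.cm l))) (canon₄₈F νtop (KMSW2014.LeafSupport.mkN (KMSW2014.LeafSupport.cm l)) True) (canon₅₄ νtop)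
        (canon₁₅₃ νtop (KMSW2014.LeafSupport.mkN (KMSW2014.LeafSupport.cm l)) (canon νtop μtop (KMSW2014.LeafSupport.mkN (KMSW2014.LeafSupport.cm l))) True)
        (canon₁₅₈ νtop μtop (KMSW2014.LeafSupport.mkN (KMSW2014.LeafSupport.cm l)) True (canon₈ νtop μtop (KMSW2014.LeafSupport.mkN (KMSW2014.LeafSupport.cm l))) (canon₅₄ νtop)) ∧
      ((canon₁₅₈ νtop μtop (KMSW2014.LeafSupport.mkN (KMSW2014.LeafSupport.cm l)) True (canon₈ νtop μtop (KMSW2014.LeafSupport.mkN (KMSW2014.LeafSupport.cm l))) (canon₅₄ νtop)).GGPntLLC ↔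
        l.onlyFull = true) ∧
      ((canon₁₅₈ νtop μtop (KMSW2014.LeafSupport.mkN (KMSW2014.LeafSupport.cm l)) True (canon₈ νtop μtop (KMSW2014.LeafSupport.mkN (KMSW2014.LeafSupport.cm l))) (canon₅₄ νtop)).GGPntThetaDistinguished ↔
        l.onlyFull = true) := by
  have Y := canon_implications₁₅₈ νtop μtop (KMSW2014.LeafSupport.mkN (KMSW2014.LeafSupport.cm l)) True (canon νtop μtop (KMSW2014.LeafSupport.mkN (KMSW2014.LeafSupport.cm l)))
    (canon₈ νtop μtop (KMSW2014.LeafSupport.mkN (KMSW2014.LeafSupport.cm l))) (canon₅₄ νtop)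
  have V := canon_implications₄₅S νtop μtop (KMSW2014.LeafSupport.mkN (KMSW2014.LeafSupport.cm l)) True
  have X := canon_implications₁₅₃ νtop (KMSW2014.LeafSupport.mkN (KMSW2014.LeafSupport.cm l)) (canon νtop μtop (KMSW2014.LeafSupport.mkN (KMSW2014.LeafSupport.cm l))) True
  have I := canon_implications νtop μtop (KMSW2014.LeafSupport.mkN (KMSW2014.LeafSupport.cm l))
  have G := canon_implications₁₃ νtop μtop (KMSW2014.LeafSupport.mkN (KMSW2014.LeafSupport.cm l))
  have node_iff : (canon₁₅₈ νtop μtop (KMSW2014.LeafSupport.mkN (KMSW2014.LeafSupport.cm l)) True (canon₈ νtop μtop (KMSW2014.LeafSupport.mkN (KMSW2014.LeafSupport.cm l))) (canon₅₄ νtop)).GGPntLLC ↔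
      l.onlyFull = true := by
    refine ⟨fun h => ?_, fun h => ?_⟩
    · cases hb : l.onlyFull
      · exact absurd h.2.2.2.1 fun hk => KMSW2014.LeafSupport.not_scope_of (KMSW2014.LeafSupport.scope_fails l hb 0) (hk 0)
      · rfl
    · exact Y.llc bookInputs_top.everything True.intro mokInputs_top.everything (scope_of_onlyFull l h) (moeglinUnitaryDS_of_inputs V bookInputs_top)
  refine ⟨Y, node_iff, ⟨fun h => node_iff.1 h.1, fun h => ?_⟩⟩
  have o := (moeglinOrthSymp_of_inputs X V I G bookInputs_top).2
  exact Y.theta (node_iff.2 h) o.1 o.2.1 bookInputs_top.everything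

/-- The CONTROL FIELD (Theorem 9.7) holds in the canonical reading for EVERY ν, μ, κ, g, c₈, c₅₄ — no leaf of any DAG. [cite: GanGrossPrasad2020, Thm 9.7 (bookkeeping proved here)] -/
theorem c158_control (ν : Nodes) (μ : Mok2015.Nodes) (κ : KMSW2014.Nodes) (g : Prop) (c₈ : Consumers8) (c₅₄ : Consumers54) : (canon₁₅₈ ν μ κ g c₈ c₅₄).GGPntLvalues :=
  True.intro

/-- THE HUNDRED-AND-FIFTY-EIGHTH TRANCHE REGRADED, in one statement: (i) at the top (Chapter-9 leaf granted, general-spin instance denied) the node and all four theorems hold while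
B75's node fails; (ii) in the book countermodel of any of the 24 leaves the node and the three consumer theorems fail; (iii) with the Chapter-9 leaf denied they fail for every
assignment; (iv) in Mok's countermodel of any Mok leaf they fail; (v) in KMSW's countermodel of a KMSW leaf the node holds iff the leaf is sequel-only; (vi) the control holds
everywhere.  Supports, exact: support(node) = support(Thm 7.7) = support(Prop. 8.2) = support(Thm 11.17) = the 24 book leaves ∧ `InnerTwists` ([A28]) ∧ Mok's 29 leaves ∧ KMSW's
proved-scope leaves; support(Thm 9.7) = ∅. [cite: GanGrossPrasad2020, §2, Thm 7.7, Prop. 8.2, Thm 9.7, Thm 11.17 (bookkeeping proved here)] [claim: KalethaMinguezShinWhite2014, under-review] -/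
theorem c158_regraded :
    (((canon₁₅₈ νtop μtop κtop False (canon₈ νtop μtop κtop) (canon₅₄ νtop)).GGPntLLC ∧
          (canon₁₅₈ νtop μtop κtop False (canon₈ νtop μtop κtop) (canon₅₄ νtop)).GGPntSupercuspidal ∧
          (canon₁₅₈ νtop μtop κtop False (canon₈ νtop μtop κtop) (canon₅₄ νtop)).GGPntMoeglinCase ∧
          (canon₁₅₈ νtop μtop κtop False (canon₈ νtop μtop κtop) (canon₅₄ νtop)).GGPntThetaDistinguished) ∧ ¬ (canon₄₅S νtop κtop False).MoeglinDSHyp) ∧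
      (∀ l : LeafSupport.Leaf, ¬ (LeafSupport.mkN (LeafSupport.cm l)).leaf l ∧ ¬ (cm₁₅₈ l).GGPntLLC ∧ ¬ (cm₁₅₈ l).GGPntSupercuspidal ∧ ¬ (cm₁₅₈ l).GGPntMoeglinCase ∧
        ¬ (cm₁₅₈ l).GGPntThetaDistinguished) ∧
      (∀ (ν : Nodes) (μ : Mok2015.Nodes) (κ : KMSW2014.Nodes) (c₅₄ : Consumers54), ¬ (canon₁₅₈ ν μ κ True (canon₈no ν μ) c₅₄).GGPntLLC ∧
        ¬ (canon₁₅₈ ν μ κ True (canon₈no ν μ) c₅₄).GGPntSupercuspidal) ∧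
      (∀ l : Mok2015.LeafSupport.Leaf, ¬ (Mok2015.LeafSupport.mkN (Mok2015.LeafSupport.cm l)).leaf l ∧
        ¬ (canon₁₅₈ νtop (Mok2015.LeafSupport.mkN (Mok2015.LeafSupport.cm l)) κnoMok True (canon₈ νtop (Mok2015.LeafSupport.mkN (Mok2015.LeafSupport.cm l)) κnoMok) (canon₅₄ νtop)).GGPntLLC) ∧
      (∀ l : KMSW2014.LeafSupport.Leaf,
        (canon₁₅₈ νtop μtop (KMSW2014.LeafSupport.mkN (KMSW2014.LeafSupport.cm l)) True (canon₈ νtop μtop (KMSW2014.LeafSupport.mkN (KMSW2014.LeafSupport.cm l))) (canon₅₄ νtop)).GGPntLLC ↔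
          l.onlyFull = true) ∧
      (∀ (ν : Nodes) (μ : Mok2015.Nodes) (κ : KMSW2014.Nodes) (g : Prop) (c₈ : Consumers8) (c₅₄ : Consumers54), (canon₁₅₈ ν μ κ g c₈ c₅₄).GGPntLvalues) :=
  have d := c158_top
  ⟨⟨⟨d.2.1.1, d.2.1.2.1, d.2.1.2.2.1, d.2.1.2.2.2.1⟩, d.2.2.1⟩,
    fun l =>
      have h := c158_book_cm l
      ⟨h.1, h.2.2.1⟩,
    fun ν μ κ c₅₄ =>
      have h := c158_ch9_denied ν μ κ True (canon ν μ κ) c₅₄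
      ⟨h.2.1, h.2.2.1⟩,
    fun l =>
      have h := c158_mok_cm l (canon₅₄ νtop)
      ⟨h.1, h.2.2.1⟩,
    fun l => (c158_kmsw_cm_iff l).2.1,
    c158_control⟩

/-! ## 161. Hundred-and-fifty-ninth tranche (v2 of this file, after `Downstream44.lean` v5; unit `pub-arthur-down-g68`): supports of NEW rows B133 (Bin Xu, Math. Z. 297 (2021) 885–921)
and B134 (M. Tadić, manuscripta math. 169 (2021) 327–367).  The canonical reading `canon₁₅₉ ν μ κ g c₅₄` (B2 in section 1's `canon₂`, B75 quasi-split in section 155's `canon₄₅S ν κ g`,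
B70 / B71 in section 156's `canon₄₈F` / `canon₄₇F`, B108 in section 52's `canon₅₂`, and an ARBITRARY tranche-54 assignment `c₅₄` of which only row B109's value `XuCombinatorial` is
read): B133 := the book ∧ B75 quasi-split ∧ B2 ∧ `c₅₄.XuCombinatorial`; B134 families := the book ∧ B70 ∧ B71 ∧ B75 quasi-split ∧ B2; B134 Theorem 1.1 := the same ∧ B108 ∧ the
families' value.  Every tranche-159 edge holds in it (`canon_implications₁₅₉`).  READINGS: (i) AT THE TOP (g denied, c₅₄ := `canon₅₄ νtop`) all three hold — delivered by the tranche's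
`hundredfiftyninth_of_rows` from the canonical bundles — while B75's node FAILS (`c159_top`); (ii) in each of the 24 BOOK countermodels all three FAIL (`c159_book_cm`); (iii) B133 with
B109 DENIED (c₅₄ := `c54noComb ν`, every other tranche-54 value the book's) FAILS for every ν, μ, κ, g while B134's two statements are untouched (`c159_b109_denied`) — row B109 is
load-bearing for B133 exactly as the text cites [Xu:Comb]; (iv) Mok and KMSW play no part: in Mok's countermodels (KMSW read `κnoMok`) all three HOLD (`c159_mok_cm`).  Supports, exact:
support(`XuNonEndoComponents`) = the 24 book leaves ∧ row B109's value; support(`TadicMoeglinFamilies`) = support(`TadicCriticalCorank3`) = the 24 book leaves. -/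

section Canon159

variable (ν : Nodes) (μ : Mok2015.Nodes) (κ : KMSW2014.Nodes) (g : Prop)

/-- The canonical reading of NEW rows B133 / B134 over an arbitrary tranche-54 assignment (B109's slot). [cite: Xu2021NonEndoscopic, Thms 1.1–1.3; Tadic2021UnitarizabilityApackets, Thms 1.1, 4.2–7.3 (canonical model; bookkeeping)] -/
abbrev canon₁₅₉ (c₅₄ : Consumers54) : Consumers159 where
  XuNonEndoComponents := (∀ N, ν.Everything N) ∧ (canon₄₅S ν κ g).MoeglinMult1qs ∧ (canon₂ ν μ κ).XuMoeglinParam ∧ c₅₄.XuCombinatorial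
  TadicMoeglinFamilies := (∀ N, ν.Everything N) ∧ (canon₄₈F ν κ g).MoeglinElementary ∧ (canon₄₇F ν κ).MoeglinDiscretePackets ∧ (canon₄₅S ν κ g).MoeglinMult1qs ∧ (canon₂ ν μ κ).XuMoeglinParam
  TadicCriticalCorank3 := ((∀ N, ν.Everything N) ∧ (canon₄₈F ν κ g).MoeglinElementary ∧ (canon₄₇F ν κ).MoeglinDiscretePackets ∧ (canon₄₅S ν κ g).MoeglinMult1qs ∧
      (canon₂ ν μ κ).XuMoeglinParam) ∧ (canon₅₂ ν).TadicCorank3 ∧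
    ((∀ N, ν.Everything N) ∧ (canon₄₈F ν κ g).MoeglinElementary ∧ (canon₄₇F ν κ).MoeglinDiscretePackets ∧ (canon₄₅S ν κ g).MoeglinMult1qs ∧ (canon₂ ν μ κ).XuMoeglinParam)

/-- Every hundred-and-fifty-ninth-tranche edge holds in the canonical reading, for arbitrary ν, μ, κ, g, c₅₄. [cite: Xu2021NonEndoscopic, Thms 1.1–1.3; Tadic2021UnitarizabilityApackets, Thms 1.1, 4.2–7.3 (bookkeeping proved here)] -/
theorem canon_implications₁₅₉ (c₅₄ : Consumers54) :
    Implications159 ν (canon₂ ν μ κ) (canon₄₅S ν κ g) (canon₄₇F ν κ) (canon₄₈F ν κ g) (canon₅₂ ν) c₅₄ (canon₁₅₉ ν μ κ g c₅₄) where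
  xuNonEndo := fun b qs x c => ⟨b, qs, x, c⟩
  tadicFamilies := fun b e d qs x => ⟨b, e, d, qs, x⟩
  tadicCritical := fun b e d qs x t f => ⟨⟨b, e, d, qs, x⟩, t, f⟩

/-- A tranche-54 assignment with row B109 DENIED and every other tranche-54 value the book's output (the SEPARATING reading for B133). [cite: Xu2021Combinatorial, §7 (separating model; bookkeeping)] -/
abbrev c54noComb : Consumers54 where
  MoeglinImage := ∀ N, ν.Everything N
  MoeglinAdams := ∀ N, ν.Everything N
  XuCombinatorial := False
  LLCdesSpO := ∀ N, ν.Everything N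
  AtobeGanThetaSpO := ∀ N, ν.Everything N
  BHtypeI := ∀ N, ν.Everything N
  BakicHanzerAdams := ∀ N, ν.Everything N
  HazeltineAdams := ∀ N, ν.Everything N
  ChenMpAdams := ∀ N, ν.Everything N

end Canon159

/-- AT THE TOP (general-spin instance denied, c₅₄ := section 54's `canon₅₄ νtop`): B133, B134's families and B134's Theorem 1.1 all HOLD — delivered by the tranche's
`hundredfiftyninth_of_rows` fed with the book at the top, B75 quasi-split, B2, B109 (its section-54 value in `canon₅₄`: the book ∧ E43's five leaves), B70 / B71 (tranche 154's `moeglinPackets_of_inputs_2026` over the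
canonical bundles) and B108 (the book's value in `canon₅₂`) —, while B75's NODE FAILS in the same reading. [cite: Xu2021NonEndoscopic, Thms 1.1–1.3; Tadic2021UnitarizabilityApackets, Thms 1.1, 4.2–7.3 (separating model; bookkeeping proved here)] -/
theorem c159_top :
    Implications159 νtop (canon₂ νtop μtop κtop) (canon₄₅S νtop κtop False) (canon₄₇F νtop κtop) (canon₄₈F νtop κtop False) (canon₅₂ νtop) (canon₅₄ νtop)
        (canon₁₅₉ νtop μtop κtop False (canon₅₄ νtop)) ∧
      ((canon₁₅₉ νtop μtop κtop False (canon₅₄ νtop)).XuNonEndoComponents ∧ (canon₁₅₉ νtop μtop κtop False (canon₅₄ νtop)).TadicMoeglinFamilies ∧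
        (canon₁₅₉ νtop μtop κtop False (canon₅₄ νtop)).TadicCriticalCorank3) ∧
      ¬ (canon₄₅S νtop κtop False).MoeglinDSHyp :=
  have Y := canon_implications₁₅₉ νtop μtop κtop False (canon₅₄ νtop)
  have p := moeglinPackets_of_inputs_2026 (canon_implications₁₅₄ νtop κtop (canon νtop μtop κtop) False) (canon_implications₄₇F νtop κtop False) (canon_implications₄₈F νtop κtop False)
    (canon_implications₄₅S νtop μtop κtop False) (canon_implications₁₅₃ νtop κtop (canon νtop μtop κtop) False) (canon_implications νtop μtop κtop) (canon_implications₁₃ νtop μtop κtop)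
    bookInputs_top
  have b := bookInputs_top.everything
  have c : (canon₅₄ νtop).XuCombinatorial := ⟨b, ⟨⟨b, True.intro⟩, moeglinUnitaryDS_of_inputs (canon_implications₄₅S νtop μtop κtop False) bookInputs_top⟩⟩
  ⟨Y, hundredfiftyninth_of_rows Y b b b c p.2.2.2.2 p.2.1 b, fun x => x.2.2⟩

/-- Book-countermodel instance of the canonical reading (g granted; c₅₄ := `canon₅₄` of the countermodel). [cite: Xu2021NonEndoscopic, §1 (separating models; bookkeeping)] -/
abbrev cm₁₅₉ (l : LeafSupport.Leaf) : Consumers159 :=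
  canon₁₅₉ (LeafSupport.mkN (LeafSupport.cm l)) μtop κtop True (canon₅₄ (LeafSupport.mkN (LeafSupport.cm l)))

/-- BOOK SIDE: in the book countermodel of ANY of the 24 leaves `l` the bundle holds and B133, B134's families, B134's Theorem 1.1 all FAIL. [cite: Xu2021NonEndoscopic, §1.3 (arXiv:1903.09436 p0006:L24); Tadic2021UnitarizabilityApackets, §3.7 (arXiv:2010.14899 p0010:L34) (bookkeeping proved here)] -/
theorem c159_book_cm (l : LeafSupport.Leaf) :
    ¬ (LeafSupport.mkN (LeafSupport.cm l)).leaf l ∧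
      Implications159 (LeafSupport.mkN (LeafSupport.cm l)) (canon₂ (LeafSupport.mkN (LeafSupport.cm l)) μtop κtop) (canon₄₅S (LeafSupport.mkN (LeafSupport.cm l)) κtop True)
        (canon₄₇F (LeafSupport.mkN (LeafSupport.cm l)) κtop) (canon₄₈F (LeafSupport.mkN (LeafSupport.cm l)) κtop True) (canon₅₂ (LeafSupport.mkN (LeafSupport.cm l)))
        (canon₅₄ (LeafSupport.mkN (LeafSupport.cm l))) (cm₁₅₉ l) ∧
      (¬ (cm₁₅₉ l).XuNonEndoComponents ∧ ¬ (cm₁₅₉ l).TadicMoeglinFamilies ∧ ¬ (cm₁₅₉ l).TadicCriticalCorank3) :=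
  have nb := not_B_cm l
  ⟨(LeafSupport.countermodel l).2.2.1, canon_implications₁₅₉ (LeafSupport.mkN (LeafSupport.cm l)) μtop κtop True (canon₅₄ (LeafSupport.mkN (LeafSupport.cm l))),
    ⟨fun h => nb h.1, fun h => nb h.1, fun h => nb h.1.1⟩⟩

/-- ROW B109 DENIED (c₅₄ := `c54noComb ν`), for EVERY ν, μ, κ, g: the bundle holds, B133 FAILS, and B134's two statements take the same values as in any other tranche-54 reading (they do
not read c₅₄) — at the top they hold.  Row B109 (Xu, J. Inst. Math. Jussieu 20) is load-bearing for B133 as the text's [Xu:Comb]. [cite: Xu2021NonEndoscopic, §1.3 (p0006:L26), §2 (p0007:L3) (separating model; bookkeeping proved here)] -/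
theorem c159_b109_denied (ν : Nodes) (μ : Mok2015.Nodes) (κ : KMSW2014.Nodes) (g : Prop) :
    (Implications159 ν (canon₂ ν μ κ) (canon₄₅S ν κ g) (canon₄₇F ν κ) (canon₄₈F ν κ g) (canon₅₂ ν) (c54noComb ν) (canon₁₅₉ ν μ κ g (c54noComb ν)) ∧
        ¬ (canon₁₅₉ ν μ κ g (c54noComb ν)).XuNonEndoComponents) ∧
      ((canon₁₅₉ νtop μtop κtop False (c54noComb νtop)).TadicMoeglinFamilies ∧ (canon₁₅₉ νtop μtop κtop False (c54noComb νtop)).TadicCriticalCorank3) :=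
  have t := c159_top
  ⟨⟨canon_implications₁₅₉ ν μ κ g (c54noComb ν), fun h => h.2.2.2⟩, ⟨t.2.1.2.1, t.2.1.2.2⟩⟩

/-- MOK SIDE: book at the top, Mok's countermodel of ANY Mok leaf (KMSW read `κnoMok`; g granted; c₅₄ := `canon₅₄ νtop`): all three statements HOLD — no Mok / KMSW premise anywhere in
the tranche. [cite: Xu2021NonEndoscopic, §1; Tadic2021UnitarizabilityApackets, §2 (bookkeeping proved here)] -/
theorem c159_mok_cm (l : Mok2015.LeafSupport.Leaf) :
    ¬ (Mok2015.LeafSupport.mkN (Mok2015.LeafSupport.cm l)).leaf l ∧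
      (canon₁₅₉ νtop (Mok2015.LeafSupport.mkN (Mok2015.LeafSupport.cm l)) κnoMok True (canon₅₄ νtop)).XuNonEndoComponents ∧
      (canon₁₅₉ νtop (Mok2015.LeafSupport.mkN (Mok2015.LeafSupport.cm l)) κnoMok True (canon₅₄ νtop)).TadicMoeglinFamilies ∧
      (canon₁₅₉ νtop (Mok2015.LeafSupport.mkN (Mok2015.LeafSupport.cm l)) κnoMok True (canon₅₄ νtop)).TadicCriticalCorank3 :=
  have Y := canon_implications₁₅₉ νtop (Mok2015.LeafSupport.mkN (Mok2015.LeafSupport.cm l)) κnoMok True (canon₅₄ νtop)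
  have p := moeglinPackets_of_inputs_2026 (canon_implications₁₅₄ νtop κnoMok (canon νtop (Mok2015.LeafSupport.mkN (Mok2015.LeafSupport.cm l)) κnoMok) True) (canon_implications₄₇F νtop κnoMok True)
    (canon_implications₄₈F νtop κnoMok True) (canon_implications₄₅S νtop (Mok2015.LeafSupport.mkN (Mok2015.LeafSupport.cm l)) κnoMok True)
    (canon_implications₁₅₃ νtop κnoMok (canon νtop (Mok2015.LeafSupport.mkN (Mok2015.LeafSupport.cm l)) κnoMok) True) (canon_implications νtop (Mok2015.LeafSupport.mkN (Mok2015.LeafSupport.cm l)) κnoMok)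
    (canon_implications₁₃ νtop (Mok2015.LeafSupport.mkN (Mok2015.LeafSupport.cm l)) κnoMok) bookInputs_top
  have b := bookInputs_top.everything
  have c : (canon₅₄ νtop).XuCombinatorial :=
    ⟨b, ⟨⟨b, True.intro⟩, moeglinUnitaryDS_of_inputs (canon_implications₄₅S νtop (Mok2015.LeafSupport.mkN (Mok2015.LeafSupport.cm l)) κnoMok True) bookInputs_top⟩⟩
  ⟨(Mok2015.LeafSupport.countermodel l).2.2.1, hundredfiftyninth_of_rows Y b b b c p.2.2.2.2 p.2.1 b⟩

/-- THE HUNDRED-AND-FIFTY-NINTH TRANCHE REGRADED, in one statement: (i) at the top (general-spin instance denied) B133 and B134's two statements hold while B75's node fails; (ii) in the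
book countermodel of any of the 24 leaves all three fail; (iii) with row B109 denied B133 fails for every assignment while B134 is untouched; (iv) in Mok's countermodel of any Mok leaf
all three hold.  Supports, exact: support(B133) = the 24 book leaves ∧ row B109's value; support(B134 families) = support(B134 Thm 1.1) = the 24 book leaves — no Mœglin node, no
general-spin instance, nothing of Mok's or KMSW's. [cite: Xu2021NonEndoscopic, Thms 1.1–1.3; Tadic2021UnitarizabilityApackets, Thms 1.1, 4.2–7.3 (bookkeeping proved here)] -/
theorem c159_regraded :
    (((canon₁₅₉ νtop μtop κtop False (canon₅₄ νtop)).XuNonEndoComponents ∧ (canon₁₅₉ νtop μtop κtop False (canon₅₄ νtop)).TadicMoeglinFamilies ∧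
          (canon₁₅₉ νtop μtop κtop False (canon₅₄ νtop)).TadicCriticalCorank3) ∧ ¬ (canon₄₅S νtop κtop False).MoeglinDSHyp) ∧
      (∀ l : LeafSupport.Leaf, ¬ (LeafSupport.mkN (LeafSupport.cm l)).leaf l ∧ ¬ (cm₁₅₉ l).XuNonEndoComponents ∧ ¬ (cm₁₅₉ l).TadicMoeglinFamilies ∧ ¬ (cm₁₅₉ l).TadicCriticalCorank3) ∧
      (∀ (ν : Nodes) (μ : Mok2015.Nodes) (κ : KMSW2014.Nodes) (g : Prop), ¬ (canon₁₅₉ ν μ κ g (c54noComb ν)).XuNonEndoComponents) ∧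
      (∀ l : Mok2015.LeafSupport.Leaf, ¬ (Mok2015.LeafSupport.mkN (Mok2015.LeafSupport.cm l)).leaf l ∧
        (canon₁₅₉ νtop (Mok2015.LeafSupport.mkN (Mok2015.LeafSupport.cm l)) κnoMok True (canon₅₄ νtop)).TadicCriticalCorank3) :=
  have t := c159_top
  ⟨⟨t.2.1, t.2.2⟩,
    fun l =>
      have h := c159_book_cm l
      ⟨h.1, h.2.2⟩,
    fun ν μ κ g => (c159_b109_denied ν μ κ g).1.2,
    fun l =>
      have h := c159_mok_cm l
      ⟨h.1, h.2.2.2⟩⟩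

/-! ## 162. Hundred-and-sixtieth tranche (v3 of this file, after `Downstream44.lean` v6; unit `pub-arthur-down-g68`): supports of NEW rows B135 (F. Chen – W.-W. Li, *Spectral transfer for
metaplectic groups. II*, Peking Math. J. 2025) and B136 (Y. Kim – M. Krishnamurthy – F. Shahidi, arXiv:2506.00892, 2025 preprint).  The canonical reading `canon₁₆₀ ν μ κ` (A5 in section 1's
`canon`, A8-p orthogonal in section 13's `canon₁₃`, B10 / B11 in section 11's `canon₁₁`, B112 / B8 / B57 in section 57's `canon₅₇`): B135's two statements := the book ∧ A5 ∧ A8-p orthogonal ∧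
B10 ∧ B11 ∧ B112 ∧ B8 ∧ B57 (their canonical values); B136's controls := `True`; B136's §4, node and Theorem 1.1 := Mok at every rank.  Every tranche-160 edge holds in it
(`canon_implications₁₆₀`).  READINGS: (i) AT THE TOP all seven fields hold — delivered by the tranche's own `hundredsixtieth_of_inputs` from the canonical bundles of tranches 1, 11, 13, 57
and the top inputs of the book's and Mok's DAGs (`c160_top`); (ii) in each of the 24 BOOK countermodels (Mok at the top) B135's two statements FAIL while all five B136 fields HOLD
(`c160_book_cm`) — the book's leaves are load-bearing for B135 and NOT for B136 (the register models Mok's inputs as Mok's own 29 leaves); (iii) in each of Mok's 29 countermodels (book at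
the top, KMSW read `κnoMok`) B135's two statements HOLD while B136's §4, node and Theorem 1.1 FAIL (`c160_mok_cm`); (iv) B135's canonical value does not read μ or κ at all
(`c160_chenli_free`: [KMSW] is in B135's bibliography for a notation only) and B136's does not read ν or κ (`c160_kks_free`); (v) the two controls hold in every reading (`c160_controls`).
Supports, exact: support(`ChenLiTWParameters`) = support(`ChenLiInertia`) = the 24 book leaves; support(`KKSGenericLLC`) = support(`KKSWeakGeneric`) = ∅; support(`KKSLpackets`) =
support(`KKSAssumptionLS`) = support(`KKSStrongGeneric`) = Mok's 29 leaves. -/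

section Canon160

variable (ν : Nodes) (μ : Mok2015.Nodes) (κ : KMSW2014.Nodes)

/-- The canonical reading of NEW rows B135 / B136. [cite: ChenLi2025MetaplecticII, Thm 2 = 16, Prop. 3 = 18; KimKrishnamurthyShahidi2025, Thms 1.1–1.3, §4 (canonical model; bookkeeping)] -/
abbrev canon₁₆₀ : Consumers160 where
  ChenLiTWParameters := (∀ N, ν.Everything N) ∧ (canon ν μ κ).IshimotoGeneric ∧ (canon₁₃ ν κ).MRpadicOrth ∧ (canon₁₁ ν).LiSpectralTransfer ∧ (canon₁₁ ν).LuoECR ∧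
    (canon₅₇ ν).GanSavinLLCMp ∧ (canon₅₇ ν).IshimotoLIRMp ∧ (canon₅₇ ν).LiPsiVariation
  ChenLiInertia := (∀ N, ν.Everything N) ∧ (canon ν μ κ).IshimotoGeneric ∧ (canon₁₃ ν κ).MRpadicOrth ∧ (canon₁₁ ν).LiSpectralTransfer ∧ (canon₁₁ ν).LuoECR ∧
    (canon₅₇ ν).GanSavinLLCMp ∧ (canon₅₇ ν).IshimotoLIRMp ∧ (canon₅₇ ν).LiPsiVariation
  KKSGenericLLC := True
  KKSWeakGeneric := True
  KKSLpackets := ∀ N, μ.Everything N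
  KKSAssumptionLS := ∀ N, μ.Everything N
  KKSStrongGeneric := ∀ N, μ.Everything N

/-- Every hundred-and-sixtieth-tranche edge holds in the canonical reading, for arbitrary ν, μ, κ (read against sections 1 / 11 / 13 / 57's `canon`, `canon₁₁`, `canon₁₃`, `canon₅₇`). [cite: ChenLi2025MetaplecticII, Thm 2, Prop. 3; KimKrishnamurthyShahidi2025, Thms 1.1–1.3, §4 (bookkeeping proved here)] -/
theorem canon_implications₁₆₀ : Implications160 ν μ (canon ν μ κ) (canon₁₁ ν) (canon₁₃ ν κ) (canon₅₇ ν) (canon₁₆₀ ν μ κ) where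
  chenLiTW := fun b i o l u g r v => ⟨b, i, o, l, u, g, r, v⟩
  chenLiInertia := fun b i o l u g r v => ⟨b, i, o, l, u, g, r, v⟩
  kksLLC := True.intro
  kksWeak := fun _ => True.intro
  kksLpackets := fun m _ => m
  kksLS := fun p => p
  kksStrong := fun a _ _ => a

end Canon160

/-- AT THE TOP: the bundle holds and all seven fields of rows B135 / B136 HOLD — delivered by the tranche's `hundredsixtieth_of_inputs` over the canonical bundles of tranches 1, 11, 13, 57
and the top inputs of the book's and Mok's DAGs. [cite: ChenLi2025MetaplecticII, Thm 2, Prop. 3; KimKrishnamurthyShahidi2025, Thms 1.1–1.3, §4 (bookkeeping proved here)] -/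
theorem c160_top :
    Implications160 νtop μtop (canon νtop μtop κtop) (canon₁₁ νtop) (canon₁₃ νtop κtop) (canon₅₇ νtop) (canon₁₆₀ νtop μtop κtop) ∧
      ((canon₁₆₀ νtop μtop κtop).ChenLiTWParameters ∧ (canon₁₆₀ νtop μtop κtop).ChenLiInertia) ∧
      ((canon₁₆₀ νtop μtop κtop).KKSGenericLLC ∧ (canon₁₆₀ νtop μtop κtop).KKSWeakGeneric) ∧
      ((canon₁₆₀ νtop μtop κtop).KKSLpackets ∧ (canon₁₆₀ νtop μtop κtop).KKSAssumptionLS ∧ (canon₁₆₀ νtop μtop κtop).KKSStrongGeneric) :=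
  have Y := canon_implications₁₆₀ νtop μtop κtop
  ⟨Y, hundredsixtieth_of_inputs Y (canon_implications₅₇ νtop μtop κtop) (canon_implications νtop μtop κtop) (canon_implications₁₁ νtop μtop κtop) (canon_implications₁₃ νtop μtop κtop)
    bookInputs_top mokInputs_top⟩

/-- Book-countermodel instance of the canonical reading (Mok, KMSW at the top). [cite: ChenLi2025MetaplecticII, §1.1 (separating models; bookkeeping)] -/
abbrev cm₁₆₀ (l : LeafSupport.Leaf) : Consumers160 := canon₁₆₀ (LeafSupport.mkN (LeafSupport.cm l)) μtop κtop

/-- BOOK SIDE: in the book countermodel of ANY of the 24 leaves `l` (Mok and KMSW at the top) the tranche's bundle holds, B135's two statements FAIL, and all five of B136's fields HOLD —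
the 24 book leaves are load-bearing for B135 (through [Ar13] directly and through each of A5, A8-p, B10, B11, B112, B8, B57) and play no part in B136, whose only typed input is Mok. [cite: ChenLi2025MetaplecticII, §1.1 (arXiv:2502.00781 p0003:L25-27); KimKrishnamurthyShahidi2025, §4.1 (arXiv:2506.00892 p0015:L13) (separating models; bookkeeping proved here)] -/
theorem c160_book_cm (l : LeafSupport.Leaf) :
    ¬ (LeafSupport.mkN (LeafSupport.cm l)).leaf l ∧
      Implications160 (LeafSupport.mkN (LeafSupport.cm l)) μtop (canon (LeafSupport.mkN (LeafSupport.cm l)) μtop κtop) (canon₁₁ (LeafSupport.mkN (LeafSupport.cm l)))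
        (canon₁₃ (LeafSupport.mkN (LeafSupport.cm l)) κtop) (canon₅₇ (LeafSupport.mkN (LeafSupport.cm l))) (cm₁₆₀ l) ∧
      (¬ (cm₁₆₀ l).ChenLiTWParameters ∧ ¬ (cm₁₆₀ l).ChenLiInertia) ∧
      ((cm₁₆₀ l).KKSGenericLLC ∧ (cm₁₆₀ l).KKSWeakGeneric ∧ (cm₁₆₀ l).KKSLpackets ∧ (cm₁₆₀ l).KKSAssumptionLS ∧ (cm₁₆₀ l).KKSStrongGeneric) :=
  have nb := not_B_cm l
  have m := mokInputs_top.everything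
  ⟨(LeafSupport.countermodel l).2.2.1, canon_implications₁₆₀ (LeafSupport.mkN (LeafSupport.cm l)) μtop κtop, ⟨fun h => nb h.1, fun h => nb h.1⟩,
    ⟨True.intro, True.intro, m, m, m⟩⟩

/-- MOK SIDE: book at the top, Mok's countermodel of ANY of the 29 Mok leaves `l` (KMSW read `κnoMok`): the bundle holds, B135's two statements HOLD (the tranche's `chenLi_of_inputs` over
the canonical bundles with the book at the top), B136's §4, node and Theorem 1.1 FAIL, its controls hold — Mok's 29 leaves are load-bearing for B136 through §4's [M15] sentences. [cite: KimKrishnamurthyShahidi2025, §4 (arXiv:2506.00892 p0015:L5-41, p0016:L10), Cor. 4.8; ChenLi2025MetaplecticII, §1.1 (separating models; bookkeeping proved here)] -/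
theorem c160_mok_cm (l : Mok2015.LeafSupport.Leaf) :
    ¬ (Mok2015.LeafSupport.mkN (Mok2015.LeafSupport.cm l)).leaf l ∧
      Implications160 νtop (Mok2015.LeafSupport.mkN (Mok2015.LeafSupport.cm l)) (canon νtop (Mok2015.LeafSupport.mkN (Mok2015.LeafSupport.cm l)) κnoMok) (canon₁₁ νtop) (canon₁₃ νtop κnoMok) (canon₅₇ νtop) (canon₁₆₀ νtop (Mok2015.LeafSupport.mkN (Mok2015.LeafSupport.cm l)) κnoMok) ∧
      ((canon₁₆₀ νtop (Mok2015.LeafSupport.mkN (Mok2015.LeafSupport.cm l)) κnoMok).ChenLiTWParameters ∧ (canon₁₆₀ νtop (Mok2015.LeafSupport.mkN (Mok2015.LeafSupport.cm l)) κnoMok).ChenLiInertia) ∧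
      (¬ (canon₁₆₀ νtop (Mok2015.LeafSupport.mkN (Mok2015.LeafSupport.cm l)) κnoMok).KKSLpackets ∧ ¬ (canon₁₆₀ νtop (Mok2015.LeafSupport.mkN (Mok2015.LeafSupport.cm l)) κnoMok).KKSAssumptionLS ∧ ¬ (canon₁₆₀ νtop (Mok2015.LeafSupport.mkN (Mok2015.LeafSupport.cm l)) κnoMok).KKSStrongGeneric) ∧
      ((canon₁₆₀ νtop (Mok2015.LeafSupport.mkN (Mok2015.LeafSupport.cm l)) κnoMok).KKSGenericLLC ∧ (canon₁₆₀ νtop (Mok2015.LeafSupport.mkN (Mok2015.LeafSupport.cm l)) κnoMok).KKSWeakGeneric) :=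
  have nm := not_M_cm l
  have Y := canon_implications₁₆₀ νtop (Mok2015.LeafSupport.mkN (Mok2015.LeafSupport.cm l)) κnoMok
  ⟨(Mok2015.LeafSupport.countermodel l).2.2.1, Y,
    chenLi_of_inputs Y (canon_implications₅₇ νtop (Mok2015.LeafSupport.mkN (Mok2015.LeafSupport.cm l)) κnoMok) (canon_implications νtop (Mok2015.LeafSupport.mkN (Mok2015.LeafSupport.cm l)) κnoMok) (canon_implications₁₁ νtop (Mok2015.LeafSupport.mkN (Mok2015.LeafSupport.cm l)) κnoMok) (canon_implications₁₃ νtop (Mok2015.LeafSupport.mkN (Mok2015.LeafSupport.cm l)) κnoMok)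
      bookInputs_top,
    ⟨nm, nm, nm⟩, ⟨True.intro, True.intro⟩⟩

/-- B135's CANONICAL VALUE READS NEITHER MOK NOR KMSW: for every ν and all μ, μ′, κ, κ′ the two statements have the same value ([KMSW] appears in B135's bibliography for a representative of a
Weyl element — `paper-arxiv-2502.00781` p0016:L23 —, no theorem of KMSW's; no unitary group in the text). [cite: ChenLi2025MetaplecticII, §6 (p0016:L23) (bookkeeping proved here)] [claim: KalethaMinguezShinWhite2014, under-review] -/
theorem c160_chenli_free (ν : Nodes) (μ μ' : Mok2015.Nodes) (κ κ' : KMSW2014.Nodes) :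
    ((canon₁₆₀ ν μ κ).ChenLiTWParameters ↔ (canon₁₆₀ ν μ' κ').ChenLiTWParameters) ∧ ((canon₁₆₀ ν μ κ).ChenLiInertia ↔ (canon₁₆₀ ν μ' κ').ChenLiInertia) :=
  ⟨Iff.rfl, Iff.rfl⟩

/-- B136's CANONICAL VALUE READS NEITHER THE BOOK's DAG NOR KMSW's: for every μ and all ν, ν′, κ, κ′ the five fields have the same value ([A13] is context in the text, never a premise of a
proof step; no [KMSW] in its bibliography). [cite: KimKrishnamurthyShahidi2025, §2 (p0009:L33-35), §4 (bookkeeping proved here)] -/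
theorem c160_kks_free (μ : Mok2015.Nodes) (ν ν' : Nodes) (κ κ' : KMSW2014.Nodes) :
    ((canon₁₆₀ ν μ κ).KKSLpackets ↔ (canon₁₆₀ ν' μ κ').KKSLpackets) ∧ ((canon₁₆₀ ν μ κ).KKSAssumptionLS ↔ (canon₁₆₀ ν' μ κ').KKSAssumptionLS) ∧
      ((canon₁₆₀ ν μ κ).KKSStrongGeneric ↔ (canon₁₆₀ ν' μ κ').KKSStrongGeneric) :=
  ⟨Iff.rfl, Iff.rfl, Iff.rfl⟩

/-- The two CONTROL FIELDS of B136 (Theorems 1.2 = 3.1, 1.3 = 3.7) hold in the canonical reading for EVERY ν, μ, κ — no leaf of any DAG. [cite: KimKrishnamurthyShahidi2025, Thms 3.1, 3.7 (bookkeeping proved here)] -/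
theorem c160_controls (ν : Nodes) (μ : Mok2015.Nodes) (κ : KMSW2014.Nodes) : (canon₁₆₀ ν μ κ).KKSGenericLLC ∧ (canon₁₆₀ ν μ κ).KKSWeakGeneric :=
  ⟨True.intro, True.intro⟩

/-- THE HUNDRED-AND-SIXTIETH TRANCHE REGRADED, in one statement: (i) at the top all seven fields hold; (ii) in the book countermodel of any of the 24 leaves B135's two statements fail and
B136's Mok-dependent three hold; (iii) in Mok's countermodel of any of the 29 Mok leaves B135's two statements hold and B136's three fail; (iv) the controls hold everywhere.  Supports, exact:
support(`ChenLiTWParameters`) = support(`ChenLiInertia`) = the 24 book leaves; support(`KKSLpackets`) = support(`KKSAssumptionLS`) = support(`KKSStrongGeneric`) = Mok's 29 leaves;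
support(`KKSGenericLLC`) = support(`KKSWeakGeneric`) = ∅. [cite: ChenLi2025MetaplecticII, Thm 2, Prop. 3; KimKrishnamurthyShahidi2025, Thms 1.1–1.3, §4 (bookkeeping proved here)] -/
theorem c160_regraded :
    ((canon₁₆₀ νtop μtop κtop).ChenLiTWParameters ∧ (canon₁₆₀ νtop μtop κtop).ChenLiInertia ∧ (canon₁₆₀ νtop μtop κtop).KKSLpackets ∧ (canon₁₆₀ νtop μtop κtop).KKSAssumptionLS ∧
        (canon₁₆₀ νtop μtop κtop).KKSStrongGeneric) ∧
      (∀ l : LeafSupport.Leaf, ¬ (LeafSupport.mkN (LeafSupport.cm l)).leaf l ∧ ¬ (cm₁₆₀ l).ChenLiTWParameters ∧ ¬ (cm₁₆₀ l).ChenLiInertia ∧ (cm₁₆₀ l).KKSLpackets ∧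
        (cm₁₆₀ l).KKSAssumptionLS ∧ (cm₁₆₀ l).KKSStrongGeneric) ∧
      (∀ l : Mok2015.LeafSupport.Leaf, ¬ (Mok2015.LeafSupport.mkN (Mok2015.LeafSupport.cm l)).leaf l ∧ (canon₁₆₀ νtop (Mok2015.LeafSupport.mkN (Mok2015.LeafSupport.cm l)) κnoMok).ChenLiTWParameters ∧ (canon₁₆₀ νtop (Mok2015.LeafSupport.mkN (Mok2015.LeafSupport.cm l)) κnoMok).ChenLiInertia ∧
        ¬ (canon₁₆₀ νtop (Mok2015.LeafSupport.mkN (Mok2015.LeafSupport.cm l)) κnoMok).KKSLpackets ∧ ¬ (canon₁₆₀ νtop (Mok2015.LeafSupport.mkN (Mok2015.LeafSupport.cm l)) κnoMok).KKSAssumptionLS ∧ ¬ (canon₁₆₀ νtop (Mok2015.LeafSupport.mkN (Mok2015.LeafSupport.cm l)) κnoMok).KKSStrongGeneric) ∧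
      (∀ (ν : Nodes) (μ : Mok2015.Nodes) (κ : KMSW2014.Nodes), (canon₁₆₀ ν μ κ).KKSGenericLLC ∧ (canon₁₆₀ ν μ κ).KKSWeakGeneric) :=
  have d := c160_top
  ⟨⟨d.2.1.1, d.2.1.2, d.2.2.2.1, d.2.2.2.2.1, d.2.2.2.2.2⟩,
    fun l =>
      have h := c160_book_cm l
      ⟨h.1, h.2.2.1.1, h.2.2.1.2, h.2.2.2.2.2.1, h.2.2.2.2.2.2.1, h.2.2.2.2.2.2.2⟩,
    fun l =>
      have h := c160_mok_cm l
      ⟨h.1, h.2.2.1.1, h.2.2.1.2, h.2.2.2.1.1, h.2.2.2.1.2.1, h.2.2.2.1.2.2⟩,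
    c160_controls⟩

/-! ## 163. Hundred-and-sixty-first tranche (v4 of this file, after NEW `Downstream45.lean` v1, now imported; unit `pub-arthur-down-g68`): supports of NEW row B137 (K. Choiy – D. Goldberg,
*Behavior of R-groups for p-adic inner forms of quasi-split special unitary groups*, arXiv:1605.05299, 2016).  The canonical reading `canon₁₆₁ μ κ` has NO book parameter: §5 := Mok at
every rank ∧ KMSW's proved scope at every rank; §6 := the same ∧ §5's value.  Every tranche-161 edge holds in it (`canon_implications₁₆₁`).  READINGS: (i) AT THE TOP both hold — the
tranche's `choiyGoldbergSU_of_inputs` over `mokInputs_top` and `kmswInputs_top` (`c161_top`); (ii) the book's DAG is not read at all (no ν in the reading: the 24 book leaves are not in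
the support by construction — [art12] is context in the text); (iii) in each of Mok's 29 countermodels (KMSW at the top) both FAIL (`c161_mok_cm`); (iv) with KMSW's Mok import denied
(`κnoMok`) both FAIL (`c161_kmsw_importDenied`); (v) in KMSW's countermodel of a KMSW leaf l (Mok at the top) each statement holds IFF l is a sequel-only leaf (`c161_kmsw_cm_iff`):
KMSW's proved-scope leaves are load-bearing, its unwritten sequels [KMS_A] / [KMS_B] and `AubertSS` are not (tempered parameters only in the text).  Supports, exact:
support(`CGUnitaryRgroups`) = support(`CGSpecialUnitaryRgroups`) = Mok's 29 leaves ∧ KMSW's proved-scope leaves; no book leaf. -/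

section Canon161

variable (μ : Mok2015.Nodes) (κ : KMSW2014.Nodes)

/-- The canonical reading of NEW row B137 (no book parameter). [cite: ChoiyGoldberg2016SpecialUnitary, Thm 5.2, Thms 6.1, 6.3, 6.6, 6.8 (canonical model; bookkeeping)] [claim: KalethaMinguezShinWhite2014, under-review] -/
abbrev canon₁₆₁ : Consumers161 where
  CGUnitaryRgroups := (∀ N, μ.Everything N) ∧ (∀ N, κ.Scope N)
  CGSpecialUnitaryRgroups := ((∀ N, μ.Everything N) ∧ (∀ N, κ.Scope N)) ∧ ((∀ N, μ.Everything N) ∧ (∀ N, κ.Scope N))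

/-- Every hundred-and-sixty-first-tranche edge holds in the canonical reading, for arbitrary μ, κ. [cite: ChoiyGoldberg2016SpecialUnitary, Thm 5.2, Thm 6.1 (bookkeeping proved here)] [claim: KalethaMinguezShinWhite2014, under-review] -/
theorem canon_implications₁₆₁ : Implications161 μ κ (canon₁₆₁ μ κ) where
  cgUnitary := fun m k => ⟨m, k⟩
  cgSpecialUnitary := fun m k u => ⟨⟨m, k⟩, u⟩

end Canon161

/-- AT THE TOP (Mok and KMSW: every leaf granted): the bundle holds and both statements of row B137 HOLD — delivered by the tranche's `choiyGoldbergSU_of_inputs` over `mokInputs_top` and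
the proved-scope part of `kmswInputs_top`. [cite: ChoiyGoldberg2016SpecialUnitary, Thm 5.2, Thm 6.1 (bookkeeping proved here)] [claim: KalethaMinguezShinWhite2014, under-review] -/
theorem c161_top : Implications161 μtop κtop (canon₁₆₁ μtop κtop) ∧ ((canon₁₆₁ μtop κtop).CGUnitaryRgroups ∧ (canon₁₆₁ μtop κtop).CGSpecialUnitaryRgroups) :=
  have Y := canon_implications₁₆₁ μtop κtop
  ⟨Y, choiyGoldbergSU_of_inputs Y mokInputs_top (kmswInputs_top μtop).1⟩

/-- MOK SIDE: in Mok's countermodel of ANY of the 29 Mok leaves `l` (KMSW at the top) the bundle holds and BOTH statements FAIL — Mok's leaves are load-bearing through « the L-packet …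
constructed by Rogawski [rog90] and Mok [mok13] ». [cite: ChoiyGoldberg2016SpecialUnitary, §1 (arXiv:1605.05299 p0003:L31), §5.1 (p0012:L9-16) (separating model; bookkeeping proved here)] [claim: KalethaMinguezShinWhite2014, under-review] -/
theorem c161_mok_cm (l : Mok2015.LeafSupport.Leaf) :
    ¬ (Mok2015.LeafSupport.mkN (Mok2015.LeafSupport.cm l)).leaf l ∧ Implications161 (Mok2015.LeafSupport.mkN (Mok2015.LeafSupport.cm l)) κtop (canon₁₆₁ (Mok2015.LeafSupport.mkN (Mok2015.LeafSupport.cm l)) κtop) ∧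
      (¬ (canon₁₆₁ (Mok2015.LeafSupport.mkN (Mok2015.LeafSupport.cm l)) κtop).CGUnitaryRgroups ∧ ¬ (canon₁₆₁ (Mok2015.LeafSupport.mkN (Mok2015.LeafSupport.cm l)) κtop).CGSpecialUnitaryRgroups) :=
  have nm := not_M_cm l
  ⟨(Mok2015.LeafSupport.countermodel l).2.2.1, canon_implications₁₆₁ (Mok2015.LeafSupport.mkN (Mok2015.LeafSupport.cm l)) κtop, ⟨fun h => nm h.1, fun h => nm h.1.1⟩⟩

/-- KMSW SIDE, THE IMPORT: with Mok at the top and KMSW's Mok import DENIED (`κnoMok`: the proved scope fails at every rank) the bundle holds and BOTH statements FAIL — KMSW is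
load-bearing through « The same is true for an F-inner form … by Kaletha-Minguez-Shin-White [kmsw14] ». [cite: ChoiyGoldberg2016SpecialUnitary, §5.1 (arXiv:1605.05299 p0012:L17), §1 (p0003:L34) (separating model; bookkeeping proved here)] [claim: KalethaMinguezShinWhite2014, under-review] -/
theorem c161_kmsw_importDenied :
    (∀ N, ¬ κnoMok.Scope N) ∧ Implications161 μtop κnoMok (canon₁₆₁ μtop κnoMok) ∧
      (¬ (canon₁₆₁ μtop κnoMok).CGUnitaryRgroups ∧ ¬ (canon₁₆₁ μtop κnoMok).CGSpecialUnitaryRgroups) :=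
  have ns : ∀ N, ¬ κnoMok.Scope N := κnoMok_facts.2.2.2.2.2.1
  ⟨ns, canon_implications₁₆₁ μtop κnoMok, ⟨fun h => ns 0 (h.2 0), fun h => ns 0 (h.1.2 0)⟩⟩

/-- KMSW SIDE, LEAF BY LEAF: Mok at the top, KMSW's countermodel of a KMSW leaf `l`: the bundle holds, and each of B137's statements HOLDS IFF `l` is a sequel-only leaf — the proved
scope (tempered = generic parameters of the inner forms of U_n, E/F a field; the intertwining statements for bounded parameters) is what the text uses; the unwritten sequels [KMS_A] /
[KMS_B] and Aubert's involution are not consumed. [cite: ChoiyGoldberg2016SpecialUnitary, §5.1 (p0012:L7-17), §6.1 (p0014:L22-38) (separating models; bookkeeping proved here)] [claim: KalethaMinguezShinWhite2014, under-review] -/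
theorem c161_kmsw_cm_iff (l : KMSW2014.LeafSupport.Leaf) :
    Implications161 μtop (KMSW2014.LeafSupport.mkN (KMSW2014.LeafSupport.cm l)) (canon₁₆₁ μtop (KMSW2014.LeafSupport.mkN (KMSW2014.LeafSupport.cm l))) ∧ ((canon₁₆₁ μtop (KMSW2014.LeafSupport.mkN (KMSW2014.LeafSupport.cm l))).CGUnitaryRgroups ↔ l.onlyFull = true) ∧
      ((canon₁₆₁ μtop (KMSW2014.LeafSupport.mkN (KMSW2014.LeafSupport.cm l))).CGSpecialUnitaryRgroups ↔ l.onlyFull = true) := by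
  have node_iff : (canon₁₆₁ μtop (KMSW2014.LeafSupport.mkN (KMSW2014.LeafSupport.cm l))).CGUnitaryRgroups ↔ l.onlyFull = true := by
    refine ⟨fun h => ?_, fun h => ?_⟩
    · cases hb : l.onlyFull
      · exact absurd h.2 fun hk => KMSW2014.LeafSupport.not_scope_of (KMSW2014.LeafSupport.scope_fails l hb 0) (hk 0)
      · rfl
    · exact ⟨mokInputs_top.everything, scope_of_onlyFull l h⟩
  exact ⟨canon_implications₁₆₁ μtop (KMSW2014.LeafSupport.mkN (KMSW2014.LeafSupport.cm l)), node_iff, ⟨fun h => node_iff.1 h.1, fun h => ⟨node_iff.2 h, node_iff.2 h⟩⟩⟩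

/-- THE HUNDRED-AND-SIXTY-FIRST TRANCHE REGRADED, in one statement: (i) at the top both statements hold; (ii) in Mok's countermodel of any of the 29 Mok leaves both fail; (iii) with
KMSW's Mok import denied both fail; (iv) in KMSW's countermodel of a KMSW leaf each holds iff the leaf is sequel-only; the reading has no book parameter.  Supports, exact:
support(`CGUnitaryRgroups`) = support(`CGSpecialUnitaryRgroups`) = Mok's 29 leaves ∧ KMSW's proved-scope leaves. [cite: ChoiyGoldberg2016SpecialUnitary, Thm 5.2, Thms 6.1, 6.3, 6.6, 6.8 (bookkeeping proved here)] [claim: KalethaMinguezShinWhite2014, under-review] -/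
theorem c161_regraded :
    ((canon₁₆₁ μtop κtop).CGUnitaryRgroups ∧ (canon₁₆₁ μtop κtop).CGSpecialUnitaryRgroups) ∧
      (∀ l : Mok2015.LeafSupport.Leaf, ¬ (Mok2015.LeafSupport.mkN (Mok2015.LeafSupport.cm l)).leaf l ∧ ¬ (canon₁₆₁ (Mok2015.LeafSupport.mkN (Mok2015.LeafSupport.cm l)) κtop).CGUnitaryRgroups ∧ ¬ (canon₁₆₁ (Mok2015.LeafSupport.mkN (Mok2015.LeafSupport.cm l)) κtop).CGSpecialUnitaryRgroups) ∧
      ((∀ N, ¬ κnoMok.Scope N) ∧ ¬ (canon₁₆₁ μtop κnoMok).CGUnitaryRgroups ∧ ¬ (canon₁₆₁ μtop κnoMok).CGSpecialUnitaryRgroups) ∧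
      (∀ l : KMSW2014.LeafSupport.Leaf, ((canon₁₆₁ μtop (KMSW2014.LeafSupport.mkN (KMSW2014.LeafSupport.cm l))).CGUnitaryRgroups ↔ l.onlyFull = true) ∧ ((canon₁₆₁ μtop (KMSW2014.LeafSupport.mkN (KMSW2014.LeafSupport.cm l))).CGSpecialUnitaryRgroups ↔ l.onlyFull = true)) :=
  ⟨c161_top.2,
    fun l =>
      have h := c161_mok_cm l
      ⟨h.1, h.2.2.1, h.2.2.2⟩,
    ⟨c161_kmsw_importDenied.1, c161_kmsw_importDenied.2.2.1, c161_kmsw_importDenied.2.2.2⟩,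
    fun l => (c161_kmsw_cm_iff l).2⟩

/-! ## 164. Hundred-and-sixty-second tranche (v4 of this file, with section 163; after `Downstream45.lean` v2; unit `pub-arthur-down-g68`): supports of NEW row B138 (J. Hundley – S. D. Miller, *On
Arthur's unitarity conj. for split real groups*, Amer. J. Math. 144 (2022) 1561–1600).  The canonical reading `canon₁₆₂ ν` (no Mok / KMSW parameter): the exceptional part := `True` (control);
Theorem 1 as stated := the book at every rank ∧ `True`.  Every tranche-162 edge holds in it (`canon_implications₁₆₂`).  READINGS: (i) AT THE TOP both hold (`c162_top`, via the tranche's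
`hundleyMiller_of_inputs`); (ii) in each of the 24 BOOK countermodels Theorem 1 as stated FAILS and the exceptional part HOLDS (`c162_book_cm`) — the 24 book leaves are load-bearing for the
statement exactly through its classical cases « settled by … Arthur [Arthur-book] »; (iii) the reading has no Mok / KMSW parameter (`canon₁₆₂` takes ν only).  Supports, exact:
support(`HMLanglandsElement`) = the 24 book leaves; support(`HMExceptional`) = ∅. -/

section Canon162

variable (ν : Nodes)

/-- The canonical reading of NEW row B138. [cite: HundleyMiller2022, Thm 1 = Thm 2 (canonical model; bookkeeping)] -/
abbrev canon₁₆₂ : Consumers162 where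
  HMLanglandsElement := (∀ N, ν.Everything N) ∧ True
  HMExceptional := True

/-- Every hundred-and-sixty-second-tranche edge holds in the canonical reading, for arbitrary ν. [cite: HundleyMiller2022, Thm 1 = Thm 2 (bookkeeping proved here)] -/
theorem canon_implications₁₆₂ : Implications162 ν (canon₁₆₂ ν) where
  hmExceptional := True.intro
  hmAsStated := fun b e => ⟨b, e⟩

end Canon162

/-- AT THE TOP: the bundle holds and both fields of row B138 HOLD — the tranche's `hundleyMiller_of_inputs` over `bookInputs_top`. [cite: HundleyMiller2022, Thm 1 = Thm 2 (bookkeeping proved here)] -/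
theorem c162_top : Implications162 νtop (canon₁₆₂ νtop) ∧ ((canon₁₆₂ νtop).HMLanglandsElement ∧ (canon₁₆₂ νtop).HMExceptional) :=
  have Y := canon_implications₁₆₂ νtop
  ⟨Y, hundleyMiller_of_inputs Y bookInputs_top⟩

/-- BOOK SIDE: in the book countermodel of ANY of the 24 leaves `l` the bundle holds, Theorem 1 AS STATED FAILS and the exceptional part HOLDS — all 24 book leaves are load-bearing for the
statement through its classical cases (SO(n,n), SO(n,n+1), Sp(2n): « settled by Mœglin [Moeglin] and Arthur [Arthur-book] »), none for the paper's own exceptional-group theorem. [cite: HundleyMiller2022, §4 (arXiv:1908.04363 p0010:L31), §2 (p0005:L7) (separating models; bookkeeping proved here)] -/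
theorem c162_book_cm (l : LeafSupport.Leaf) :
    ¬ (LeafSupport.mkN (LeafSupport.cm l)).leaf l ∧ Implications162 (LeafSupport.mkN (LeafSupport.cm l)) (canon₁₆₂ (LeafSupport.mkN (LeafSupport.cm l))) ∧ ¬ (canon₁₆₂ (LeafSupport.mkN (LeafSupport.cm l))).HMLanglandsElement ∧ (canon₁₆₂ (LeafSupport.mkN (LeafSupport.cm l))).HMExceptional :=
  have nb := not_B_cm l
  ⟨(LeafSupport.countermodel l).2.2.1, canon_implications₁₆₂ (LeafSupport.mkN (LeafSupport.cm l)), fun h => nb h.1, True.intro⟩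

/-- THE HUNDRED-AND-SIXTY-SECOND TRANCHE REGRADED, in one statement: (i) at the top both fields hold; (ii) in the book countermodel of any of the 24 leaves Theorem 1 as stated fails and the
exceptional part holds; (iii) the control holds for every ν.  Supports, exact: support(`HMLanglandsElement`) = the 24 book leaves; support(`HMExceptional`) = ∅. [cite: HundleyMiller2022, Thm 1 = Thm 2 (bookkeeping proved here)] -/
theorem c162_regraded :
    ((canon₁₆₂ νtop).HMLanglandsElement ∧ (canon₁₆₂ νtop).HMExceptional) ∧
      (∀ l : LeafSupport.Leaf, ¬ (LeafSupport.mkN (LeafSupport.cm l)).leaf l ∧ ¬ (canon₁₆₂ (LeafSupport.mkN (LeafSupport.cm l))).HMLanglandsElement ∧ (canon₁₆₂ (LeafSupport.mkN (LeafSupport.cm l))).HMExceptional) ∧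
      (∀ ν : Nodes, (canon₁₆₂ ν).HMExceptional) :=
  ⟨c162_top.2, fun l => have h := c162_book_cm l; ⟨h.1, h.2.2.1, h.2.2.2⟩, fun _ => True.intro⟩

/-! ## 165. Hundred-and-sixty-third tranche (v5 of this file, after `Downstream45.lean` v3; unit `pub-arthur-down-g69`, downstream tracer gen 69): supports of row C143 (Y. Liu – Y. Tian – L. Xiao –
W. Zhang – X. Zhu, *Deformation of rigid conjugate self-dual Galois representations*, Acta Math. Sin. (Engl. Ser.) 40 (2024) 1599–1644 — typed in tranche 163, graded `[g5c]` long before) and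
of NEW row B139 (Y. Mieda, *On the formal degree conj. for simple supercuspidal representations*, Math. Res. Lett. 28 (2021) 1227–1242).  The canonical reading `canon₁₆₃ ν μ κ c₅₉` over an
ARBITRARY tranche-59 assignment `c₅₉` (of which only row B30's field `OiSSC` is read; section 59's `canon₅₉ ν μ κ` gives it the value « the book at every rank »): C143's node := Mok at every
rank ∧ KMSW's proved scope at every rank; Theorem 3.6.3 := the node's value; Theorem 4.2.6 := `True` (control); Theorem 1.0.1 := Theorem 3.6.3's value ∧ `True`; B139's Theorem 2.1 :=
`True` (control); Theorem 3.5 := the book at every rank ∧ `c₅₉.OiSSC` ∧ `True`.  Every tranche-163 edge holds in it for every ν, μ, κ, c₅₉ (`canon_implications₁₆₃`).  READINGS: (i) AT THE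
TOP (c₅₉ := `canon₅₉ νtop μtop κtop`) all six fields HOLD — C143's by the tranche's `ltxzz2_of_inputs` over `mokInputs_top` / `kmswInputs_top`, B139's by `mieda_of_inputs` over the
canonical bundles of tranches 35, 45, 54, 59 and `bookInputs_top` (`c163_top`); (ii) BOOK SIDE: in each of the 24 book countermodels (Mok / KMSW at the top, c₅₉ := section 59's reading of
the countermodel) B139's Theorem 3.5 FAILS, its control holds, and ALL FOUR of C143's fields HOLD — no book leaf in C143's support, all 24 in B139's (`c163_book_cm`); (iii) B30 DENIED:
with ν at the top and a tranche-59 assignment whose `OiSSC` is false (all other fields true) Theorem 3.5 FAILS while the bundle holds — row B30 is a genuine premise of B139, not a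
re-reading of the book sentence (`c163_B30_denied`; B30's own certified support = the 24 book leaves, section 59 `simpleSC_book_cm`); (iv) MOK SIDE: in each of Mok's 29 countermodels
(KMSW at the top) C143's node, Theorem 3.6.3 and Theorem 1.0.1 FAIL, its control holds, and B139's two fields HOLD (`c163_mok_cm`); (v) KMSW's MOK IMPORT DENIED (`κnoMok`): the same
three FAIL (`c163_kmsw_importDenied`); (vi) KMSW LEAF BY LEAF (Mok at the top): each of the three holds IFF the leaf is sequel-only (`c163_kmsw_cm_iff`) — KMSW's proved-scope leaves are
load-bearing (« [KMSW, Theorem 1.7.1] for generic packets »), its unwritten sequels [KMS_A] / [KMS_B] and `AubertSS` are not; (vii) the two controls hold in every reading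
(`c163_controls`).  Supports, exact: support(`LTXZZ2BaseChange`) = support(`LTXZZ2RT`) = support(`LTXZZ2Combined`) = Mok's 29 leaves ∧ KMSW's proved-scope leaves, no book leaf;
support(`LTXZZ2Rigid`) = ∅; support(`MiedaFDCssc`) = the 24 book leaves (∧ row B30, whose support is the same 24 leaves); support(`MiedaExteriorSquare`) = ∅.  ERRATUM to the tranche-163
header docstring of `Downstream45.lean` v3 (p505180), one census id in a context remark: « [2018arXiv181200047B] (Beuzart-Plessis, unitary FDC = row C40's text) » should read « … = row C25's text »
(R. Beuzart-Plessis, arXiv:1812.00047, bib `BeuzartPlessis2021Plancherel`, typed in `Downstream7.lean`; C40 is Peng – Whitmore); no edge or support is affected. -/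

section Canon163

variable (ν : Nodes) (μ : Mok2015.Nodes) (κ : KMSW2014.Nodes)

/-- The canonical reading of row C143 and NEW row B139 over an arbitrary tranche-59 assignment (only `c₅₉.OiSSC` is read). [cite: LiuTianXiaoZhangZhu2024Rigid, Prop. 2.3.6, Thms 3.6.3, 4.2.6, 1.0.1; Mieda2021FormalDegreeSSC, Thms 2.1, 3.5 (canonical model; bookkeeping)] [claim: KalethaMinguezShinWhite2014, under-review] -/
abbrev canon₁₆₃ (c₅₉ : Consumers59) : Consumers163 where
  LTXZZ2BaseChange := (∀ N, μ.Everything N) ∧ (∀ N, κ.Scope N)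
  LTXZZ2RT := (∀ N, μ.Everything N) ∧ (∀ N, κ.Scope N)
  LTXZZ2Rigid := True
  LTXZZ2Combined := ((∀ N, μ.Everything N) ∧ (∀ N, κ.Scope N)) ∧ True
  MiedaExteriorSquare := True
  MiedaFDCssc := (∀ N, ν.Everything N) ∧ c₅₉.OiSSC ∧ True

/-- Every hundred-and-sixty-third-tranche edge holds in the canonical reading, for arbitrary ν, μ, κ and an arbitrary tranche-59 assignment. [cite: LiuTianXiaoZhangZhu2024Rigid, Prop. 2.3.6, Thm 3.6.3; Mieda2021FormalDegreeSSC, Thm 3.5 (bookkeeping proved here)] [claim: KalethaMinguezShinWhite2014, under-review] -/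
theorem canon_implications₁₆₃ (c₅₉ : Consumers59) : Implications163 ν μ κ c₅₉ (canon₁₆₃ ν μ κ c₅₉) where
  ltxzz2BaseChange := fun m k => ⟨m, k⟩
  ltxzz2RT := fun h => h
  ltxzz2Rigid := True.intro
  ltxzz2Combined := fun r g => ⟨r, g⟩
  miedaExteriorSquare := True.intro
  miedaFDC := fun b h e => ⟨b, h, e⟩

end Canon163

/-- AT THE TOP (every leaf of the three DAGs granted; c₅₉ := section 59's canonical reading at the top): the bundle holds and ALL SIX fields HOLD — C143's four by the tranche's
`ltxzz2_of_inputs` over `mokInputs_top` and the proved-scope part of `kmswInputs_top`, B139's two by `mieda_of_inputs` over the canonical bundles of tranches 59, 35, 45, 54 and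
`bookInputs_top` (so row B30 is delivered, not assumed). [cite: LiuTianXiaoZhangZhu2024Rigid, Thms 3.6.3, 1.0.1; Mieda2021FormalDegreeSSC, Thm 3.5 (bookkeeping proved here)] [claim: KalethaMinguezShinWhite2014, under-review] -/
theorem c163_top :
    Implications163 νtop μtop κtop (canon₅₉ νtop μtop κtop) (canon₁₆₃ νtop μtop κtop (canon₅₉ νtop μtop κtop)) ∧
      ((canon₁₆₃ νtop μtop κtop (canon₅₉ νtop μtop κtop)).LTXZZ2BaseChange ∧ (canon₁₆₃ νtop μtop κtop (canon₅₉ νtop μtop κtop)).LTXZZ2RT ∧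
        (canon₁₆₃ νtop μtop κtop (canon₅₉ νtop μtop κtop)).LTXZZ2Rigid ∧ (canon₁₆₃ νtop μtop κtop (canon₅₉ νtop μtop κtop)).LTXZZ2Combined) ∧
      ((canon₁₆₃ νtop μtop κtop (canon₅₉ νtop μtop κtop)).MiedaFDCssc ∧ (canon₁₆₃ νtop μtop κtop (canon₅₉ νtop μtop κtop)).MiedaExteriorSquare) :=
  have Y := canon_implications₁₆₃ νtop μtop κtop (canon₅₉ νtop μtop κtop)
  ⟨Y, ltxzz2_of_inputs Y mokInputs_top (kmswInputs_top μtop).1,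
    mieda_of_inputs Y (canon_implications₅₉ νtop μtop κtop) (canon_implications₃₅ νtop μtop κtop) (canon_implications₄₅ νtop μtop κtop) (canon_implications₅₄ νtop μtop κtop) bookInputs_top⟩

/-- BOOK SIDE: in the book countermodel of ANY of the 24 leaves `l` (Mok and KMSW at the top; c₅₉ := section 59's reading of the countermodel, in which row B30 fails — `simpleSC_book_cm`)
the bundle holds, B139's Theorem 3.5 FAILS and its control HOLDS, while ALL FOUR of C143's fields HOLD: every book leaf is load-bearing for B139 (« the local Langlands correspondence due
to Arthur [MR3135650] » and [Oi-ssc-classical]), none for C143 (no symplectic / orthogonal group in its text). [cite: Mieda2021FormalDegreeSSC, §3 (arXiv:1908.11185 p0007:L23-24, L114); LiuTianXiaoZhangZhu2024Rigid, Prop. 2.3.6 (separating models; bookkeeping proved here)] [claim: KalethaMinguezShinWhite2014, under-review] -/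
theorem c163_book_cm (l : LeafSupport.Leaf) :
    ¬ (LeafSupport.mkN (LeafSupport.cm l)).leaf l ∧ Implications163 (LeafSupport.mkN (LeafSupport.cm l)) μtop κtop (canon₅₉ (LeafSupport.mkN (LeafSupport.cm l)) μtop κtop) (canon₁₆₃ (LeafSupport.mkN (LeafSupport.cm l)) μtop κtop (canon₅₉ (LeafSupport.mkN (LeafSupport.cm l)) μtop κtop)) ∧
      (¬ (canon₁₆₃ (LeafSupport.mkN (LeafSupport.cm l)) μtop κtop (canon₅₉ (LeafSupport.mkN (LeafSupport.cm l)) μtop κtop)).MiedaFDCssc ∧ (canon₁₆₃ (LeafSupport.mkN (LeafSupport.cm l)) μtop κtop (canon₅₉ (LeafSupport.mkN (LeafSupport.cm l)) μtop κtop)).MiedaExteriorSquare) ∧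
      ((canon₁₆₃ (LeafSupport.mkN (LeafSupport.cm l)) μtop κtop (canon₅₉ (LeafSupport.mkN (LeafSupport.cm l)) μtop κtop)).LTXZZ2BaseChange ∧ (canon₁₆₃ (LeafSupport.mkN (LeafSupport.cm l)) μtop κtop (canon₅₉ (LeafSupport.mkN (LeafSupport.cm l)) μtop κtop)).LTXZZ2RT ∧
        (canon₁₆₃ (LeafSupport.mkN (LeafSupport.cm l)) μtop κtop (canon₅₉ (LeafSupport.mkN (LeafSupport.cm l)) μtop κtop)).LTXZZ2Rigid ∧ (canon₁₆₃ (LeafSupport.mkN (LeafSupport.cm l)) μtop κtop (canon₅₉ (LeafSupport.mkN (LeafSupport.cm l)) μtop κtop)).LTXZZ2Combined) :=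
  have nb := not_B_cm l
  have Y := canon_implications₁₆₃ (LeafSupport.mkN (LeafSupport.cm l)) μtop κtop (canon₅₉ (LeafSupport.mkN (LeafSupport.cm l)) μtop κtop)
  ⟨(LeafSupport.countermodel l).2.2.1, Y, ⟨fun h => nb h.1, True.intro⟩, ltxzz2_of_inputs Y mokInputs_top (kmswInputs_top μtop).1⟩

/-- ROW B30 DENIED: with the book at the top and a tranche-59 assignment in which `OiSSC` is false (every other field true; Mok / KMSW at the top) the bundle holds and B139's Theorem 3.5
FAILS — Oi's Theorem 3.3 is a genuine premise of the typed edge (its own support, section 59, is the 24 book leaves); C143's fields and both controls are untouched. [cite: Mieda2021FormalDegreeSSC, Thm 3.3 as used in §3 (arXiv:1908.11185 p0007:L111-124, p0008:L26-29, L45, L99) (separating model; bookkeeping proved here)] -/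
theorem c163_B30_denied :
    Implications163 νtop μtop κtop ⟨True, True, False, True, True, True⟩ (canon₁₆₃ νtop μtop κtop ⟨True, True, False, True, True, True⟩) ∧
      ¬ (canon₁₆₃ νtop μtop κtop ⟨True, True, False, True, True, True⟩).MiedaFDCssc ∧ (canon₁₆₃ νtop μtop κtop ⟨True, True, False, True, True, True⟩).MiedaExteriorSquare ∧
      (canon₁₆₃ νtop μtop κtop ⟨True, True, False, True, True, True⟩).LTXZZ2Combined :=
  have Y := canon_implications₁₆₃ νtop μtop κtop ⟨True, True, False, True, True, True⟩
  ⟨Y, fun h => h.2.1, True.intro, (ltxzz2_of_inputs Y mokInputs_top (kmswInputs_top μtop).1).2.2.2⟩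

/-- MOK SIDE: in Mok's countermodel of ANY of the 29 Mok leaves `l` (book and KMSW at the top; c₅₉ := section 59's reading there) the bundle holds, C143's node, Theorem 3.6.3 and Theorem
1.0.1 FAIL, its control holds, and B139's two fields HOLD — Mok's leaves are load-bearing for C143 through « local base change … defined by … [Mok15,KMSW] for general N » and KMSW's Mok
import, and are not read by B139. [cite: LiuTianXiaoZhangZhu2024Rigid, §2.3 (arXiv:2108.06998v1 p0008:L2-3, L15) (separating model; bookkeeping proved here)] [claim: KalethaMinguezShinWhite2014, under-review] -/
theorem c163_mok_cm (l : Mok2015.LeafSupport.Leaf) :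
    ¬ (Mok2015.LeafSupport.mkN (Mok2015.LeafSupport.cm l)).leaf l ∧ Implications163 νtop (Mok2015.LeafSupport.mkN (Mok2015.LeafSupport.cm l)) κtop (canon₅₉ νtop (Mok2015.LeafSupport.mkN (Mok2015.LeafSupport.cm l)) κtop) (canon₁₆₃ νtop (Mok2015.LeafSupport.mkN (Mok2015.LeafSupport.cm l)) κtop (canon₅₉ νtop (Mok2015.LeafSupport.mkN (Mok2015.LeafSupport.cm l)) κtop)) ∧
      (¬ (canon₁₆₃ νtop (Mok2015.LeafSupport.mkN (Mok2015.LeafSupport.cm l)) κtop (canon₅₉ νtop (Mok2015.LeafSupport.mkN (Mok2015.LeafSupport.cm l)) κtop)).LTXZZ2BaseChange ∧ ¬ (canon₁₆₃ νtop (Mok2015.LeafSupport.mkN (Mok2015.LeafSupport.cm l)) κtop (canon₅₉ νtop (Mok2015.LeafSupport.mkN (Mok2015.LeafSupport.cm l)) κtop)).LTXZZ2RT ∧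
        ¬ (canon₁₆₃ νtop (Mok2015.LeafSupport.mkN (Mok2015.LeafSupport.cm l)) κtop (canon₅₉ νtop (Mok2015.LeafSupport.mkN (Mok2015.LeafSupport.cm l)) κtop)).LTXZZ2Combined ∧ (canon₁₆₃ νtop (Mok2015.LeafSupport.mkN (Mok2015.LeafSupport.cm l)) κtop (canon₅₉ νtop (Mok2015.LeafSupport.mkN (Mok2015.LeafSupport.cm l)) κtop)).LTXZZ2Rigid) ∧
      ((canon₁₆₃ νtop (Mok2015.LeafSupport.mkN (Mok2015.LeafSupport.cm l)) κtop (canon₅₉ νtop (Mok2015.LeafSupport.mkN (Mok2015.LeafSupport.cm l)) κtop)).MiedaFDCssc ∧ (canon₁₆₃ νtop (Mok2015.LeafSupport.mkN (Mok2015.LeafSupport.cm l)) κtop (canon₅₉ νtop (Mok2015.LeafSupport.mkN (Mok2015.LeafSupport.cm l)) κtop)).MiedaExteriorSquare) :=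
  have nm := not_M_cm l
  have Y := canon_implications₁₆₃ νtop (Mok2015.LeafSupport.mkN (Mok2015.LeafSupport.cm l)) κtop (canon₅₉ νtop (Mok2015.LeafSupport.mkN (Mok2015.LeafSupport.cm l)) κtop)
  ⟨(Mok2015.LeafSupport.countermodel l).2.2.1, Y, ⟨fun h => nm h.1, fun h => nm h.1, fun h => nm h.1.1, True.intro⟩,
    mieda_of_inputs Y (canon_implications₅₉ νtop (Mok2015.LeafSupport.mkN (Mok2015.LeafSupport.cm l)) κtop) (canon_implications₃₅ νtop (Mok2015.LeafSupport.mkN (Mok2015.LeafSupport.cm l)) κtop) (canon_implications₄₅ νtop (Mok2015.LeafSupport.mkN (Mok2015.LeafSupport.cm l)) κtop) (canon_implications₅₄ νtop (Mok2015.LeafSupport.mkN (Mok2015.LeafSupport.cm l)) κtop) bookInputs_top⟩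

/-- KMSW SIDE, THE IMPORT: with the book and Mok at the top and KMSW's Mok import DENIED (`κnoMok`: the proved scope fails at every rank) the bundle holds and C143's node, Theorem 3.6.3
and Theorem 1.0.1 FAIL — KMSW is load-bearing through « This follows from [KMSW, Theorem 1.7.1] for generic packets ». [cite: LiuTianXiaoZhangZhu2024Rigid, Prop. 2.3.6 proof (arXiv:2108.06998v1 p0008:L15) (separating model; bookkeeping proved here)] [claim: KalethaMinguezShinWhite2014, under-review] -/
theorem c163_kmsw_importDenied :
    (∀ N, ¬ κnoMok.Scope N) ∧ Implications163 νtop μtop κnoMok (canon₅₉ νtop μtop κnoMok) (canon₁₆₃ νtop μtop κnoMok (canon₅₉ νtop μtop κnoMok)) ∧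
      (¬ (canon₁₆₃ νtop μtop κnoMok (canon₅₉ νtop μtop κnoMok)).LTXZZ2BaseChange ∧ ¬ (canon₁₆₃ νtop μtop κnoMok (canon₅₉ νtop μtop κnoMok)).LTXZZ2RT ∧
        ¬ (canon₁₆₃ νtop μtop κnoMok (canon₅₉ νtop μtop κnoMok)).LTXZZ2Combined) :=
  have ns : ∀ N, ¬ κnoMok.Scope N := κnoMok_facts.2.2.2.2.2.1
  ⟨ns, canon_implications₁₆₃ νtop μtop κnoMok (canon₅₉ νtop μtop κnoMok), ⟨fun h => ns 0 (h.2 0), fun h => ns 0 (h.2 0), fun h => ns 0 (h.1.2 0)⟩⟩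

/-- KMSW SIDE, LEAF BY LEAF: the book and Mok at the top, KMSW's countermodel of a KMSW leaf `l`: the bundle holds, and each of C143's node, Theorem 3.6.3, Theorem 1.0.1 HOLDS IFF `l` is a
sequel-only leaf — the proved scope ([KMSW, Theorem 1.7.1] for generic parameters on the unitary group of a hermitian space, E/F a field) is what the text uses; the unwritten sequels
[KMS_A] / [KMS_B] and Aubert's involution are not consumed. [cite: LiuTianXiaoZhangZhu2024Rigid, Prop. 2.3.6 proof (arXiv:2108.06998v1 p0008:L15) (separating models; bookkeeping proved here)] [claim: KalethaMinguezShinWhite2014, under-review] -/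
theorem c163_kmsw_cm_iff (l : KMSW2014.LeafSupport.Leaf) :
    Implications163 νtop μtop (KMSW2014.LeafSupport.mkN (KMSW2014.LeafSupport.cm l)) (canon₅₉ νtop μtop (KMSW2014.LeafSupport.mkN (KMSW2014.LeafSupport.cm l))) (canon₁₆₃ νtop μtop (KMSW2014.LeafSupport.mkN (KMSW2014.LeafSupport.cm l)) (canon₅₉ νtop μtop (KMSW2014.LeafSupport.mkN (KMSW2014.LeafSupport.cm l)))) ∧
      ((canon₁₆₃ νtop μtop (KMSW2014.LeafSupport.mkN (KMSW2014.LeafSupport.cm l)) (canon₅₉ νtop μtop (KMSW2014.LeafSupport.mkN (KMSW2014.LeafSupport.cm l)))).LTXZZ2BaseChange ↔ l.onlyFull = true) ∧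
      ((canon₁₆₃ νtop μtop (KMSW2014.LeafSupport.mkN (KMSW2014.LeafSupport.cm l)) (canon₅₉ νtop μtop (KMSW2014.LeafSupport.mkN (KMSW2014.LeafSupport.cm l)))).LTXZZ2RT ↔ l.onlyFull = true) ∧
      ((canon₁₆₃ νtop μtop (KMSW2014.LeafSupport.mkN (KMSW2014.LeafSupport.cm l)) (canon₅₉ νtop μtop (KMSW2014.LeafSupport.mkN (KMSW2014.LeafSupport.cm l)))).LTXZZ2Combined ↔ l.onlyFull = true) := by
  have node_iff : (canon₁₆₃ νtop μtop (KMSW2014.LeafSupport.mkN (KMSW2014.LeafSupport.cm l)) (canon₅₉ νtop μtop (KMSW2014.LeafSupport.mkN (KMSW2014.LeafSupport.cm l)))).LTXZZ2BaseChange ↔ l.onlyFull = true := by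
    refine ⟨fun h => ?_, fun h => ?_⟩
    · cases hb : l.onlyFull
      · exact absurd h.2 fun hk => KMSW2014.LeafSupport.not_scope_of (KMSW2014.LeafSupport.scope_fails l hb 0) (hk 0)
      · rfl
    · exact ⟨mokInputs_top.everything, scope_of_onlyFull l h⟩
  exact ⟨canon_implications₁₆₃ νtop μtop (KMSW2014.LeafSupport.mkN (KMSW2014.LeafSupport.cm l)) (canon₅₉ νtop μtop (KMSW2014.LeafSupport.mkN (KMSW2014.LeafSupport.cm l))), node_iff, node_iff, ⟨fun h => node_iff.1 h.1, fun h => ⟨node_iff.2 h, True.intro⟩⟩⟩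

/-- THE TWO CONTROLS hold in every reading (every ν, μ, κ, c₅₉). [cite: LiuTianXiaoZhangZhu2024Rigid, Thm 4.2.6; Mieda2021FormalDegreeSSC, Thm 2.1 (bookkeeping proved here)] -/
theorem c163_controls (ν : Nodes) (μ : Mok2015.Nodes) (κ : KMSW2014.Nodes) (c₅₉ : Consumers59) :
    (canon₁₆₃ ν μ κ c₅₉).LTXZZ2Rigid ∧ (canon₁₆₃ ν μ κ c₅₉).MiedaExteriorSquare :=
  hundredsixtythird_controls (canon_implications₁₆₃ ν μ κ c₅₉)

/-- THE HUNDRED-AND-SIXTY-THIRD TRANCHE REGRADED, in one statement: (i) at the top all six fields hold; (ii) in the book countermodel of any of the 24 leaves B139's Theorem 3.5 fails and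
C143's node holds; (iii) with row B30 denied (book at the top) Theorem 3.5 fails; (iv) in Mok's countermodel of any of the 29 Mok leaves C143's node and Theorem 1.0.1 fail and B139's
Theorem 3.5 holds; (v) with KMSW's Mok import denied C143's node fails; (vi) in KMSW's countermodel of a KMSW leaf C143's Theorem 1.0.1 holds iff the leaf is sequel-only; (vii) the two
controls hold for every ν, μ, κ, c₅₉.  Supports, exact: support(C143's node / Thm 3.6.3 / Thm 1.0.1) = Mok's 29 leaves ∧ KMSW's proved-scope leaves; support(B139's Thm 3.5) = the 24
book leaves; support(Thm 4.2.6) = support(Thm 2.1) = ∅. [cite: LiuTianXiaoZhangZhu2024Rigid, Prop. 2.3.6, Thms 3.6.3, 4.2.6, 1.0.1; Mieda2021FormalDegreeSSC, Thms 2.1, 3.5 (bookkeeping proved here)] [claim: KalethaMinguezShinWhite2014, under-review] -/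
theorem c163_regraded :
    (((canon₁₆₃ νtop μtop κtop (canon₅₉ νtop μtop κtop)).LTXZZ2BaseChange ∧ (canon₁₆₃ νtop μtop κtop (canon₅₉ νtop μtop κtop)).LTXZZ2RT ∧
        (canon₁₆₃ νtop μtop κtop (canon₅₉ νtop μtop κtop)).LTXZZ2Rigid ∧ (canon₁₆₃ νtop μtop κtop (canon₅₉ νtop μtop κtop)).LTXZZ2Combined) ∧
      ((canon₁₆₃ νtop μtop κtop (canon₅₉ νtop μtop κtop)).MiedaFDCssc ∧ (canon₁₆₃ νtop μtop κtop (canon₅₉ νtop μtop κtop)).MiedaExteriorSquare)) ∧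
      (∀ l : LeafSupport.Leaf, ¬ (LeafSupport.mkN (LeafSupport.cm l)).leaf l ∧ ¬ (canon₁₆₃ (LeafSupport.mkN (LeafSupport.cm l)) μtop κtop (canon₅₉ (LeafSupport.mkN (LeafSupport.cm l)) μtop κtop)).MiedaFDCssc ∧ (canon₁₆₃ (LeafSupport.mkN (LeafSupport.cm l)) μtop κtop (canon₅₉ (LeafSupport.mkN (LeafSupport.cm l)) μtop κtop)).LTXZZ2BaseChange) ∧
      (¬ (canon₁₆₃ νtop μtop κtop ⟨True, True, False, True, True, True⟩).MiedaFDCssc) ∧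
      (∀ l : Mok2015.LeafSupport.Leaf, ¬ (Mok2015.LeafSupport.mkN (Mok2015.LeafSupport.cm l)).leaf l ∧ ¬ (canon₁₆₃ νtop (Mok2015.LeafSupport.mkN (Mok2015.LeafSupport.cm l)) κtop (canon₅₉ νtop (Mok2015.LeafSupport.mkN (Mok2015.LeafSupport.cm l)) κtop)).LTXZZ2BaseChange ∧
        ¬ (canon₁₆₃ νtop (Mok2015.LeafSupport.mkN (Mok2015.LeafSupport.cm l)) κtop (canon₅₉ νtop (Mok2015.LeafSupport.mkN (Mok2015.LeafSupport.cm l)) κtop)).LTXZZ2Combined ∧ (canon₁₆₃ νtop (Mok2015.LeafSupport.mkN (Mok2015.LeafSupport.cm l)) κtop (canon₅₉ νtop (Mok2015.LeafSupport.mkN (Mok2015.LeafSupport.cm l)) κtop)).MiedaFDCssc) ∧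
      ((∀ N, ¬ κnoMok.Scope N) ∧ ¬ (canon₁₆₃ νtop μtop κnoMok (canon₅₉ νtop μtop κnoMok)).LTXZZ2BaseChange) ∧
      (∀ l : KMSW2014.LeafSupport.Leaf, (canon₁₆₃ νtop μtop (KMSW2014.LeafSupport.mkN (KMSW2014.LeafSupport.cm l)) (canon₅₉ νtop μtop (KMSW2014.LeafSupport.mkN (KMSW2014.LeafSupport.cm l)))).LTXZZ2Combined ↔ l.onlyFull = true) ∧
      (∀ (ν : Nodes) (μ : Mok2015.Nodes) (κ : KMSW2014.Nodes) (c₅₉ : Consumers59), (canon₁₆₃ ν μ κ c₅₉).LTXZZ2Rigid ∧ (canon₁₆₃ ν μ κ c₅₉).MiedaExteriorSquare) :=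
  ⟨c163_top.2,
    fun l =>
      have h := c163_book_cm l
      ⟨h.1, h.2.2.1.1, h.2.2.2.1⟩,
    c163_B30_denied.2.1,
    fun l =>
      have h := c163_mok_cm l
      ⟨h.1, h.2.2.1.1, h.2.2.1.2.2.1, h.2.2.2.1⟩,
    ⟨c163_kmsw_importDenied.1, c163_kmsw_importDenied.2.2.1⟩,
    fun l => (c163_kmsw_cm_iff l).2.2.2,
    c163_controls⟩

/-! ## 166. Hundred-and-sixty-fourth tranche (v6 of this file, after `Downstream45.lean` v4; unit `pub-arthur-down-g69`, downstream tracer gen 69): supports of NEW rows C318 (U. K. Anandavardhanan –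
N. Matringe, *Test vectors for finite periods and base change*, Adv. Math. 360 (2020) 106915) and C319 (V. Hernandez – B. Schraen, *The infinite fern in higher dimensions*, arXiv:2210.10564v2,
2023, PREPRINT).  The canonical reading `canon₁₆₄ μ c₃₄` over an ARBITRARY tranche-34 assignment `c₃₄` (of which only row C25's field `BPPlancherel` is read; section 37's `canon₃₄ μ κ` gives
it the value Mok ∧ KMSW-scope ∧ C24's value ∧ C60's value) and with NO book parameter: C318's Theorem 1.1 := `True` (control); Theorem 7.1 := Mok at every rank ∧ `c₃₄.BPPlancherel`; C319's
Theorem 8.8 := `True` (control); Corollary 8.13 := Mok at every rank ∧ `True`.  Every tranche-164 edge holds in it for every μ, c₃₄ (`canon_implications₁₆₄`).  READINGS: (i) AT THE TOP (c₃₄ :=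
`canon₃₄ μtop κtop`) all four fields HOLD — by the tranche's `hundredsixtyfourth_of_inputs` over the canonical bundles of tranches 34, 33, 6, `mokInputs_top`, `kmswInputs_top` and tranche 6's
hypothesis node granted (`trivial`), exactly as section 137 delivered Cai – Fan's C25 premise (`c164_top`); (ii) NO BOOK PARAMETER: the reading does not mention ν — no book leaf is in any
support by construction (neither text cites [Art13]); (iii) MOK SIDE: in each of Mok's 29 countermodels (KMSW read `κnoMok`, as in section 137) Theorem 7.1 and Corollary 8.13 FAIL, the two
controls hold (`c164_mok_cm`); (iv) KMSW's MOK IMPORT DENIED with Mok at the top (`κnoMok`): Theorem 7.1 FAILS (row C25 runs on KMSW's proved scope) while Corollary 8.13 HOLDS — C319 reads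
no KMSW (`c164_kmsw_importDenied`); (v) KMSW LEAF BY LEAF (Mok at the top): Theorem 7.1 holds IFF the leaf is sequel-only, Corollary 8.13 holds for every leaf (`c164_kmsw_cm_iff`); (vi) ROW C25
DENIED (c₃₄ := section 37's `canon₃₄noC60 μtop κtop`, in which `BPPlancherel` is false; Mok and KMSW at the top): Theorem 7.1 FAILS, Corollary 8.13 holds — Beuzart-Plessis's formal degree
theorem is a genuine premise of C318 (`c164_C25_denied`); (vii) the controls hold in every reading (`c164_controls`).  Supports, exact: support(`AMpadicFormalDegrees`) = Mok's 29 leaves ∧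
KMSW's proved-scope leaves (the latter only through C25); support(`HSFernDense`) = Mok's 29 leaves; support(`AMFiniteTestVectors`) = support(`HSInfiniteFern`) = ∅; no book leaf. -/

section Canon164

variable (μ : Mok2015.Nodes)

/-- The canonical reading of NEW rows C318 / C319 over an arbitrary tranche-34 assignment (only `c₃₄.BPPlancherel` is read); no book and no KMSW parameter of its own. [cite: AnandavardhananMatringe2020, Thms 1.1, 7.1; HernandezSchraen2023InfiniteFern, Thm 8.8, Cor. 8.13 (canonical model; bookkeeping)] [claim: KalethaMinguezShinWhite2014, under-review] -/
abbrev canon₁₆₄ (c₃₄ : Consumers34) : Consumers164 where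
  AMFiniteTestVectors := True
  AMpadicFormalDegrees := (∀ N, μ.Everything N) ∧ c₃₄.BPPlancherel
  HSInfiniteFern := True
  HSFernDense := (∀ N, μ.Everything N) ∧ True

/-- Every hundred-and-sixty-fourth-tranche edge holds in the canonical reading, for arbitrary μ and an arbitrary tranche-34 assignment. [cite: AnandavardhananMatringe2020, Thm 7.1; HernandezSchraen2023InfiniteFern, Cor. 8.13 (bookkeeping proved here)] [claim: KalethaMinguezShinWhite2014, under-review] -/
theorem canon_implications₁₆₄ (c₃₄ : Consumers34) : Implications164 μ c₃₄ (canon₁₆₄ μ c₃₄) where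
  amFinite := True.intro
  amPadic := fun m p => ⟨m, p⟩
  hsFern := True.intro
  hsDense := fun m f => ⟨m, f⟩

end Canon164

/-- AT THE TOP (Mok and KMSW: every leaf granted; c₃₄ := section 37's `canon₃₄ μtop κtop`): the bundle holds and ALL FOUR fields HOLD — by the tranche's `hundredsixtyfourth_of_inputs` over
`canon_implications₃₄` / `canon_implications₃₃` / `canon_implications₆`, `mokInputs_top`, the proved-scope part of `kmswInputs_top` and tranche 6's hypothesis node (true in `canon₆`). [cite: AnandavardhananMatringe2020, Thm 7.1; HernandezSchraen2023InfiniteFern, Cor. 8.13 (bookkeeping proved here)] [claim: KalethaMinguezShinWhite2014, under-review] -/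
theorem c164_top :
    Implications164 μtop (canon₃₄ μtop κtop) (canon₁₆₄ μtop (canon₃₄ μtop κtop)) ∧
      (((canon₁₆₄ μtop (canon₃₄ μtop κtop)).AMFiniteTestVectors ∧ (canon₁₆₄ μtop (canon₃₄ μtop κtop)).AMpadicFormalDegrees) ∧
        ((canon₁₆₄ μtop (canon₃₄ μtop κtop)).HSInfiniteFern ∧ (canon₁₆₄ μtop (canon₃₄ μtop κtop)).HSFernDense)) :=
  have Y := canon_implications₁₆₄ μtop (canon₃₄ μtop κtop)
  ⟨Y, hundredsixtyfourth_of_inputs Y (canon_implications₃₄ νtop μtop κtop) (canon_implications₃₃ νtop μtop κtop) (canon_implications₆ νtop μtop κtop) mokInputs_top (kmswInputs_top μtop).1 trivial⟩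

/-- MOK SIDE: in Mok's countermodel of ANY of the 29 Mok leaves `l` (KMSW read `κnoMok`, c₃₄ := section 37's reading there) the bundle holds, C318's Theorem 7.1 and C319's Corollary 8.13 FAIL and
both controls HOLD — Mok's leaves are load-bearing through « now a theorem by the work of Mok [mok15] » / « the (unique) representation of U(n,K/k) that base changes to π » and through
« by [ Mok15, Thm. 2.4.2], there exists π0 ». [cite: AnandavardhananMatringe2020, §7 (arXiv:1805.04047 p0015:L5, L18); HernandezSchraen2023InfiniteFern, Cor. 8.13 proof (arXiv:2210.10564v2 p0040:L12) (separating model; bookkeeping proved here)] [claim: KalethaMinguezShinWhite2014, under-review] -/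
theorem c164_mok_cm (l : Mok2015.LeafSupport.Leaf) :
    ¬ (Mok2015.LeafSupport.mkN (Mok2015.LeafSupport.cm l)).leaf l ∧ Implications164 (Mok2015.LeafSupport.mkN (Mok2015.LeafSupport.cm l)) (canon₃₄ (Mok2015.LeafSupport.mkN (Mok2015.LeafSupport.cm l)) κnoMok) (canon₁₆₄ (Mok2015.LeafSupport.mkN (Mok2015.LeafSupport.cm l)) (canon₃₄ (Mok2015.LeafSupport.mkN (Mok2015.LeafSupport.cm l)) κnoMok)) ∧
      (¬ (canon₁₆₄ (Mok2015.LeafSupport.mkN (Mok2015.LeafSupport.cm l)) (canon₃₄ (Mok2015.LeafSupport.mkN (Mok2015.LeafSupport.cm l)) κnoMok)).AMpadicFormalDegrees ∧ ¬ (canon₁₆₄ (Mok2015.LeafSupport.mkN (Mok2015.LeafSupport.cm l)) (canon₃₄ (Mok2015.LeafSupport.mkN (Mok2015.LeafSupport.cm l)) κnoMok)).HSFernDense) ∧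
      ((canon₁₆₄ (Mok2015.LeafSupport.mkN (Mok2015.LeafSupport.cm l)) (canon₃₄ (Mok2015.LeafSupport.mkN (Mok2015.LeafSupport.cm l)) κnoMok)).AMFiniteTestVectors ∧ (canon₁₆₄ (Mok2015.LeafSupport.mkN (Mok2015.LeafSupport.cm l)) (canon₃₄ (Mok2015.LeafSupport.mkN (Mok2015.LeafSupport.cm l)) κnoMok)).HSInfiniteFern) :=
  have nm := not_M_cm l
  ⟨(Mok2015.LeafSupport.countermodel l).2.2.1, canon_implications₁₆₄ (Mok2015.LeafSupport.mkN (Mok2015.LeafSupport.cm l)) (canon₃₄ (Mok2015.LeafSupport.mkN (Mok2015.LeafSupport.cm l)) κnoMok), ⟨fun h => nm h.1, fun h => nm h.1⟩, ⟨True.intro, True.intro⟩⟩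

/-- KMSW SIDE, THE IMPORT: Mok at the top, KMSW's Mok import DENIED (`κnoMok`: the proved scope fails at every rank): the bundle holds, C318's Theorem 7.1 FAILS — its row-C25 premise runs on
KMSW's proved scope (section 37) — while C319's Corollary 8.13 HOLDS: Hernandez – Schraen read Mok only (U quasi-split). [cite: AnandavardhananMatringe2020, §7 (arXiv:1805.04047 p0015:L14, L38); HernandezSchraen2023InfiniteFern, Cor. 8.13 proof (separating model; bookkeeping proved here)] [claim: KalethaMinguezShinWhite2014, under-review] -/
theorem c164_kmsw_importDenied :
    (∀ N, ¬ κnoMok.Scope N) ∧ Implications164 μtop (canon₃₄ μtop κnoMok) (canon₁₆₄ μtop (canon₃₄ μtop κnoMok)) ∧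
      ¬ (canon₁₆₄ μtop (canon₃₄ μtop κnoMok)).AMpadicFormalDegrees ∧ (canon₁₆₄ μtop (canon₃₄ μtop κnoMok)).HSFernDense :=
  have ns : ∀ N, ¬ κnoMok.Scope N := κnoMok_facts.2.2.2.2.2.1
  ⟨ns, canon_implications₁₆₄ μtop (canon₃₄ μtop κnoMok), fun h => ns 0 (h.2.2.1 0), ⟨mokInputs_top.everything, True.intro⟩⟩

/-- KMSW SIDE, LEAF BY LEAF: Mok at the top, KMSW's countermodel of a KMSW leaf `l`: the bundle holds; C318's Theorem 7.1 holds IFF `l` is a sequel-only leaf (through C25: Beuzart-Plessis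
uses the tempered = proved-scope packets of U(n)); C319's Corollary 8.13 holds for every `l`. [cite: AnandavardhananMatringe2020, Thm 7.1; HernandezSchraen2023InfiniteFern, Cor. 8.13 (separating models; bookkeeping proved here)] [claim: KalethaMinguezShinWhite2014, under-review] -/
theorem c164_kmsw_cm_iff (l : KMSW2014.LeafSupport.Leaf) :
    Implications164 μtop (canon₃₄ μtop (KMSW2014.LeafSupport.mkN (KMSW2014.LeafSupport.cm l))) (canon₁₆₄ μtop (canon₃₄ μtop (KMSW2014.LeafSupport.mkN (KMSW2014.LeafSupport.cm l)))) ∧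
      ((canon₁₆₄ μtop (canon₃₄ μtop (KMSW2014.LeafSupport.mkN (KMSW2014.LeafSupport.cm l)))).AMpadicFormalDegrees ↔ l.onlyFull = true) ∧ (canon₁₆₄ μtop (canon₃₄ μtop (KMSW2014.LeafSupport.mkN (KMSW2014.LeafSupport.cm l)))).HSFernDense := by
  have m : ∀ N, μtop.Everything N := mokInputs_top.everything
  have sc : (∀ N, (KMSW2014.LeafSupport.mkN (KMSW2014.LeafSupport.cm l)).Scope N) ↔ l.onlyFull = true := by
    refine ⟨fun h => ?_, fun h => scope_of_onlyFull l h⟩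
    cases hb : l.onlyFull
    · exact absurd (h 0) (KMSW2014.LeafSupport.not_scope_of (KMSW2014.LeafSupport.scope_fails l hb 0))
    · rfl
  have pl : ((∀ N, μtop.Everything N) ∧ (canon₃₄ μtop (KMSW2014.LeafSupport.mkN (KMSW2014.LeafSupport.cm l))).BPPlancherel) ↔ l.onlyFull = true :=
    ⟨fun h => sc.1 h.2.2.1, fun h => have s := sc.2 h
      ⟨m, m, s, ⟨m, s⟩, ⟨m, s, ⟨m, s⟩, ⟨m, s⟩⟩⟩⟩
  exact ⟨canon_implications₁₆₄ μtop (canon₃₄ μtop (KMSW2014.LeafSupport.mkN (KMSW2014.LeafSupport.cm l))), pl, ⟨m, True.intro⟩⟩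

/-- ROW C25 DENIED: Mok and KMSW at the top, c₃₄ := section 37's `canon₃₄noC60 μtop κtop` (a tranche-34 assignment in which `BPPlancherel` is false): the bundle holds, C318's Theorem 7.1
FAILS and C319's Corollary 8.13 holds — Beuzart-Plessis's formal degree theorem for U(n, K/k) is a genuine premise of the typed edge, not a re-reading of the Mok sentence. [cite: AnandavardhananMatringe2020, §7 (arXiv:1805.04047 p0015:L14, L38-40; p0016:L39-40) (separating model; bookkeeping proved here)] [claim: KalethaMinguezShinWhite2014, under-review] -/
theorem c164_C25_denied :
    Implications164 μtop (canon₃₄noC60 μtop κtop) (canon₁₆₄ μtop (canon₃₄noC60 μtop κtop)) ∧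
      ¬ (canon₁₆₄ μtop (canon₃₄noC60 μtop κtop)).AMpadicFormalDegrees ∧ (canon₁₆₄ μtop (canon₃₄noC60 μtop κtop)).HSFernDense :=
  ⟨canon_implications₁₆₄ μtop (canon₃₄noC60 μtop κtop), fun h => h.2, ⟨mokInputs_top.everything, True.intro⟩⟩

/-- THE TWO CONTROLS hold in every reading (every μ, c₃₄). [cite: AnandavardhananMatringe2020, Thm 1.1; HernandezSchraen2023InfiniteFern, Thm 8.8 (bookkeeping proved here)] -/
theorem c164_controls (μ : Mok2015.Nodes) (c₃₄ : Consumers34) : (canon₁₆₄ μ c₃₄).AMFiniteTestVectors ∧ (canon₁₆₄ μ c₃₄).HSInfiniteFern :=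
  hundredsixtyfourth_controls (canon_implications₁₆₄ μ c₃₄)

/-- THE HUNDRED-AND-SIXTY-FOURTH TRANCHE REGRADED, in one statement: (i) at the top all four fields hold; (ii) in Mok's countermodel of any of the 29 Mok leaves C318's Theorem 7.1 and C319's
Corollary 8.13 fail; (iii) with KMSW's Mok import denied Theorem 7.1 fails and Corollary 8.13 holds; (iv) in KMSW's countermodel of a KMSW leaf Theorem 7.1 holds iff the leaf is sequel-only
and Corollary 8.13 holds; (v) with row C25 denied Theorem 7.1 fails; (vi) the controls hold for every μ, c₃₄; the reading has no book parameter.  Supports, exact: support(`AMpadicFormalDegrees`) =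
Mok's 29 leaves ∧ KMSW's proved-scope leaves; support(`HSFernDense`) = Mok's 29 leaves; support(`AMFiniteTestVectors`) = support(`HSInfiniteFern`) = ∅. [cite: AnandavardhananMatringe2020, Thms 1.1, 7.1; HernandezSchraen2023InfiniteFern, Thm 8.8, Cor. 8.13 (bookkeeping proved here)] [claim: KalethaMinguezShinWhite2014, under-review] -/
theorem c164_regraded :
    (((canon₁₆₄ μtop (canon₃₄ μtop κtop)).AMFiniteTestVectors ∧ (canon₁₆₄ μtop (canon₃₄ μtop κtop)).AMpadicFormalDegrees) ∧
        ((canon₁₆₄ μtop (canon₃₄ μtop κtop)).HSInfiniteFern ∧ (canon₁₆₄ μtop (canon₃₄ μtop κtop)).HSFernDense)) ∧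
      (∀ l : Mok2015.LeafSupport.Leaf, ¬ (Mok2015.LeafSupport.mkN (Mok2015.LeafSupport.cm l)).leaf l ∧ ¬ (canon₁₆₄ (Mok2015.LeafSupport.mkN (Mok2015.LeafSupport.cm l)) (canon₃₄ (Mok2015.LeafSupport.mkN (Mok2015.LeafSupport.cm l)) κnoMok)).AMpadicFormalDegrees ∧ ¬ (canon₁₆₄ (Mok2015.LeafSupport.mkN (Mok2015.LeafSupport.cm l)) (canon₃₄ (Mok2015.LeafSupport.mkN (Mok2015.LeafSupport.cm l)) κnoMok)).HSFernDense) ∧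
      ((∀ N, ¬ κnoMok.Scope N) ∧ ¬ (canon₁₆₄ μtop (canon₃₄ μtop κnoMok)).AMpadicFormalDegrees ∧ (canon₁₆₄ μtop (canon₃₄ μtop κnoMok)).HSFernDense) ∧
      (∀ l : KMSW2014.LeafSupport.Leaf, ((canon₁₆₄ μtop (canon₃₄ μtop (KMSW2014.LeafSupport.mkN (KMSW2014.LeafSupport.cm l)))).AMpadicFormalDegrees ↔ l.onlyFull = true) ∧ (canon₁₆₄ μtop (canon₃₄ μtop (KMSW2014.LeafSupport.mkN (KMSW2014.LeafSupport.cm l)))).HSFernDense) ∧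
      (¬ (canon₁₆₄ μtop (canon₃₄noC60 μtop κtop)).AMpadicFormalDegrees) ∧
      (∀ (μ : Mok2015.Nodes) (c₃₄ : Consumers34), (canon₁₆₄ μ c₃₄).AMFiniteTestVectors ∧ (canon₁₆₄ μ c₃₄).HSInfiniteFern) :=
  ⟨c164_top.2,
    fun l =>
      have h := c164_mok_cm l
      ⟨h.1, h.2.2.1.1, h.2.2.1.2⟩,
    ⟨c164_kmsw_importDenied.1, c164_kmsw_importDenied.2.2.1, c164_kmsw_importDenied.2.2.2⟩,
    fun l => (c164_kmsw_cm_iff l).2,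
    c164_C25_denied.2.1,
    c164_controls⟩

/-! ## 167. Hundred-and-sixty-fifth tranche (v7 of this file, after `Downstream45.lean` v5; unit `pub-arthur-down-g69`, downstream tracer gen 69): supports of NEW row B140 (M. Hanzer, *On the Muić
conj. — the irreducibility of the big theta lift*, arXiv:2510.10389v2, 2025, PREPRINT).  The canonical reading `canon₁₆₅ ν c₂ c₅ c₃₃ c₅₁ c₅₄` over ARBITRARY tranche-2 / 5 / 33 / 51 / 54
assignments, of which only B2's `XuMoeglinParam`, B5's `AtobeApackets`, B89's `AtobeWhichPackets`, the Mœglin – Tadić field `MoeglinTadicDS` and tranche 54's `MoeglinAdams` (B110),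
`MoeglinImage` (C168), `AtobeGanThetaSpO` (B7 for Sp – O), `BHtypeI` (B111) are read: the node := `c₅₄.MoeglinAdams`; Theorem 3.1 := the book at every rank ∧ the node's value ∧ the seven other
row values; the tempered part := the book ∧ Theorem 3.1's value ∧ `AtobeGanThetaSpO` ∧ `BHtypeI`.  Every tranche-165 edge holds in it (`canon_implications₁₆₅`).  READINGS: (i) AT THE TOP
(the canonical readings `canon₂` / `canon₅` / `canon₃₃` / `canon₅₁` / `canon₅₄` at the all-ones assignment) all three fields HOLD — by the tranche's `hanzer_of_rows` fed with section 54's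
`fiftyfourth_holds_top` (C168, B110, B7 for Sp – O, B111 at the top) and the book-valued rows (`c165_top`); (ii) BOOK SIDE: in each of the 24 book countermodels all three FAIL
(`c165_book_cm`); (iii) B75's GRANTED REMAINDER: in section 54's denied-remainder reading `canon₅₄noR νtop` (the book at the top; Arthur's announced packets beyond the book's case denied) the
node, Theorem 3.1 and the tempered part all FAIL — B140 inherits the remainder through [26] = B110 and [27] = C168 (`c165_needs_remainder`), exactly as section 54 recorded for B93 / B92 /
B62; (iv) NO MOK / KMSW: in Mok's countermodel of any Mok leaf (book at the top, KMSW read `κnoMok`, the tranche-2 / 5 / 33 readings evaluated there) all three HOLD (`c165_mok_cm`) — row B7's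
general field (symplectic, orthogonal AND unitary pairs: book ∧ Mok ∧ KMSW-scope) is NOT read, only its Sp – O instance.  Supports, exact: support(`HanzerBigTheta`) = support(`HanzerTempered`)
= the 24 book leaves, modulo B75's granted remainder (through B110 / C168); support(`HanzerAdamsInstance`) = support(B110) = the same; no Mok / KMSW leaf. -/

section Canon165

variable (ν : Nodes)

/-- The canonical reading of NEW row B140 over arbitrary tranche-2 / 5 / 33 / 51 / 54 assignments. [cite: Hanzer2025BigTheta, Prop. 2.1, Thm 3.1, Cor. 3.9 – Prop. 3.12 (canonical model; bookkeeping)] -/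
abbrev canon₁₆₅ (c₂ : Consumers2) (c₅ : Consumers5) (c₃₃ : Consumers33) (c₅₁ : Consumers51) (c₅₄ : Consumers54) : Consumers165 where
  HanzerAdamsInstance := c₅₄.MoeglinAdams
  HanzerBigTheta := (∀ N, ν.Everything N) ∧ c₅₄.MoeglinAdams ∧ c₅₄.MoeglinImage ∧ c₂.XuMoeglinParam ∧ c₅.AtobeApackets ∧ c₃₃.AtobeWhichPackets ∧ c₅₁.MoeglinTadicDS ∧
    c₅₄.AtobeGanThetaSpO ∧ c₅₄.BHtypeI
  HanzerTempered := (∀ N, ν.Everything N) ∧ ((∀ N, ν.Everything N) ∧ c₅₄.MoeglinAdams ∧ c₅₄.MoeglinImage ∧ c₂.XuMoeglinParam ∧ c₅.AtobeApackets ∧ c₃₃.AtobeWhichPackets ∧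
    c₅₁.MoeglinTadicDS ∧ c₅₄.AtobeGanThetaSpO ∧ c₅₄.BHtypeI) ∧ c₅₄.AtobeGanThetaSpO ∧ c₅₄.BHtypeI

/-- Every hundred-and-sixty-fifth-tranche edge holds in the canonical reading, for arbitrary ν and arbitrary tranche-2 / 5 / 33 / 51 / 54 assignments. [cite: Hanzer2025BigTheta, Prop. 2.1, Thm 3.1, Cor. 3.9 (bookkeeping proved here)] -/
theorem canon_implications₁₆₅ (c₂ : Consumers2) (c₅ : Consumers5) (c₃₃ : Consumers33) (c₅₁ : Consumers51) (c₅₄ : Consumers54) :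
    Implications165 ν c₂ c₅ c₃₃ c₅₁ c₅₄ (canon₁₆₅ ν c₂ c₅ c₃₃ c₅₁ c₅₄) where
  hanzerAdams := fun h => h
  hanzerBigTheta := fun b a i x ap wh mt ag bh => ⟨b, a, i, x, ap, wh, mt, ag, bh⟩
  hanzerTempered := fun b t ag bh => ⟨b, t, ag, bh⟩

end Canon165

/-- AT THE TOP (the book's every leaf granted; the canonical readings of tranches 2, 5, 33, 51, 54 at the all-ones assignment, B75's remainder granted as in `canon₅₄`): the bundle holds and
ALL THREE fields of row B140 HOLD — by the tranche's `hanzer_of_rows`, fed with section 54's `fiftyfourth_holds_top` for C168 / B110 / B7 (Sp – O) / B111 and with the book at the top for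
B2 / B5 / B89 / Mœglin – Tadić. [cite: Hanzer2025BigTheta, Thm 3.1 (bookkeeping proved here)] -/
theorem c165_top :
    Implications165 νtop (canon₂ νtop μtop κtop) (canon₅ νtop μtop κtop) (canon₃₃ νtop μtop κtop) (canon₅₁ νtop) (canon₅₄ νtop)
        (canon₁₆₅ νtop (canon₂ νtop μtop κtop) (canon₅ νtop μtop κtop) (canon₃₃ νtop μtop κtop) (canon₅₁ νtop) (canon₅₄ νtop)) ∧
      ((canon₁₆₅ νtop (canon₂ νtop μtop κtop) (canon₅ νtop μtop κtop) (canon₃₃ νtop μtop κtop) (canon₅₁ νtop) (canon₅₄ νtop)).HanzerAdamsInstance ∧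
        (canon₁₆₅ νtop (canon₂ νtop μtop κtop) (canon₅ νtop μtop κtop) (canon₃₃ νtop μtop κtop) (canon₅₁ νtop) (canon₅₄ νtop)).HanzerBigTheta ∧
        (canon₁₆₅ νtop (canon₂ νtop μtop κtop) (canon₅ νtop μtop κtop) (canon₃₃ νtop μtop κtop) (canon₅₁ νtop) (canon₅₄ νtop)).HanzerTempered) :=
  have b : ∀ N, νtop.Everything N := bookInputs_top.everything
  have f := fiftyfourth_holds_top
  have Y := canon_implications₁₆₅ νtop (canon₂ νtop μtop κtop) (canon₅ νtop μtop κtop) (canon₃₃ νtop μtop κtop) (canon₅₁ νtop) (canon₅₄ νtop)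
  ⟨Y, hanzer_of_rows Y b f.2.1 f.1 b b b b f.2.2.2.2.1 f.2.2.2.2.2.1⟩

/-- BOOK SIDE: in the book countermodel of ANY of the 24 leaves `l` (the tranche-2 / 5 / 33 / 51 / 54 readings evaluated there, Mok / KMSW at the top) the bundle holds and ALL THREE fields of
row B140 FAIL — every book leaf is load-bearing (« Recall ([2]) that a discrete series representation … can be described using its L-parameter (φ, ε) »). [cite: Hanzer2025BigTheta, §2 item 6 (arXiv:2510.10389v2 p0004:L41) (separating models; bookkeeping proved here)] -/
theorem c165_book_cm (l : LeafSupport.Leaf) :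
    ¬ (LeafSupport.mkN (LeafSupport.cm l)).leaf l ∧
      Implications165 (LeafSupport.mkN (LeafSupport.cm l)) (canon₂ (LeafSupport.mkN (LeafSupport.cm l)) μtop κtop) (canon₅ (LeafSupport.mkN (LeafSupport.cm l)) μtop κtop) (canon₃₃ (LeafSupport.mkN (LeafSupport.cm l)) μtop κtop) (canon₅₁ (LeafSupport.mkN (LeafSupport.cm l))) (canon₅₄ (LeafSupport.mkN (LeafSupport.cm l)))
        (canon₁₆₅ (LeafSupport.mkN (LeafSupport.cm l)) (canon₂ (LeafSupport.mkN (LeafSupport.cm l)) μtop κtop) (canon₅ (LeafSupport.mkN (LeafSupport.cm l)) μtop κtop) (canon₃₃ (LeafSupport.mkN (LeafSupport.cm l)) μtop κtop) (canon₅₁ (LeafSupport.mkN (LeafSupport.cm l))) (canon₅₄ (LeafSupport.mkN (LeafSupport.cm l)))) ∧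
      (¬ (canon₁₆₅ (LeafSupport.mkN (LeafSupport.cm l)) (canon₂ (LeafSupport.mkN (LeafSupport.cm l)) μtop κtop) (canon₅ (LeafSupport.mkN (LeafSupport.cm l)) μtop κtop) (canon₃₃ (LeafSupport.mkN (LeafSupport.cm l)) μtop κtop) (canon₅₁ (LeafSupport.mkN (LeafSupport.cm l))) (canon₅₄ (LeafSupport.mkN (LeafSupport.cm l)))).HanzerAdamsInstance ∧
        ¬ (canon₁₆₅ (LeafSupport.mkN (LeafSupport.cm l)) (canon₂ (LeafSupport.mkN (LeafSupport.cm l)) μtop κtop) (canon₅ (LeafSupport.mkN (LeafSupport.cm l)) μtop κtop) (canon₃₃ (LeafSupport.mkN (LeafSupport.cm l)) μtop κtop) (canon₅₁ (LeafSupport.mkN (LeafSupport.cm l))) (canon₅₄ (LeafSupport.mkN (LeafSupport.cm l)))).HanzerBigTheta ∧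
        ¬ (canon₁₆₅ (LeafSupport.mkN (LeafSupport.cm l)) (canon₂ (LeafSupport.mkN (LeafSupport.cm l)) μtop κtop) (canon₅ (LeafSupport.mkN (LeafSupport.cm l)) μtop κtop) (canon₃₃ (LeafSupport.mkN (LeafSupport.cm l)) μtop κtop) (canon₅₁ (LeafSupport.mkN (LeafSupport.cm l))) (canon₅₄ (LeafSupport.mkN (LeafSupport.cm l)))).HanzerTempered) :=
  have nb := not_B_cm l
  ⟨(LeafSupport.countermodel l).2.2.1, canon_implications₁₆₅ (LeafSupport.mkN (LeafSupport.cm l)) _ _ _ _ _, ⟨fun h => nb h.1.1, fun h => nb h.1, fun h => nb h.1⟩⟩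

/-- B75's GRANTED REMAINDER IS LOAD-BEARING: at the top, with tranche 54 read in its DENIED-REMAINDER reading `canon₅₄noR νtop` (section 54: Arthur's announced packets beyond the book's
quasi-split symplectic / orthogonal case denied; the theta-side instances keep the book's value), the bundle holds and all three fields of row B140 FAIL — through [26] = B110 and [27] =
C168. [cite: Hanzer2025BigTheta, Prop. 2.1 proof (arXiv:2510.10389v2 p0007:L46-47), §2 item 11 (p0006:L9-13); Moeglin2011Adams, §1 (separating model; bookkeeping proved here)] -/
theorem c165_needs_remainder :
    Implications165 νtop (canon₂ νtop μtop κtop) (canon₅ νtop μtop κtop) (canon₃₃ νtop μtop κtop) (canon₅₁ νtop) (canon₅₄noR νtop)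
        (canon₁₆₅ νtop (canon₂ νtop μtop κtop) (canon₅ νtop μtop κtop) (canon₃₃ νtop μtop κtop) (canon₅₁ νtop) (canon₅₄noR νtop)) ∧
      (¬ (canon₁₆₅ νtop (canon₂ νtop μtop κtop) (canon₅ νtop μtop κtop) (canon₃₃ νtop μtop κtop) (canon₅₁ νtop) (canon₅₄noR νtop)).HanzerAdamsInstance ∧
        ¬ (canon₁₆₅ νtop (canon₂ νtop μtop κtop) (canon₅ νtop μtop κtop) (canon₃₃ νtop μtop κtop) (canon₅₁ νtop) (canon₅₄noR νtop)).HanzerBigTheta ∧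
        ¬ (canon₁₆₅ νtop (canon₂ νtop μtop κtop) (canon₅ νtop μtop κtop) (canon₃₃ νtop μtop κtop) (canon₅₁ νtop) (canon₅₄noR νtop)).HanzerTempered) ∧
      ((canon₅₄noR νtop).AtobeGanThetaSpO ∧ (canon₅₄noR νtop).BHtypeI) :=
  have b : ∀ N, νtop.Everything N := bookInputs_top.everything
  ⟨canon_implications₁₆₅ νtop _ _ _ _ _, ⟨fun h => h.1.2, fun h => h.2.1.1.2, fun h => h.2.1.2.1.1.2⟩, ⟨b, b⟩⟩

/-- NO MOK / KMSW LEAF: in Mok's countermodel of ANY Mok leaf `l` (the book at the top, KMSW read `κnoMok`, the tranche-2 / 5 / 33 readings evaluated there) the bundle holds and all three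
fields of row B140 HOLD — the reading takes row B7 only through its Sp – O instance (symplectic – even orthogonal pairs in the text), never through `Consumers5.AtobeGanTheta` (which carries
the unitary pairs and hence Mok ∧ KMSW-scope). [cite: Hanzer2025BigTheta, §1 (arXiv:2510.10389v2 p0003:L5-8) (separating model; bookkeeping proved here)] -/
theorem c165_mok_cm (l : Mok2015.LeafSupport.Leaf) :
    ¬ (Mok2015.LeafSupport.mkN (Mok2015.LeafSupport.cm l)).leaf l ∧
      Implications165 νtop (canon₂ νtop (Mok2015.LeafSupport.mkN (Mok2015.LeafSupport.cm l)) κnoMok) (canon₅ νtop (Mok2015.LeafSupport.mkN (Mok2015.LeafSupport.cm l)) κnoMok) (canon₃₃ νtop (Mok2015.LeafSupport.mkN (Mok2015.LeafSupport.cm l)) κnoMok) (canon₅₁ νtop) (canon₅₄ νtop)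
        (canon₁₆₅ νtop (canon₂ νtop (Mok2015.LeafSupport.mkN (Mok2015.LeafSupport.cm l)) κnoMok) (canon₅ νtop (Mok2015.LeafSupport.mkN (Mok2015.LeafSupport.cm l)) κnoMok) (canon₃₃ νtop (Mok2015.LeafSupport.mkN (Mok2015.LeafSupport.cm l)) κnoMok) (canon₅₁ νtop) (canon₅₄ νtop)) ∧
      ((canon₁₆₅ νtop (canon₂ νtop (Mok2015.LeafSupport.mkN (Mok2015.LeafSupport.cm l)) κnoMok) (canon₅ νtop (Mok2015.LeafSupport.mkN (Mok2015.LeafSupport.cm l)) κnoMok) (canon₃₃ νtop (Mok2015.LeafSupport.mkN (Mok2015.LeafSupport.cm l)) κnoMok) (canon₅₁ νtop) (canon₅₄ νtop)).HanzerAdamsInstance ∧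
        (canon₁₆₅ νtop (canon₂ νtop (Mok2015.LeafSupport.mkN (Mok2015.LeafSupport.cm l)) κnoMok) (canon₅ νtop (Mok2015.LeafSupport.mkN (Mok2015.LeafSupport.cm l)) κnoMok) (canon₃₃ νtop (Mok2015.LeafSupport.mkN (Mok2015.LeafSupport.cm l)) κnoMok) (canon₅₁ νtop) (canon₅₄ νtop)).HanzerBigTheta ∧
        (canon₁₆₅ νtop (canon₂ νtop (Mok2015.LeafSupport.mkN (Mok2015.LeafSupport.cm l)) κnoMok) (canon₅ νtop (Mok2015.LeafSupport.mkN (Mok2015.LeafSupport.cm l)) κnoMok) (canon₃₃ νtop (Mok2015.LeafSupport.mkN (Mok2015.LeafSupport.cm l)) κnoMok) (canon₅₁ νtop) (canon₅₄ νtop)).HanzerTempered) :=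
  have b : ∀ N, νtop.Everything N := bookInputs_top.everything
  have f := fiftyfourth_holds_top
  have Y := canon_implications₁₆₅ νtop (canon₂ νtop (Mok2015.LeafSupport.mkN (Mok2015.LeafSupport.cm l)) κnoMok) (canon₅ νtop (Mok2015.LeafSupport.mkN (Mok2015.LeafSupport.cm l)) κnoMok) (canon₃₃ νtop (Mok2015.LeafSupport.mkN (Mok2015.LeafSupport.cm l)) κnoMok) (canon₅₁ νtop) (canon₅₄ νtop)
  ⟨(Mok2015.LeafSupport.countermodel l).2.2.1, Y, hanzer_of_rows Y b f.2.1 f.1 b b b b f.2.2.2.2.1 f.2.2.2.2.2.1⟩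

/-- THE HUNDRED-AND-SIXTY-FIFTH TRANCHE REGRADED, in one statement: (i) at the top all three fields of row B140 hold; (ii) in the book countermodel of any of the 24 leaves all three fail;
(iii) in section 54's denied-remainder reading all three fail while the theta-side instances hold; (iv) in Mok's countermodel of any Mok leaf all three hold.  Supports, exact:
support(`HanzerAdamsInstance`) = support(`HanzerBigTheta`) = support(`HanzerTempered`) = the 24 book leaves, modulo B75's granted remainder; no Mok / KMSW leaf. [cite: Hanzer2025BigTheta, Prop. 2.1, Thm 3.1, Cor. 3.9 – Prop. 3.12 (bookkeeping proved here)] -/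
theorem c165_regraded :
    ((canon₁₆₅ νtop (canon₂ νtop μtop κtop) (canon₅ νtop μtop κtop) (canon₃₃ νtop μtop κtop) (canon₅₁ νtop) (canon₅₄ νtop)).HanzerAdamsInstance ∧
        (canon₁₆₅ νtop (canon₂ νtop μtop κtop) (canon₅ νtop μtop κtop) (canon₃₃ νtop μtop κtop) (canon₅₁ νtop) (canon₅₄ νtop)).HanzerBigTheta ∧
        (canon₁₆₅ νtop (canon₂ νtop μtop κtop) (canon₅ νtop μtop κtop) (canon₃₃ νtop μtop κtop) (canon₅₁ νtop) (canon₅₄ νtop)).HanzerTempered) ∧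
      (∀ l : LeafSupport.Leaf, ¬ (LeafSupport.mkN (LeafSupport.cm l)).leaf l ∧
        ¬ (canon₁₆₅ (LeafSupport.mkN (LeafSupport.cm l)) (canon₂ (LeafSupport.mkN (LeafSupport.cm l)) μtop κtop) (canon₅ (LeafSupport.mkN (LeafSupport.cm l)) μtop κtop) (canon₃₃ (LeafSupport.mkN (LeafSupport.cm l)) μtop κtop) (canon₅₁ (LeafSupport.mkN (LeafSupport.cm l))) (canon₅₄ (LeafSupport.mkN (LeafSupport.cm l)))).HanzerBigTheta ∧
        ¬ (canon₁₆₅ (LeafSupport.mkN (LeafSupport.cm l)) (canon₂ (LeafSupport.mkN (LeafSupport.cm l)) μtop κtop) (canon₅ (LeafSupport.mkN (LeafSupport.cm l)) μtop κtop) (canon₃₃ (LeafSupport.mkN (LeafSupport.cm l)) μtop κtop) (canon₅₁ (LeafSupport.mkN (LeafSupport.cm l))) (canon₅₄ (LeafSupport.mkN (LeafSupport.cm l)))).HanzerTempered) ∧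
      (¬ (canon₁₆₅ νtop (canon₂ νtop μtop κtop) (canon₅ νtop μtop κtop) (canon₃₃ νtop μtop κtop) (canon₅₁ νtop) (canon₅₄noR νtop)).HanzerBigTheta ∧
        (canon₅₄noR νtop).AtobeGanThetaSpO) ∧
      (∀ l : Mok2015.LeafSupport.Leaf, ¬ (Mok2015.LeafSupport.mkN (Mok2015.LeafSupport.cm l)).leaf l ∧
        (canon₁₆₅ νtop (canon₂ νtop (Mok2015.LeafSupport.mkN (Mok2015.LeafSupport.cm l)) κnoMok) (canon₅ νtop (Mok2015.LeafSupport.mkN (Mok2015.LeafSupport.cm l)) κnoMok) (canon₃₃ νtop (Mok2015.LeafSupport.mkN (Mok2015.LeafSupport.cm l)) κnoMok) (canon₅₁ νtop) (canon₅₄ νtop)).HanzerBigTheta) :=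
  ⟨c165_top.2,
    fun l =>
      have h := c165_book_cm l
      ⟨h.1, h.2.2.2.1, h.2.2.2.2⟩,
    ⟨c165_needs_remainder.2.1.2.1, c165_needs_remainder.2.2.1⟩,
    fun l =>
      have h := c165_mok_cm l
      ⟨h.1, h.2.2.2.1⟩⟩

/-! ## 168. Hundred-and-sixty-sixth tranche (v8 of this file, after `Downstream45.lean` v6; unit `pub-arthur-down-g69`, downstream tracer gen 69): supports of NEW rows C320 (F. Cléry –
G. van der Geer, Doc. Math. 23 (2018) 1129–1156, with G. Chenevier's Appendices A and B) and C321 (S. Tang, J. Théor. Nombres Bordeaux 33 (2021) 197–221).  The canonical reading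
`canon₁₆₆ ν c` over an ARBITRARY tranche-1 assignment `c : Consumers`, of which only `ChenevierLannesStar` (row C5's starred statements) and `KretShinGSp` (row C10) are read: the five
controls := `True`; Prop. A.1 (first assertion), Lemma A.2, Lemma 6.3 := the book at every rank; Lemma A.3 (j = 36, 38) := `c.ChenevierLannesStar`; Prop. A.1 (second assertion) := the
conjunction of the values of Lemma A.2, Lemma A.3 (j ≤ 34) and Lemma A.3 (j = 36, 38); Theorem A.5 := the book ∧ Proposition 7.1's value; Tang's §6 := `c.KretShinGSp`.  Every tranche-166
edge holds in it (`canon_implications₁₆₆`).  READINGS: (i) AT THE TOP (`canon νtop μtop κtop`: C5★ and C10 take the book's value) the bundle holds and all twelve fields HOLD (`c166_top`, by the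
tranche's `chenevierTang_of_rows`); (ii) BOOK SIDE: in each of the 24 book countermodels (tranche 1 read canonically there) the seven book-fed fields all FAIL and the five controls hold
(`c166_book_cm`); (iii) ROW C5 IS A GENUINE PREMISE OF THE j = 36, 38 STEP: at the top with C5's starred statements denied (section 104's `c₁noC5`) Lemma A.3 (j = 36, 38) and Prop. A.1's
second assertion FAIL while Prop. A.1's first assertion, Lemma A.2 and Theorem A.5 HOLD (`c166_C5_denied`); (iv) ROW C10 IS A GENUINE PREMISE OF TANG's §6: at the top with C10 denied
(`c₁noC10`, defined here like `c₁noC5`) §6 FAILS while Lemma 6.3 HOLDS (`c166_C10_denied`); (v) NO MOK / KMSW: in Mok's countermodel of any Mok leaf (book at the top, KMSW read `κnoMok`,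
tranche 1 read canonically there) all twelve fields HOLD (`c166_mok_cm`).  Supports, exact: support(`ChenWeight1LevelOne`) = support(`ChenLemmaA2`) = support(`ChenThmA5`) =
support(`TangLemma63`) = the 24 book leaves; support(`ChenLemmaA3Top`) = support(C5★) = the 24 book leaves and support(`TangKretShinSpin`) = support(C10) = the 24 book leaves (sections 1 –
3 of `DownstreamSupport.lean`), hence support(`ChenWeight2LevelOne`) = the 24 book leaves; the five controls: ∅.  No Mok / KMSW leaf anywhere in the tranche. -/

section Canon166

variable (ν : Nodes)

/-- The canonical reading of NEW rows C320 / C321 over an arbitrary tranche-1 assignment. [cite: CleryVanDerGeer2018Chenevier, Thm 1.3, Prop. 7.1, App. A, App. B; Tang2021SpinMotivic, Thms 1.1, 1.2, §6, Lemma 6.3 (canonical model; bookkeeping)] -/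
abbrev canon₁₆₆ (c : Consumers) : Consumers166 where
  CvdGWeight2Vanishing := True
  CvdGSmallWeights := True
  ChenWeight1LevelOne := ∀ N, ν.Everything N
  ChenLemmaA2 := ∀ N, ν.Everything N
  ChenLemmaA3Low := True
  ChenLemmaA3Top := c.ChenevierLannesStar
  ChenWeight2LevelOne := (∀ N, ν.Everything N) ∧ True ∧ c.ChenevierLannesStar
  ChenThmA5 := (∀ N, ν.Everything N) ∧ True
  ChenAppBYoshida := True
  TangSpinSystems := True
  TangKretShinSpin := c.KretShinGSp
  TangLemma63 := ∀ N, ν.Everything N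

/-- Every hundred-and-sixty-sixth-tranche edge holds in the canonical reading, for arbitrary ν and an arbitrary tranche-1 assignment. [cite: CleryVanDerGeer2018Chenevier, App. A; Tang2021SpinMotivic, §6, Lemma 6.3 (bookkeeping proved here)] -/
theorem canon_implications₁₆₆ (c : Consumers) : Implications166 ν c (canon₁₆₆ ν c) where
  cvdgWeight2 := True.intro
  cvdgSmall := True.intro
  chenWeight1 := fun b => b
  chenLemmaA2 := fun b => b
  chenLemmaA3Low := True.intro
  chenLemmaA3Top := fun h => h
  chenWeight2 := fun a2 a3l a3t => ⟨a2, a3l, a3t⟩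
  chenThmA5 := fun b s => ⟨b, s⟩
  chenAppB := True.intro
  tangSpin := True.intro
  tangKretShin := fun h => h
  tangLemma63 := fun b => b

end Canon166

/-- Row C10 DENIED (`KretShinGSp := False`; the other tranche-1 fields as in `canon` at the top): a reading of `Consumers` used only to deny Kret – Shin's theorem; no first-tranche edge is claimed for it (defined like section 104's `c₁noC5`). [cite: KretShin2022, main theorem (separating model; bookkeeping)] -/
abbrev c₁noC10 : Consumers := { canon νtop μtop κtop with KretShinGSp := False }

/-- AT THE TOP (the book's every leaf granted; tranche 1 read canonically, so C5★ and C10 hold by sections 1 – 3): the bundle holds and ALL TWELVE fields of rows C320 / C321 HOLD — by the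
tranche's `hundredsixtysixth_controls` and `chenevierTang_of_rows`. [cite: CleryVanDerGeer2018Chenevier, App. A; Tang2021SpinMotivic, §6, Lemma 6.3 (bookkeeping proved here)] -/
theorem c166_top :
    Implications166 νtop (canon νtop μtop κtop) (canon₁₆₆ νtop (canon νtop μtop κtop)) ∧
      ((canon₁₆₆ νtop (canon νtop μtop κtop)).CvdGWeight2Vanishing ∧
        (canon₁₆₆ νtop (canon νtop μtop κtop)).CvdGSmallWeights ∧
        (canon₁₆₆ νtop (canon νtop μtop κtop)).ChenLemmaA3Low ∧
        (canon₁₆₆ νtop (canon νtop μtop κtop)).ChenAppBYoshida ∧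
        (canon₁₆₆ νtop (canon νtop μtop κtop)).TangSpinSystems) ∧
      (((canon₁₆₆ νtop (canon νtop μtop κtop)).ChenWeight1LevelOne ∧
        (canon₁₆₆ νtop (canon νtop μtop κtop)).ChenLemmaA2 ∧
        (canon₁₆₆ νtop (canon νtop μtop κtop)).ChenLemmaA3Top ∧
        (canon₁₆₆ νtop (canon νtop μtop κtop)).ChenWeight2LevelOne ∧
        (canon₁₆₆ νtop (canon νtop μtop κtop)).ChenThmA5) ∧
        ((canon₁₆₆ νtop (canon νtop μtop κtop)).TangKretShinSpin ∧
        (canon₁₆₆ νtop (canon νtop μtop κtop)).TangLemma63)) :=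
  have b : ∀ N, νtop.Everything N := bookInputs_top.everything
  have Y := canon_implications₁₆₆ νtop (canon νtop μtop κtop)
  ⟨Y, hundredsixtysixth_controls Y, chenevierTang_of_rows Y b b b⟩

/-- BOOK SIDE: in the book countermodel of ANY of the 24 leaves `l` (tranche 1 read canonically there, Mok / KMSW at the top) the bundle holds, the SEVEN book-fed fields all FAIL and
the five controls hold — every book leaf is load-bearing for Chenevier's Appendix A (« we may apply Arthur's theory [1] to such a π ») and for Tang's §6 / Lemma 6.3. [cite: CleryVanDerGeer2018Chenevier, App. A (arXiv:1709.01748v1 p0017:L44); Tang2021SpinMotivic, Lemma 6.3 (arXiv:2006.03585 p0017:L23-24) (separating models; bookkeeping proved here)] -/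
theorem c166_book_cm (l : LeafSupport.Leaf) :
    ¬ (LeafSupport.mkN (LeafSupport.cm l)).leaf l ∧
      Implications166 (LeafSupport.mkN (LeafSupport.cm l)) (canon (LeafSupport.mkN (LeafSupport.cm l)) μtop κtop) (canon₁₆₆ (LeafSupport.mkN (LeafSupport.cm l)) (canon (LeafSupport.mkN (LeafSupport.cm l)) μtop κtop)) ∧
      (¬ (canon₁₆₆ (LeafSupport.mkN (LeafSupport.cm l)) (canon (LeafSupport.mkN (LeafSupport.cm l)) μtop κtop)).ChenWeight1LevelOne ∧
        ¬ (canon₁₆₆ (LeafSupport.mkN (LeafSupport.cm l)) (canon (LeafSupport.mkN (LeafSupport.cm l)) μtop κtop)).ChenLemmaA2 ∧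
        ¬ (canon₁₆₆ (LeafSupport.mkN (LeafSupport.cm l)) (canon (LeafSupport.mkN (LeafSupport.cm l)) μtop κtop)).ChenLemmaA3Top ∧
        ¬ (canon₁₆₆ (LeafSupport.mkN (LeafSupport.cm l)) (canon (LeafSupport.mkN (LeafSupport.cm l)) μtop κtop)).ChenWeight2LevelOne ∧
        ¬ (canon₁₆₆ (LeafSupport.mkN (LeafSupport.cm l)) (canon (LeafSupport.mkN (LeafSupport.cm l)) μtop κtop)).ChenThmA5 ∧
        ¬ (canon₁₆₆ (LeafSupport.mkN (LeafSupport.cm l)) (canon (LeafSupport.mkN (LeafSupport.cm l)) μtop κtop)).TangKretShinSpin ∧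
        ¬ (canon₁₆₆ (LeafSupport.mkN (LeafSupport.cm l)) (canon (LeafSupport.mkN (LeafSupport.cm l)) μtop κtop)).TangLemma63) ∧
      ((canon₁₆₆ (LeafSupport.mkN (LeafSupport.cm l)) (canon (LeafSupport.mkN (LeafSupport.cm l)) μtop κtop)).CvdGWeight2Vanishing ∧
        (canon₁₆₆ (LeafSupport.mkN (LeafSupport.cm l)) (canon (LeafSupport.mkN (LeafSupport.cm l)) μtop κtop)).CvdGSmallWeights ∧
        (canon₁₆₆ (LeafSupport.mkN (LeafSupport.cm l)) (canon (LeafSupport.mkN (LeafSupport.cm l)) μtop κtop)).ChenLemmaA3Low ∧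
        (canon₁₆₆ (LeafSupport.mkN (LeafSupport.cm l)) (canon (LeafSupport.mkN (LeafSupport.cm l)) μtop κtop)).ChenAppBYoshida ∧
        (canon₁₆₆ (LeafSupport.mkN (LeafSupport.cm l)) (canon (LeafSupport.mkN (LeafSupport.cm l)) μtop κtop)).TangSpinSystems) :=
  have nb := not_B_cm l
  ⟨(LeafSupport.countermodel l).2.2.1, canon_implications₁₆₆ (LeafSupport.mkN (LeafSupport.cm l)) _,
    ⟨fun h => nb h, fun h => nb h, fun h => nb h, fun h => nb h.1, fun h => nb h.1, fun h => nb h, fun h => nb h⟩,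
    ⟨True.intro, True.intro, True.intro, True.intro, True.intro⟩⟩

/-- ROW C5 IS A GENUINE PREMISE OF THE j = 36, 38 STEP: at the top, with Chenevier – Lannes's starred statements denied (section 104's `c₁noC5`), the bundle holds, Lemma A.3 (j = 36, 38)
and Prop. A.1's second assertion FAIL, while Prop. A.1's first assertion, Lemma A.2, Theorem A.5 and Tang's two statements HOLD (« This Π′ is a selfdual cuspidal representation by [6,
Chap. IX Prop. 1.4] »). [cite: CleryVanDerGeer2018Chenevier, proof of Lemma A.3 (arXiv:1709.01748v1 p0020:L35) (separating model; bookkeeping proved here)] -/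
theorem c166_C5_denied :
    Implications166 νtop c₁noC5 (canon₁₆₆ νtop c₁noC5) ∧
      (¬ (canon₁₆₆ νtop c₁noC5).ChenLemmaA3Top ∧ ¬ (canon₁₆₆ νtop c₁noC5).ChenWeight2LevelOne) ∧
      ((canon₁₆₆ νtop c₁noC5).ChenWeight1LevelOne ∧
        (canon₁₆₆ νtop c₁noC5).ChenLemmaA2 ∧
        (canon₁₆₆ νtop c₁noC5).ChenThmA5 ∧
        (canon₁₆₆ νtop c₁noC5).TangKretShinSpin ∧
        (canon₁₆₆ νtop c₁noC5).TangLemma63) :=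
  have b : ∀ N, νtop.Everything N := bookInputs_top.everything
  ⟨canon_implications₁₆₆ νtop c₁noC5, ⟨fun h => h, fun h => h.2.2⟩, ⟨b, b, ⟨b, True.intro⟩, b, b⟩⟩

/-- ROW C10 IS A GENUINE PREMISE OF TANG's §6: at the top, with Kret – Shin's theorem denied (`c₁noC10`), the bundle holds and §6's statement FAILS while Lemma 6.3 and Chenevier's
statements HOLD (« Therefore, by [kret-shin], … »). [cite: Tang2021SpinMotivic, §6 (arXiv:2006.03585 p0017:L5) (separating model; bookkeeping proved here)] -/
theorem c166_C10_denied :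
    Implications166 νtop c₁noC10 (canon₁₆₆ νtop c₁noC10) ∧
      ¬ (canon₁₆₆ νtop c₁noC10).TangKretShinSpin ∧
      ((canon₁₆₆ νtop c₁noC10).TangLemma63 ∧
        (canon₁₆₆ νtop c₁noC10).ChenWeight1LevelOne ∧
        (canon₁₆₆ νtop c₁noC10).ChenLemmaA2 ∧
        (canon₁₆₆ νtop c₁noC10).ChenLemmaA3Top ∧
        (canon₁₆₆ νtop c₁noC10).ChenWeight2LevelOne ∧
        (canon₁₆₆ νtop c₁noC10).ChenThmA5) :=
  have b : ∀ N, νtop.Everything N := bookInputs_top.everything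
  ⟨canon_implications₁₆₆ νtop c₁noC10, fun h => h, ⟨b, b, b, b, ⟨b, True.intro, b⟩, ⟨b, True.intro⟩⟩⟩

/-- NO MOK / KMSW LEAF: in Mok's countermodel of ANY Mok leaf `l` (the book at the top, KMSW read `κnoMok`, tranche 1 read canonically there) the bundle holds and all seven book-fed fields
HOLD — neither text cites Mok or KMSW (PGSp₄ ≅ SO₅ over ℤ; Sp_{2n} / PSp_{2n} / GSp_{2n} over ℚ). [cite: CleryVanDerGeer2018Chenevier, App. A; Tang2021SpinMotivic, §6 (separating model; bookkeeping proved here)] -/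
theorem c166_mok_cm (l : Mok2015.LeafSupport.Leaf) :
    ¬ (Mok2015.LeafSupport.mkN (Mok2015.LeafSupport.cm l)).leaf l ∧
      Implications166 νtop (canon νtop (Mok2015.LeafSupport.mkN (Mok2015.LeafSupport.cm l)) κnoMok) (canon₁₆₆ νtop (canon νtop (Mok2015.LeafSupport.mkN (Mok2015.LeafSupport.cm l)) κnoMok)) ∧
      (((canon₁₆₆ νtop (canon νtop (Mok2015.LeafSupport.mkN (Mok2015.LeafSupport.cm l)) κnoMok)).ChenWeight1LevelOne ∧
        (canon₁₆₆ νtop (canon νtop (Mok2015.LeafSupport.mkN (Mok2015.LeafSupport.cm l)) κnoMok)).ChenLemmaA2 ∧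
        (canon₁₆₆ νtop (canon νtop (Mok2015.LeafSupport.mkN (Mok2015.LeafSupport.cm l)) κnoMok)).ChenLemmaA3Top ∧
        (canon₁₆₆ νtop (canon νtop (Mok2015.LeafSupport.mkN (Mok2015.LeafSupport.cm l)) κnoMok)).ChenWeight2LevelOne ∧
        (canon₁₆₆ νtop (canon νtop (Mok2015.LeafSupport.mkN (Mok2015.LeafSupport.cm l)) κnoMok)).ChenThmA5) ∧
        ((canon₁₆₆ νtop (canon νtop (Mok2015.LeafSupport.mkN (Mok2015.LeafSupport.cm l)) κnoMok)).TangKretShinSpin ∧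
        (canon₁₆₆ νtop (canon νtop (Mok2015.LeafSupport.mkN (Mok2015.LeafSupport.cm l)) κnoMok)).TangLemma63)) :=
  have b : ∀ N, νtop.Everything N := bookInputs_top.everything
  have Y := canon_implications₁₆₆ νtop (canon νtop (Mok2015.LeafSupport.mkN (Mok2015.LeafSupport.cm l)) κnoMok)
  ⟨(Mok2015.LeafSupport.countermodel l).2.2.1, Y, chenevierTang_of_rows Y b b b⟩

/-- THE HUNDRED-AND-SIXTY-SIXTH TRANCHE REGRADED, in one statement: (i) at the top all seven book-fed fields of rows C320 / C321 hold; (ii) in the book countermodel of any of the 24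
leaves all seven fail; (iii) with C5★ denied at the top, Lemma A.3 (j = 36, 38) fails and Lemma A.2 holds; (iv) with C10 denied at the top, Tang's §6 fails and Lemma 6.3 holds; (v) in
Mok's countermodel of any Mok leaf Theorem A.5 and Lemma 6.3 hold.  Supports, exact: the seven book-fed fields each have support = the 24 book leaves (C5★ / C10 themselves book-supported);
the five controls ∅; no Mok / KMSW leaf. [cite: CleryVanDerGeer2018Chenevier, App. A; Tang2021SpinMotivic, §6, Lemma 6.3 (bookkeeping proved here)] -/
theorem c166_regraded :
    (((canon₁₆₆ νtop (canon νtop μtop κtop)).ChenWeight1LevelOne ∧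
        (canon₁₆₆ νtop (canon νtop μtop κtop)).ChenLemmaA2 ∧
        (canon₁₆₆ νtop (canon νtop μtop κtop)).ChenLemmaA3Top ∧
        (canon₁₆₆ νtop (canon νtop μtop κtop)).ChenWeight2LevelOne ∧
        (canon₁₆₆ νtop (canon νtop μtop κtop)).ChenThmA5) ∧
        ((canon₁₆₆ νtop (canon νtop μtop κtop)).TangKretShinSpin ∧
        (canon₁₆₆ νtop (canon νtop μtop κtop)).TangLemma63)) ∧
      (∀ l : LeafSupport.Leaf, ¬ (LeafSupport.mkN (LeafSupport.cm l)).leaf l ∧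
        (¬ (canon₁₆₆ (LeafSupport.mkN (LeafSupport.cm l)) (canon (LeafSupport.mkN (LeafSupport.cm l)) μtop κtop)).ChenWeight1LevelOne ∧
        ¬ (canon₁₆₆ (LeafSupport.mkN (LeafSupport.cm l)) (canon (LeafSupport.mkN (LeafSupport.cm l)) μtop κtop)).ChenLemmaA2 ∧
        ¬ (canon₁₆₆ (LeafSupport.mkN (LeafSupport.cm l)) (canon (LeafSupport.mkN (LeafSupport.cm l)) μtop κtop)).ChenLemmaA3Top ∧
        ¬ (canon₁₆₆ (LeafSupport.mkN (LeafSupport.cm l)) (canon (LeafSupport.mkN (LeafSupport.cm l)) μtop κtop)).ChenWeight2LevelOne ∧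
        ¬ (canon₁₆₆ (LeafSupport.mkN (LeafSupport.cm l)) (canon (LeafSupport.mkN (LeafSupport.cm l)) μtop κtop)).ChenThmA5 ∧
        ¬ (canon₁₆₆ (LeafSupport.mkN (LeafSupport.cm l)) (canon (LeafSupport.mkN (LeafSupport.cm l)) μtop κtop)).TangKretShinSpin ∧
        ¬ (canon₁₆₆ (LeafSupport.mkN (LeafSupport.cm l)) (canon (LeafSupport.mkN (LeafSupport.cm l)) μtop κtop)).TangLemma63)) ∧
      (¬ (canon₁₆₆ νtop c₁noC5).ChenLemmaA3Top ∧ (canon₁₆₆ νtop c₁noC5).ChenLemmaA2) ∧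
      (¬ (canon₁₆₆ νtop c₁noC10).TangKretShinSpin ∧ (canon₁₆₆ νtop c₁noC10).TangLemma63) ∧
      (∀ l : Mok2015.LeafSupport.Leaf, ¬ (Mok2015.LeafSupport.mkN (Mok2015.LeafSupport.cm l)).leaf l ∧
        (canon₁₆₆ νtop (canon νtop (Mok2015.LeafSupport.mkN (Mok2015.LeafSupport.cm l)) κnoMok)).ChenThmA5 ∧ (canon₁₆₆ νtop (canon νtop (Mok2015.LeafSupport.mkN (Mok2015.LeafSupport.cm l)) κnoMok)).TangLemma63) :=
  ⟨c166_top.2.2,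
    fun l =>
      have h := c166_book_cm l
      ⟨h.1, h.2.2.1⟩,
    ⟨c166_C5_denied.2.1.1, c166_C5_denied.2.2.2.1⟩,
    ⟨c166_C10_denied.2.1, c166_C10_denied.2.2.1⟩,
    fun l =>
      have h := c166_mok_cm l
      ⟨h.1, h.2.2.1.2.2.2.2, h.2.2.2.2⟩⟩

/-! ## 169. Hundred-and-sixty-seventh tranche (v9 of this file, after NEW `Downstream46.lean` v1; unit `pub-arthur-down-g70`, downstream tracer gen 70): supports of NEW row B141
(C. Blondel – G. K.-F. Tam, *Base change for ramified unitary groups: the strongly ramified case*, J. reine angew. Math. 774 (2021) 127–161).  The canonical reading `canon₁₆₇ ν κ`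
over section 13's `canon₁₃ ν κ` (A8-p as printed := the book at every rank ∧ FL ∧ WFL_split ∧ WFL_general ∧ STF_Arthur ∧ KMSW's proved scope), section 14's `canon₁₄ ν` (E41 := its
seven conjuncts) and section 45's `canon₄₅ ν` (E43 := its five published leaves): the two controls := `True`; Theorem 3.9 (quasi-split) := E43's value ∧ E41's value ∧ `True`;
Theorem 3.9 (non-quasi-split) := A8-p's value ∧ `True`; Theorem 3.9 as printed := the conjunction of the two; Remark 3.11 := E43's value ∧ the value of Theorem 3.9 as printed.  Every
tranche-167 edge holds in it for every ν, κ (`canon_implications₁₆₇`).  READINGS: (i) AT THE TOP the bundle holds and all six fields HOLD — delivered by the tranche's own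
`blondelTam_of_inputs` from the canonical bundles of tranches 1, 13, 14, 45 and the top inputs of the three DAGs (`c167_top`); (ii) BOOK SIDE: in the book countermodel of ANY of the
24 leaves the non-quasi-split case, the theorem as printed and Remark 3.11 FAIL (A8-p carries the book at every rank), the two controls hold, and the QUASI-SPLIT case holds iff E43 ∧
E41 do there (`c167_book_cm`) — EXACTLY: iff the removed leaf is none of LLC_GLN, FL, Transfer, InvariantTF, TwistedTF, A11_twisted, W4_Thm38, WFL_general, WFL_nonstandard, MW_Stab
(`c167_QS_cm_iff`, from sections 14 / 45's `moeglinStable_cm_holds` / `_fails`, `moeglinUnitaryDS_cm_holds` / `_fails`); so the quasi-split case HOLDS in the countermodel of each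
2024–2026 PREPRINT leaf while the book's theorems fail there, and FAILS in the countermodels of the two UNWRITTEN weighted fundamental lemmas (`c167_QS_preprint_vs_unwritten`);
(iii) MOK SIDE: in Mok's countermodel of ANY Mok leaf (book at the top, KMSW read `κnoMok`) the quasi-split case HOLDS and the non-quasi-split case, the theorem as printed and
Remark 3.11 FAIL — A8-p's unitary groups are KMSW's, whose proved scope imports Mok (section 16's `thirteenth_mok_cm`) (`c167_mok_cm`); (iv) KMSW SIDE: in KMSW's countermodel of a
leaf `l ≠ MokMain` (book and Mok at the top) the quasi-split case holds and the non-quasi-split case / the theorem as printed hold iff `l` is a sequel-only leaf (`l.onlyFull = true`;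
section 16's `thirteenth_kmsw_cm`) (`c167_kmsw_cm`).  Supports, exact: support(`BTBaseChangeQS`) = the ten book leaves named in (ii) — no book THEOREM, no preprint leaf, no Mok,
no KMSW; support(`BTBaseChangeNQS`) = support(`BTBaseChange`) = support(`BTSingleton`) = the 24 book leaves ∧ Mok's 29 leaves ∧ KMSW's proved-scope leaves (neither sequel);
the two controls ∅. -/

section Canon167

variable (ν : Nodes) (κ : KMSW2014.Nodes)

/-- The canonical reading of NEW row B141 over `canon₁₃ ν κ`, `canon₁₄ ν`, `canon₄₅ ν`. [cite: BlondelTam2021RamifiedBaseChange, Thm 3.9 = Thm 1.1, Thm 3.4, Rem. 3.11, Prop. 3.13 (canonical model; bookkeeping)] [claim: KalethaMinguezShinWhite2014, under-review] -/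
abbrev canon₁₆₇ : Consumers167 where
  BTReducibility := True
  BTBaseChangeQS := (canon₄₅ ν).MoeglinUnitaryDS ∧ (canon₁₄ ν).MoeglinStable ∧ True
  BTBaseChangeNQS := (canon₁₃ ν κ).MRpadic ∧ True
  BTBaseChange := ((canon₄₅ ν).MoeglinUnitaryDS ∧ (canon₁₄ ν).MoeglinStable ∧ True) ∧ ((canon₁₃ ν κ).MRpadic ∧ True)
  BTSingleton := (canon₄₅ ν).MoeglinUnitaryDS ∧ (((canon₄₅ ν).MoeglinUnitaryDS ∧ (canon₁₄ ν).MoeglinStable ∧ True) ∧ ((canon₁₃ ν κ).MRpadic ∧ True))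
  BTParity := True

/-- Every hundred-and-sixty-seventh-tranche edge holds in the canonical reading, for arbitrary ν, κ. [cite: BlondelTam2021RamifiedBaseChange, Thm 3.9, Rem. 3.11 (bookkeeping proved here)] [claim: KalethaMinguezShinWhite2014, under-review] -/
theorem canon_implications₁₆₇ : Implications167 (canon₁₃ ν κ) (canon₁₄ ν) (canon₄₅ ν) (canon₁₆₇ ν κ) where
  reducibility := True.intro
  baseChangeQS := fun a b c => ⟨a, b, c⟩
  baseChangeNQS := fun a c => ⟨a, c⟩
  baseChange := fun q n => ⟨q, n⟩
  singleton := fun a b => ⟨a, b⟩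
  parity := True.intro

end Canon167

/-- AT THE TOP (every atom of the three DAGs true; tranches 1, 13, 14, 45 read canonically): the bundle holds and ALL SIX fields of row B141 HOLD — by the tranche's
`blondelTam_of_inputs` fed with `bookInputs_top`, `mokInputs_top`, `kmswInputs_top μtop`. [cite: BlondelTam2021RamifiedBaseChange, Thm 3.9 = Thm 1.1, Rem. 3.11 (bookkeeping proved here)] [claim: KalethaMinguezShinWhite2014, under-review] -/
theorem c167_top :
    Implications167 (canon₁₃ νtop κtop) (canon₁₄ νtop) (canon₄₅ νtop) (canon₁₆₇ νtop κtop) ∧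
      ((canon₁₆₇ νtop κtop).BTReducibility ∧
        (canon₁₆₇ νtop κtop).BTBaseChangeQS ∧
        (canon₁₆₇ νtop κtop).BTBaseChangeNQS ∧
        (canon₁₆₇ νtop κtop).BTBaseChange ∧
        (canon₁₆₇ νtop κtop).BTSingleton ∧
        (canon₁₆₇ νtop κtop).BTParity) :=
  have Y := canon_implications₁₆₇ νtop κtop
  ⟨Y, blondelTam_of_inputs Y (canon_implications νtop μtop κtop) (canon_implications₁₃ νtop μtop κtop) (canon_implications₁₄ νtop)
    (canon_implications₄₅ νtop μtop κtop) bookInputs_top mokInputs_top (kmswInputs_top μtop).1⟩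

/-- BOOK SIDE: in the book countermodel of ANY of the 24 leaves `l` (tranches 13 / 14 / 45 read canonically there, Mok / KMSW at the top) the bundle holds; the NON-QUASI-SPLIT
case, the theorem AS PRINTED and Remark 3.11 FAIL (A8-p as printed carries the book at every rank); the QUASI-SPLIT case holds iff E43 ∧ E41 hold there; the two controls hold.
[cite: BlondelTam2021RamifiedBaseChange, §1 (VoR p. 130 = `paper-hal-03046916v2/` p0005:L34-35) (separating models; bookkeeping proved here)] [claim: KalethaMinguezShinWhite2014, under-review] -/
theorem c167_book_cm (l : LeafSupport.Leaf) :
    ¬ (LeafSupport.mkN (LeafSupport.cm l)).leaf l ∧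
      Implications167 (canon₁₃ (LeafSupport.mkN (LeafSupport.cm l)) κtop) (canon₁₄ (LeafSupport.mkN (LeafSupport.cm l))) (canon₄₅ (LeafSupport.mkN (LeafSupport.cm l))) (canon₁₆₇ (LeafSupport.mkN (LeafSupport.cm l)) κtop) ∧
      (¬ (canon₁₆₇ (LeafSupport.mkN (LeafSupport.cm l)) κtop).BTBaseChangeNQS ∧
        ¬ (canon₁₆₇ (LeafSupport.mkN (LeafSupport.cm l)) κtop).BTBaseChange ∧
        ¬ (canon₁₆₇ (LeafSupport.mkN (LeafSupport.cm l)) κtop).BTSingleton) ∧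
      ((canon₁₆₇ (LeafSupport.mkN (LeafSupport.cm l)) κtop).BTBaseChangeQS ↔
        ((canon₄₅ (LeafSupport.mkN (LeafSupport.cm l))).MoeglinUnitaryDS ∧ (canon₁₄ (LeafSupport.mkN (LeafSupport.cm l))).MoeglinStable)) ∧
      ((canon₁₆₇ (LeafSupport.mkN (LeafSupport.cm l)) κtop).BTReducibility ∧
        (canon₁₆₇ (LeafSupport.mkN (LeafSupport.cm l)) κtop).BTParity) :=
  have nb := not_B_cm l
  ⟨(LeafSupport.countermodel l).2.2.1, canon_implications₁₆₇ _ _,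
    ⟨fun h => nb h.1.1, fun h => nb h.2.1.1, fun h => nb h.2.2.1.1⟩,
    ⟨fun h => ⟨h.1, h.2.1⟩, fun e => ⟨e.1, e.2, True.intro⟩⟩, ⟨True.intro, True.intro⟩⟩

/-- THE QUASI-SPLIT CASE, EXACT SUPPORT AS TYPED: in the book countermodel removing the leaf `l`, Theorem 3.9 for quasi-split U(V) holds if and only if `l` is none of E43's five
leaves (LLC_GLN, FL, Transfer, InvariantTF, TwistedTF — section 45) and none of E41's eight (A11_twisted, W4_Thm38, WFL_general, WFL_nonstandard, FL, TwistedTF, MW_Stab, LLC_GLN —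
section 14; WFL_general through the derived `TWFL`): ten leaves in all, the two UNWRITTEN weighted fundamental lemmas among them, NO 2024–2026 preprint leaf, no book theorem.
[cite: BlondelTam2021RamifiedBaseChange, §1 (VoR p0005:L34 « [38, 4. Proposition], [39, Theorem 3.2.1] for quasi-split groups »); Moeglin2007Unitary; Moeglin2014Stable (bookkeeping proved here)] -/
theorem c167_QS_cm_iff (l : LeafSupport.Leaf) :
    (canon₁₆₇ (LeafSupport.mkN (LeafSupport.cm l)) κtop).BTBaseChangeQS ↔
      (l ≠ .LLC_GLN ∧ l ≠ .FL ∧ l ≠ .Transfer ∧ l ≠ .InvariantTF ∧ l ≠ .TwistedTF ∧ l ≠ .A11_twisted ∧ l ≠ .W4_Thm38 ∧ l ≠ .WFL_general ∧ l ≠ .WFL_nonstandard ∧ l ≠ .MW_Stab) := by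
  constructor
  · intro h
    exact ⟨fun e => by subst e; exact (moeglinUnitaryDS_cm_fails .LLC_GLN (.inl rfl)).2 h.1,
      fun e => by subst e; exact (moeglinUnitaryDS_cm_fails .FL (.inr (.inl rfl))).2 h.1,
      fun e => by subst e; exact (moeglinUnitaryDS_cm_fails .Transfer (.inr (.inr (.inl rfl)))).2 h.1,
      fun e => by subst e; exact (moeglinUnitaryDS_cm_fails .InvariantTF (.inr (.inr (.inr (.inl rfl))))).2 h.1,
      fun e => by subst e; exact (moeglinUnitaryDS_cm_fails .TwistedTF (.inr (.inr (.inr (.inr rfl))))).2 h.1,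
      fun e => by subst e; exact (moeglinStable_cm_fails .A11_twisted (.inl rfl)).2 h.2.1,
      fun e => by subst e; exact (moeglinStable_cm_fails .W4_Thm38 (.inr (.inl rfl))).2 h.2.1,
      fun e => by subst e; exact (moeglinStable_cm_fails .WFL_general (.inr (.inr (.inl rfl)))).2 h.2.1,
      fun e => by subst e; exact (moeglinStable_cm_fails .WFL_nonstandard (.inr (.inr (.inr (.inl rfl))))).2 h.2.1,
      fun e => by subst e; exact (moeglinStable_cm_fails .MW_Stab (.inr (.inr (.inr (.inr (.inr (.inr (.inl rfl)))))))).2 h.2.1⟩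
  · intro ⟨n1, n2, n3, n4, n5, n6, n7, n8, n9, n10⟩
    exact ⟨moeglinUnitaryDS_cm_holds l n1 n2 n3 n4 n5, moeglinStable_cm_holds l n6 n7 n8 n9 n2 n5 n10 n1, True.intro⟩

/-- THE QUASI-SPLIT CASE ACROSS THE BOOK's OPEN RESIDUE: in the countermodel of each of the seven 2024–2026 PREPRINT leaves (AGIKMS Thm 1.8.1 / 1.9.1 / 1.10.5 / Cor. D.2.1 / App. E,
[KM26], [CK26]) Theorem 3.9 for quasi-split U(V) HOLDS while the book's theorems fail at every rank; in the countermodels of the two UNWRITTEN weighted fundamental lemmas it FAILS.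
[cite: BlondelTam2021RamifiedBaseChange, Thm 3.9 (bookkeeping proved here)] -/
theorem c167_QS_preprint_vs_unwritten :
    (∀ l : LeafSupport.Leaf, (l = .AGIKMS_181 ∨ l = .AGIKMS_191 ∨ l = .AGIKMS_1105 ∨ l = .AGIKMS_D21 ∨ l = .AGIKMS_AppE ∨ l = .KM26 ∨ l = .CK26) →
        (canon₁₆₇ (LeafSupport.mkN (LeafSupport.cm l)) κtop).BTBaseChangeQS ∧ ¬ ∀ N, (LeafSupport.mkN (LeafSupport.cm l)).Everything N) ∧
      (¬ (canon₁₆₇ (LeafSupport.mkN (LeafSupport.cm .WFL_general)) κtop).BTBaseChangeQS ∧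
        ¬ (canon₁₆₇ (LeafSupport.mkN (LeafSupport.cm .WFL_nonstandard)) κtop).BTBaseChangeQS) := by
  refine ⟨fun l hl => ⟨?_, not_B_cm l⟩, fun h => ((c167_QS_cm_iff _).1 h).2.2.2.2.2.2.2.1 rfl, fun h => ((c167_QS_cm_iff _).1 h).2.2.2.2.2.2.2.2.1 rfl⟩
  rcases hl with rfl | rfl | rfl | rfl | rfl | rfl | rfl <;>
    exact (c167_QS_cm_iff _).2 ⟨by decide, by decide, by decide, by decide, by decide, by decide, by decide, by decide, by decide, by decide⟩

/-- MOK SIDE: in Mok's countermodel of ANY Mok leaf `l` (the book at the top, KMSW read `κnoMok`; tranches 13 / 14 / 45 read canonically there) the bundle holds, the QUASI-SPLIT case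
HOLDS, and the NON-QUASI-SPLIT case, the theorem AS PRINTED and Remark 3.11 FAIL — « [40, 8.3.5] for non-quasi-split groups » = A8-p as printed, whose unitary groups are KMSW's, whose
proved scope imports Mok (section 16). [cite: BlondelTam2021RamifiedBaseChange, §1 (VoR p0005:L34-35); MoeglinRenard2018, p0008:L37-38 (separating models; bookkeeping proved here)] [claim: KalethaMinguezShinWhite2014, under-review] -/
theorem c167_mok_cm (l : Mok2015.LeafSupport.Leaf) :
    ¬ (Mok2015.LeafSupport.mkN (Mok2015.LeafSupport.cm l)).leaf l ∧
      Implications167 (canon₁₃ νtop κnoMok) (canon₁₄ νtop) (canon₄₅ νtop) (canon₁₆₇ νtop κnoMok) ∧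
      (canon₁₆₇ νtop κnoMok).BTBaseChangeQS ∧
      (¬ (canon₁₆₇ νtop κnoMok).BTBaseChangeNQS ∧
        ¬ (canon₁₆₇ νtop κnoMok).BTBaseChange ∧
        ¬ (canon₁₆₇ νtop κnoMok).BTSingleton) :=
  have nP : ¬ (canon₁₃ νtop κnoMok).MRpadic := (thirteenth_mok_cm l).2.2.2.2.2.1.1
  have q : (canon₁₆₇ νtop κnoMok).BTBaseChangeQS :=
    ⟨moeglinUnitaryDS_of_inputs (canon_implications₄₅ νtop μtop κtop) bookInputs_top, fourteenth_holds_top, True.intro⟩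
  ⟨(Mok2015.LeafSupport.countermodel l).2.2.1, canon_implications₁₆₇ νtop κnoMok, q,
    ⟨fun h => nP h.1, fun h => nP h.2.1, fun h => nP h.2.2.1⟩⟩

/-- KMSW SIDE: in KMSW's countermodel of a leaf `l ≠ MokMain` (book and Mok at the top; tranches 13 / 14 / 45 read canonically there) the bundle holds, the quasi-split case HOLDS, and the
non-quasi-split case and the theorem as printed hold iff `l` is a sequel-only leaf (`l.onlyFull = true`): KMSW's proved-scope leaves are load-bearing through A8-p, its unwritten sequels
[KMS_A] / [KMS_B] (and `AubertSS`) are not. [claim: KalethaMinguezShinWhite2014, under-review] [cite: BlondelTam2021RamifiedBaseChange, §1 (VoR p0005:L34-35) (separating models; bookkeeping proved here)] -/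
theorem c167_kmsw_cm (l : KMSW2014.LeafSupport.Leaf) (hl : l ≠ .MokMain) :
    ¬ (KMSW2014.LeafSupport.mkN (KMSW2014.LeafSupport.cm l)).leaf l ∧
      Implications167 (canon₁₃ νtop (KMSW2014.LeafSupport.mkN (KMSW2014.LeafSupport.cm l))) (canon₁₄ νtop) (canon₄₅ νtop) (canon₁₆₇ νtop (KMSW2014.LeafSupport.mkN (KMSW2014.LeafSupport.cm l))) ∧
      (canon₁₆₇ νtop (KMSW2014.LeafSupport.mkN (KMSW2014.LeafSupport.cm l))).BTBaseChangeQS ∧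
      ((canon₁₆₇ νtop (KMSW2014.LeafSupport.mkN (KMSW2014.LeafSupport.cm l))).BTBaseChangeNQS ↔ l.onlyFull = true) ∧
      ((canon₁₆₇ νtop (KMSW2014.LeafSupport.mkN (KMSW2014.LeafSupport.cm l))).BTBaseChange ↔ l.onlyFull = true) :=
  have e := (thirteenth_kmsw_cm l hl).2.2.2.2.2.1
  have q : (canon₁₆₇ νtop (KMSW2014.LeafSupport.mkN (KMSW2014.LeafSupport.cm l))).BTBaseChangeQS :=
    ⟨moeglinUnitaryDS_of_inputs (canon_implications₄₅ νtop μtop κtop) bookInputs_top, fourteenth_holds_top, True.intro⟩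
  ⟨(KMSW2014.LeafSupport.countermodel l).2.2.1, canon_implications₁₆₇ _ _, q,
    ⟨fun h => e.1 h.1, fun o => ⟨e.2 o, True.intro⟩⟩,
    ⟨fun h => e.1 h.2.1, fun o => ⟨q, e.2 o, True.intro⟩⟩⟩

/-- THE HUNDRED-AND-SIXTY-SEVENTH TRANCHE REGRADED, in one statement: (i) at the top all six fields of row B141 hold; (ii) in the book countermodel of any of the 24 leaves the
non-quasi-split case, the theorem as printed and Remark 3.11 fail, and the quasi-split case holds iff the leaf is outside the ten of `c167_QS_cm_iff`; (iii) in Mok's countermodel of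
any Mok leaf the quasi-split case holds and the theorem as printed fails; (iv) in KMSW's countermodel of a leaf `l ≠ MokMain` the theorem as printed holds iff `l.onlyFull = true`.
Supports, exact: support(Thm 3.9, quasi-split) = ten book leaves (E43 ∪ E41); support(Thm 3.9, non-quasi-split) = support(Thm 3.9 as printed) = support(Rem. 3.11) = the 24 book leaves ∧
Mok's 29 leaves ∧ KMSW's proved-scope leaves; controls ∅. [cite: BlondelTam2021RamifiedBaseChange, Thm 3.9 = Thm 1.1, Rem. 3.11 (bookkeeping proved here)] [claim: KalethaMinguezShinWhite2014, under-review] -/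
theorem c167_regraded :
    ((canon₁₆₇ νtop κtop).BTReducibility ∧
        (canon₁₆₇ νtop κtop).BTBaseChangeQS ∧
        (canon₁₆₇ νtop κtop).BTBaseChangeNQS ∧
        (canon₁₆₇ νtop κtop).BTBaseChange ∧
        (canon₁₆₇ νtop κtop).BTSingleton ∧
        (canon₁₆₇ νtop κtop).BTParity) ∧
      (∀ l : LeafSupport.Leaf, ¬ (LeafSupport.mkN (LeafSupport.cm l)).leaf l ∧
        (¬ (canon₁₆₇ (LeafSupport.mkN (LeafSupport.cm l)) κtop).BTBaseChangeNQS ∧ ¬ (canon₁₆₇ (LeafSupport.mkN (LeafSupport.cm l)) κtop).BTBaseChange ∧ ¬ (canon₁₆₇ (LeafSupport.mkN (LeafSupport.cm l)) κtop).BTSingleton) ∧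
        ((canon₁₆₇ (LeafSupport.mkN (LeafSupport.cm l)) κtop).BTBaseChangeQS ↔
          (l ≠ .LLC_GLN ∧ l ≠ .FL ∧ l ≠ .Transfer ∧ l ≠ .InvariantTF ∧ l ≠ .TwistedTF ∧ l ≠ .A11_twisted ∧ l ≠ .W4_Thm38 ∧ l ≠ .WFL_general ∧ l ≠ .WFL_nonstandard ∧ l ≠ .MW_Stab))) ∧
      (∀ l : Mok2015.LeafSupport.Leaf, ¬ (Mok2015.LeafSupport.mkN (Mok2015.LeafSupport.cm l)).leaf l ∧
        (canon₁₆₇ νtop κnoMok).BTBaseChangeQS ∧ ¬ (canon₁₆₇ νtop κnoMok).BTBaseChange) ∧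
      (∀ l : KMSW2014.LeafSupport.Leaf, l ≠ .MokMain → ((canon₁₆₇ νtop (KMSW2014.LeafSupport.mkN (KMSW2014.LeafSupport.cm l))).BTBaseChange ↔ l.onlyFull = true)) :=
  ⟨c167_top.2,
    fun l =>
      have h := c167_book_cm l
      ⟨h.1, h.2.2.1, c167_QS_cm_iff l⟩,
    fun l =>
      have h := c167_mok_cm l
      ⟨h.1, h.2.2.1, h.2.2.2.2.1⟩,
    fun l hl => (c167_kmsw_cm l hl).2.2.2.2⟩

/-! ## 170. Hundred-and-sixty-eighth tranche (v10 of this file, after `Downstream46.lean` v2; unit `pub-arthur-down-g70`, downstream tracer gen 70): supports of NEW rows C322 (M. Dittmann –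
R. Salvati Manni – N. R. Scheithauer, Algebra Number Theory 15 (2021) 271–285) and C323 (R. Hain, Forum Math. Sigma 13 (2025)).  The canonical reading `canon₁₆₈ c` over an ARBITRARY
tranche-1 assignment `c : Consumers`, of which only `TaibiDim` (row C4) and `ChenevierTaibi` (row C6) are read: the four controls (and Corollary 5.3, fed by a control) := `True`; Theorem 4.3 :=
`c.TaibiDim` ∧ `True`; the vanishing of H⁰(Ā₆, ω) := `c.ChenevierTaibi`; Hain's Theorem 2 and Corollary 3 := `c.TaibiDim`.  Every tranche-168 edge holds in it (`canon_implications₁₆₈`).  READINGS: (i)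
AT THE TOP (`canon νtop μtop κtop`: C4 and C6 take the book's value) the bundle holds and all eight fields HOLD (`c168_top`, by the tranche's `dsmsHain_of_rows`); (ii) BOOK SIDE: in each of the 24
book countermodels (tranche 1 read canonically there) the four book-fed fields all FAIL and the four controls hold (`c168_book_cm`); (iii) ROW C4 IS A GENUINE PREMISE: at the top with Taïbi's
dimension formula denied (`c₁noC4`, defined here like sections 104 / 118's `c₁noC5` / `c₁noC6`) Theorem 4.3, Hain's Theorem 2 and Corollary 3 FAIL while the C6-fed statement HOLDS
(`c168_C4_denied`); (iv) ROW C6 IS A GENUINE PREMISE of the ω-statement only: with Chenevier – Taïbi's tables denied (section 118's `c₁noC6`) it FAILS while the three C4-fed statements HOLD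
(`c168_C6_denied`); (v) NO MOK / KMSW: in Mok's countermodel of any Mok leaf (book at the top, KMSW read `κnoMok`, tranche 1 read canonically there) all eight fields HOLD (`c168_mok_cm`).
Supports, exact: support(`DSMSBasis`) = support(`HainGGgenus3`) = support(`HainHypRank1`) = support(C4) = the 24 book leaves and support(`DSMSNoCanonical`) = support(C6) = the 24 book leaves
(sections 1 – 3 of `DownstreamSupport.lean`); the four controls: ∅.  No Mok / KMSW leaf anywhere in the tranche.  This section CLOSES `DownstreamSupport18.lean` (≈ 80 % of the byte
bound); the next support section opens `DownstreamSupport19.lean` (module M312). -/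

section Canon168

/-- The canonical reading of NEW rows C322 / C323 over an arbitrary tranche-1 assignment. [cite: DittmannSalvatiManniScheithauer2021, Thms 4.3, 5.2, Cor. 5.3, §5; Hain2025CeresaRank, Thms 1, 2, Cor. 3 (canonical model; bookkeeping)] -/
abbrev canon₁₆₈ (c : Consumers) : Consumers168 where
  DSMSIndependence := True
  DSMSBasis := c.TaibiDim ∧ True
  DSMSKodaira := True
  DSMSNoCanonical := c.ChenevierTaibi
  DSMSUnirational := True
  HainMaxRank := True
  HainGGgenus3 := c.TaibiDim
  HainHypRank1 := c.TaibiDim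

/-- Every hundred-and-sixty-eighth-tranche edge holds in the canonical reading, for an arbitrary tranche-1 assignment. [cite: DittmannSalvatiManniScheithauer2021, Thm 4.3, §5; Hain2025CeresaRank, Thm 2, Cor. 3 (bookkeeping proved here)] -/
theorem canon_implications₁₆₈ (c : Consumers) : Implications168 c (canon₁₆₈ c) where
  dsmsIndep := True.intro
  dsmsBasis := fun h i => ⟨h, i⟩
  dsmsKodaira := True.intro
  dsmsNoCanonical := fun h => h
  dsmsUnirational := fun _ => True.intro
  hainMaxRank := True.intro
  hainGG := fun h => h
  hainHyp := fun h => h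

end Canon168

/-- Row C4 DENIED (`TaibiDim := False`; the other tranche-1 fields as in `canon` at the top): a reading of `Consumers` used only to deny Taïbi's level-one dimension formula; no first-tranche edge is claimed for it (defined like sections 104 / 118's `c₁noC5` / `c₁noC6`). [cite: Taibi2017, dimension formulas of §§4–5 (separating model; bookkeeping)] -/
abbrev c₁noC4 : Consumers := { canon νtop μtop κtop with TaibiDim := False }

/-- AT THE TOP (the book's every leaf granted; tranche 1 read canonically, so C4 and C6 hold by sections 1 – 3): the bundle holds and ALL EIGHT fields of rows C322 / C323 HOLD — by the
tranche's `hundredsixtyeighth_controls` and `dsmsHain_of_rows`. [cite: DittmannSalvatiManniScheithauer2021, Thm 4.3, §5; Hain2025CeresaRank, Thm 2, Cor. 3 (bookkeeping proved here)] -/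
theorem c168_top :
    Implications168 (canon νtop μtop κtop) (canon₁₆₈ (canon νtop μtop κtop)) ∧
      ((canon₁₆₈ (canon νtop μtop κtop)).DSMSIndependence ∧
        (canon₁₆₈ (canon νtop μtop κtop)).DSMSKodaira ∧
        (canon₁₆₈ (canon νtop μtop κtop)).DSMSUnirational ∧
        (canon₁₆₈ (canon νtop μtop κtop)).HainMaxRank) ∧
      (((canon₁₆₈ (canon νtop μtop κtop)).DSMSBasis ∧
        (canon₁₆₈ (canon νtop μtop κtop)).DSMSNoCanonical) ∧
        ((canon₁₆₈ (canon νtop μtop κtop)).HainGGgenus3 ∧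
        (canon₁₆₈ (canon νtop μtop κtop)).HainHypRank1)) :=
  have I := canon_implications νtop μtop κtop
  have Y := canon_implications₁₆₈ (canon νtop μtop κtop)
  ⟨Y, hundredsixtyeighth_controls Y, dsmsHain_of_rows Y (taibiDim_of_leaves I bookInputs_top) (chenevierTaibi_of_leaves I bookInputs_top)⟩

/-- BOOK SIDE: in the book countermodel of ANY of the 24 leaves `l` (tranche 1 read canonically there, Mok / KMSW at the top) the bundle holds, the FOUR book-fed fields all FAIL and the four
controls hold — every book leaf is load-bearing for Theorem 4.3 and for Hain's Theorem 2 / Corollary 3 (through Taïbi's dimension formula) and for the ω-statement (through Chenevier – Taïbi's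
tables). [cite: DittmannSalvatiManniScheithauer2021, Thm 4.3 (arXiv:1909.07062 p0007:L88), §5 (p0008:L42); Hain2025CeresaRank, Thm 3.2 proof (arXiv:2408.07809 p0022:L4) (separating models; bookkeeping proved here)] -/
theorem c168_book_cm (l : LeafSupport.Leaf) :
    ¬ (LeafSupport.mkN (LeafSupport.cm l)).leaf l ∧
      Implications168 (canon (LeafSupport.mkN (LeafSupport.cm l)) μtop κtop) (canon₁₆₈ (canon (LeafSupport.mkN (LeafSupport.cm l)) μtop κtop)) ∧
      (¬ (canon₁₆₈ (canon (LeafSupport.mkN (LeafSupport.cm l)) μtop κtop)).DSMSBasis ∧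
        ¬ (canon₁₆₈ (canon (LeafSupport.mkN (LeafSupport.cm l)) μtop κtop)).DSMSNoCanonical ∧
        ¬ (canon₁₆₈ (canon (LeafSupport.mkN (LeafSupport.cm l)) μtop κtop)).HainGGgenus3 ∧
        ¬ (canon₁₆₈ (canon (LeafSupport.mkN (LeafSupport.cm l)) μtop κtop)).HainHypRank1) ∧
      ((canon₁₆₈ (canon (LeafSupport.mkN (LeafSupport.cm l)) μtop κtop)).DSMSIndependence ∧
        (canon₁₆₈ (canon (LeafSupport.mkN (LeafSupport.cm l)) μtop κtop)).DSMSKodaira ∧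
        (canon₁₆₈ (canon (LeafSupport.mkN (LeafSupport.cm l)) μtop κtop)).DSMSUnirational ∧
        (canon₁₆₈ (canon (LeafSupport.mkN (LeafSupport.cm l)) μtop κtop)).HainMaxRank) :=
  have nb := not_B_cm l
  ⟨(LeafSupport.countermodel l).2.2.1, canon_implications₁₆₈ _,
    ⟨fun h => nb h.1, fun h => nb h, fun h => nb h, fun h => nb h⟩,
    ⟨True.intro, True.intro, True.intro, True.intro⟩⟩

/-- ROW C4 IS A GENUINE PREMISE: at the top, with Taïbi's dimension formula denied (`c₁noC4`), the bundle holds; Theorem 4.3, Hain's Theorem 2 and Corollary 3 FAIL, while the C6-fed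
ω-statement and the controls HOLD (« Taïbi showed that the dimension … is 9 … This implies »; « Taïbi [taibi] has shown that the space of Siegel cusp forms of weight (4,0,8) is one dimensional »).
[cite: DittmannSalvatiManniScheithauer2021, Thm 4.3 (arXiv:1909.07062 p0007:L88-91); Hain2025CeresaRank, Thm 3.2 proof (arXiv:2408.07809 p0022:L4) (separating model; bookkeeping proved here)] -/
theorem c168_C4_denied :
    Implications168 c₁noC4 (canon₁₆₈ c₁noC4) ∧
      (¬ (canon₁₆₈ c₁noC4).DSMSBasis ∧ ¬ (canon₁₆₈ c₁noC4).HainGGgenus3 ∧ ¬ (canon₁₆₈ c₁noC4).HainHypRank1) ∧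
      ((canon₁₆₈ c₁noC4).DSMSNoCanonical ∧ (canon₁₆₈ c₁noC4).DSMSKodaira ∧ (canon₁₆₈ c₁noC4).HainMaxRank) :=
  have b : ∀ N, νtop.Everything N := bookInputs_top.everything
  ⟨canon_implications₁₆₈ c₁noC4, ⟨fun h => h.1, fun h => h, fun h => h⟩, ⟨b, True.intro, True.intro⟩⟩

/-- ROW C6 IS A GENUINE PREMISE OF THE ω-STATEMENT ONLY: at the top, with Chenevier – Taïbi's tables denied (section 118's `c₁noC6`), the bundle holds; « ω_{Ā₆} has no non-trivial sections »
FAILS, while Theorem 4.3 and Hain's statements HOLD (« According to Table 6 in [CT] … »). [cite: DittmannSalvatiManniScheithauer2021, §5 (arXiv:1909.07062 p0008:L42) (separating model; bookkeeping proved here)] -/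
theorem c168_C6_denied :
    Implications168 c₁noC6 (canon₁₆₈ c₁noC6) ∧
      ¬ (canon₁₆₈ c₁noC6).DSMSNoCanonical ∧
      ((canon₁₆₈ c₁noC6).DSMSBasis ∧
        (canon₁₆₈ c₁noC6).HainGGgenus3 ∧
        (canon₁₆₈ c₁noC6).HainHypRank1) :=
  have b : ∀ N, νtop.Everything N := bookInputs_top.everything
  ⟨canon_implications₁₆₈ c₁noC6, fun h => h, ⟨⟨b, True.intro⟩, b, b⟩⟩

/-- NO MOK / KMSW LEAF: in Mok's countermodel of ANY Mok leaf `l` (the book at the top, KMSW read `κnoMok`, tranche 1 read canonically there) the bundle holds and all four book-fed fields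
HOLD — neither text cites Mok or KMSW (Sp₁₂(ℤ); Sp₆(ℤ)). [cite: DittmannSalvatiManniScheithauer2021, Thm 4.3, §5; Hain2025CeresaRank, Thm 2 (separating model; bookkeeping proved here)] -/
theorem c168_mok_cm (l : Mok2015.LeafSupport.Leaf) :
    ¬ (Mok2015.LeafSupport.mkN (Mok2015.LeafSupport.cm l)).leaf l ∧
      Implications168 (canon νtop (Mok2015.LeafSupport.mkN (Mok2015.LeafSupport.cm l)) κnoMok) (canon₁₆₈ (canon νtop (Mok2015.LeafSupport.mkN (Mok2015.LeafSupport.cm l)) κnoMok)) ∧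
      (((canon₁₆₈ (canon νtop (Mok2015.LeafSupport.mkN (Mok2015.LeafSupport.cm l)) κnoMok)).DSMSBasis ∧
        (canon₁₆₈ (canon νtop (Mok2015.LeafSupport.mkN (Mok2015.LeafSupport.cm l)) κnoMok)).DSMSNoCanonical) ∧
        ((canon₁₆₈ (canon νtop (Mok2015.LeafSupport.mkN (Mok2015.LeafSupport.cm l)) κnoMok)).HainGGgenus3 ∧
        (canon₁₆₈ (canon νtop (Mok2015.LeafSupport.mkN (Mok2015.LeafSupport.cm l)) κnoMok)).HainHypRank1)) :=
  have b : ∀ N, νtop.Everything N := bookInputs_top.everything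
  have Y := canon_implications₁₆₈ (canon νtop (Mok2015.LeafSupport.mkN (Mok2015.LeafSupport.cm l)) κnoMok)
  ⟨(Mok2015.LeafSupport.countermodel l).2.2.1, Y, dsmsHain_of_rows Y b b⟩

/-- THE HUNDRED-AND-SIXTY-EIGHTH TRANCHE REGRADED, in one statement: (i) at the top all four book-fed fields of rows C322 / C323 hold; (ii) in the book countermodel of any of the 24 leaves all
four fail; (iii) with C4 denied at the top Theorem 4.3 and Hain's Theorem 2 fail and the ω-statement holds; (iv) with C6 denied at the top the ω-statement fails and Theorem 4.3 holds; (v) in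
Mok's countermodel of any Mok leaf Theorem 4.3 and Hain's Theorem 2 hold.  Supports, exact: the four book-fed fields each have support = the 24 book leaves (C4 / C6 themselves
book-supported); the four controls ∅; no Mok / KMSW leaf. [cite: DittmannSalvatiManniScheithauer2021, Thm 4.3, §5; Hain2025CeresaRank, Thm 2, Cor. 3 (bookkeeping proved here)] -/
theorem c168_regraded :
    (((canon₁₆₈ (canon νtop μtop κtop)).DSMSBasis ∧
        (canon₁₆₈ (canon νtop μtop κtop)).DSMSNoCanonical) ∧
        ((canon₁₆₈ (canon νtop μtop κtop)).HainGGgenus3 ∧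
        (canon₁₆₈ (canon νtop μtop κtop)).HainHypRank1)) ∧
      (∀ l : LeafSupport.Leaf, ¬ (LeafSupport.mkN (LeafSupport.cm l)).leaf l ∧
        (¬ (canon₁₆₈ (canon (LeafSupport.mkN (LeafSupport.cm l)) μtop κtop)).DSMSBasis ∧
        ¬ (canon₁₆₈ (canon (LeafSupport.mkN (LeafSupport.cm l)) μtop κtop)).DSMSNoCanonical ∧
        ¬ (canon₁₆₈ (canon (LeafSupport.mkN (LeafSupport.cm l)) μtop κtop)).HainGGgenus3 ∧
        ¬ (canon₁₆₈ (canon (LeafSupport.mkN (LeafSupport.cm l)) μtop κtop)).HainHypRank1)) ∧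
      (¬ (canon₁₆₈ c₁noC4).DSMSBasis ∧ ¬ (canon₁₆₈ c₁noC4).HainGGgenus3 ∧ (canon₁₆₈ c₁noC4).DSMSNoCanonical) ∧
      (¬ (canon₁₆₈ c₁noC6).DSMSNoCanonical ∧ (canon₁₆₈ c₁noC6).DSMSBasis) ∧
      (∀ l : Mok2015.LeafSupport.Leaf, ¬ (Mok2015.LeafSupport.mkN (Mok2015.LeafSupport.cm l)).leaf l ∧
        (canon₁₆₈ (canon νtop (Mok2015.LeafSupport.mkN (Mok2015.LeafSupport.cm l)) κnoMok)).DSMSBasis ∧ (canon₁₆₈ (canon νtop (Mok2015.LeafSupport.mkN (Mok2015.LeafSupport.cm l)) κnoMok)).HainGGgenus3) :=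
  ⟨c168_top.2.2,
    fun l =>
      have h := c168_book_cm l
      ⟨h.1, h.2.2.1⟩,
    ⟨c168_C4_denied.2.1.1, c168_C4_denied.2.1.2.1, c168_C4_denied.2.2.1⟩,
    ⟨c168_C6_denied.2.1, c168_C6_denied.2.2.1⟩,
    fun l =>
      have h := c168_mok_cm l
      ⟨h.1, h.2.2.1.1, h.2.2.2.1⟩⟩

end Support

end Downstream

end Literature.NumberTheory.Automorphic.Arthur2013
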